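import Summits.AtomisticToContinuum.Crystallization.Theses.HullExactificationCascade
import Summits.AtomisticToContinuum.Crystallization.Theses.HcpDefectCounting
import Literature.MathematicalPhysics.StatisticalMechanics.LocalMatchingCompactness
import Summits.AtomisticToContinuum.Crystallization.Theorems.HullExactificationCascadeHcpLandscapeGapStubBoxMinimiser
import Summits.AtomisticToContinuum.Crystallization.Theorems.HullExactificationCascadeHcpLandscapeGapStubBoundaryLayer
import Summits.AtomisticToContinuum.Crystallization.Theorems.HullExactificationCascadeHcpLandscapeGapMasterOf
import Summits.AtomisticToContinuum.Crystallization.Theorems.HullExactificationCascadeHcpLandscapeGapStubBoxMinimiserRigid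
import Summits.AtomisticToContinuum.Crystallization.Theorems.HullExactificationCascadeHcpLandscapeGapStubShellGeometry
import Summits.AtomisticToContinuum.Crystallization.Theorems.HullExactificationCascadeHcpLandscapeGapGlueCore
import Summits.AtomisticToContinuum.Crystallization.Theorems.PricedLinkCensusStackingHingeLjRegistryDomination
import Summits.AtomisticToContinuum.Crystallization.Theorems.PricedLinkCensusStackingHingeBarlowEnergyIdentification
import Summits.AtomisticToContinuum.Crystallization.Theorems.PricedLinkCensusStackingHingeHcpEnergyMinOnBox
import Summits.AtomisticToContinuum.Crystallization.Theorems.MinMeanCycleStackingLockHaggEnergyPeriodic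
import Summits.AtomisticToContinuum.Crystallization.Theorems.HullExactificationCascadeHcpLandscapeGapStubDominatedRegistrySelectsHcp
import Summits.AtomisticToContinuum.Crystallization.Theorems.HullExactificationCascadeHcpLandscapeGapOfPeriodicReduction
import Summits.AtomisticToContinuum.Crystallization.Theorems.HullExactificationCascadeRobustBarlowTemplateDefs
import Summits.AtomisticToContinuum.Crystallization.Theorems.HullExactificationCascadeHcpLandscapeGapOfTemplatedCoercivity
import Summits.AtomisticToContinuum.Crystallization.Theorems.ReggeStarCoercivityDefectFreeCrystallizesSiteColumnLJ
import Summits.AtomisticToContinuum.Crystallization.Theorems.PricedLinkCensusStackingHingeHcpBoxModulus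
import Summits.AtomisticToContinuum.Crystallization.Theorems.PricedLinkCensusStackingHingeJ2Neg
import Summits.AtomisticToContinuum.Crystallization.Theorems.PricedLinkCensusStackingHingeLjDomination
import Summits.AtomisticToContinuum.Crystallization.Theorems.PricedLinkCensusStackingHingeUnmatchedNearBadBond
import Literature.MathematicalPhysics.StatisticalMechanics.HcpHomogeneous
import Summits.AtomisticToContinuum.Crystallization.Theorems.HullExactificationCascadeHcpLandscapeGapStubGoodOfNoBadBond
import Summits.AtomisticToContinuum.Crystallization.Theorems.HullExactificationCascadeHcpLandscapeGapStubChargeToBadBond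
import Summits.AtomisticToContinuum.Crystallization.Theorems.HullExactificationCascadeHcpLandscapeGapStubExactWindowEnergy
import Summits.AtomisticToContinuum.Crystallization.Theorems.HullExactificationCascadeHcpLandscapeGapExactBarlowPricing
import Summits.AtomisticToContinuum.Crystallization.Theorems.HullExactificationCascadeHcpLandscapeGapStubPeriodiseWindow
import Summits.AtomisticToContinuum.Crystallization.Theorems.HullExactificationCascadeHcpLandscapeGapExactBarlowPricingAllWords
import Summits.AtomisticToContinuum.Crystallization.Theorems.HullExactificationCascadeHcpLandscapeGapExactBarlowClass
import Literature.MathematicalPhysics.StatisticalMechanics.BarlowStackingHeights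
import Literature.MathematicalPhysics.StatisticalMechanics.BarlowStackingEnergy
import Summits.AtomisticToContinuum.Crystallization.Theorems.HullExactificationCascadeHcpLandscapeGapStubSiteEnergyHeights
import Summits.AtomisticToContinuum.Crystallization.Theorems.HullExactificationCascadeHcpLandscapeGapStubFibreDecomposition
import Summits.AtomisticToContinuum.Crystallization.Theorems.HullExactificationCascadeHcpLandscapeGapStubGoodOfNoBadBondHeights
import Summits.AtomisticToContinuum.Crystallization.Theorems.PalmUnimodularRigidityLayeredLawsSelectHcpDefs
import Summits.AtomisticToContinuum.Crystallization.Theorems.HullExactificationCascadeHcpLandscapeGapStubJensenShift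
import Summits.AtomisticToContinuum.Crystallization.Theorems.HullExactificationCascadeHcpLandscapeGapStubRegistryMajorisationHeights
import Summits.AtomisticToContinuum.Crystallization.Theorems.HullExactificationCascadeHcpLandscapeGapStubFreeBlockBounds
import Summits.AtomisticToContinuum.Crystallization.Theorems.HullExactificationCascadeHcpLandscapeGapStubRelaxedColumn
import Summits.AtomisticToContinuum.Crystallization.Theorems.HullExactificationCascadeHcpLandscapeGapRelaxedWindowEnergy
import Summits.AtomisticToContinuum.Crystallization.Theorems.HullExactificationCascadeHcpLandscapeGapStubFibreCharge
import Summits.AtomisticToContinuum.Crystallization.Theorems.HullExactificationCascadeHcpLandscapeGapStubGoodOfDeepSite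
import Summits.AtomisticToContinuum.Crystallization.Theorems.HullExactificationCascadeHcpLandscapeGapStubWindowColumnSum
import Summits.AtomisticToContinuum.Crystallization.Theorems.HullExactificationCascadeHcpLandscapeGapRelaxedBarlowPricing
import Summits.AtomisticToContinuum.Crystallization.Theorems.HullExactificationCascadeHcpLandscapeGapRelaxedBarlowClass
import Summits.AtomisticToContinuum.Crystallization.Theorems.HullExactificationCascadeHcpLandscapeGapStubSlipSiteEnergy
import Summits.AtomisticToContinuum.Crystallization.Theorems.HullExactificationCascadeHcpLandscapeGapStubSlipFibreDecomposition
import Summits.AtomisticToContinuum.Crystallization.Theorems.HullExactificationCascadeHcpLandscapeGapStubWindowEnergySeparated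
import Summits.AtomisticToContinuum.Crystallization.Theorems.HullExactificationCascadeHcpLandscapeGapStubSlipFibreCharge
import Summits.AtomisticToContinuum.Crystallization.Theorems.HullExactificationCascadeHcpLandscapeGapStubGoodOfNoBadBondSlip
import Summits.AtomisticToContinuum.Crystallization.Theorems.PhononSlackCertificatesPeriodicGivenLayeredRegistry3
import Literature.MathematicalPhysics.StatisticalMechanics.OneCrossingMixture

/-!
# Skeleton v15 (lead c7): S2 cut into RS/POIS/TRIG/NUM with the assembly `slipFarHessian_of_pieces` PROVED (S2 constant
# reshaped to (39a/(50t))⁶); SC ⟸ SL ∧ RC with `slipColumn_of_lateral_relaxed` PROVED; the sorried copies of the sibling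
# cruxes R/K and their derived decls were dropped (kept: the sorry-free conditionals).  Registered open stubs: T, S1, RS,
# POIS, TRIG, NUM, SL.
#
# Skeleton v14 (lead c6, end of session): + wave 6 (slip-X1 p169340, slip-RG p169333) and the registered numerics stubs S1, S2 of
# T_slip (sorried) + SC `stub_slipColumn` (registered, sorried).  Registered open stubs: R, K, T, S1, S2, SC.
#
# Skeleton v13 (lead c6, end of cycle 1): v12 + wave-5 preparation of the next cut T_slip (laterally slipped layered
# sets): SS p168836, SF p168715, SE p168772 landed and re-exported; plan in the v13 section and LINE-REPORT.md.
#
# Skeleton v12 (lead prover-line-…-12087-c6-0, 2026-08-17): T_relaxed LANDED.  The relaxed-Barlow cut of stub T is a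
# THEOREM: `stub_relaxedBarlowPricing` p167995 (…HcpLandscapeGapRelaxedBarlowPricing.lean) — B's priced inequality for windows
# of rigid images of Barlow MULTILATTICES (every Hägg word, every spacing profile in the band, every box in-layer scale),
# assembled from RC (p166305 ⟸ W1 p165320, W2 p164934, W3 p165713), RS p163097, RF p163443, RG p163150, RE p164228,
# X1 p166631, X2 p166565, X5 p167043 — 3 waves of stub-workers + lead glue, all this lead (c6); and B's OWN conclusion on the
# exact relaxed-Barlow class, `stub_hcpLandscapeGap_relaxedBarlow` p168164 (wave 4).  Registered open stubs
# after v12: R, K (v4 composition), T (composition 2; now typed as the lift T_relaxed → T).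
#
# (v10 header:) Skeleton v10 (lead prover-line-…-12087-c6-0, 2026-08-17): the RELAXED-BARLOW cut of stub T.
# T ⟸ T_relaxed ∧ lift, where T_relaxed = B's priced inequality (T's finite-window form) for windows of rigid
# images of Barlow MULTILATTICES `barlowStackingH a' H s` — perfect triangular layers in exact A/B/C registry,
# in-layer scale `a' ∈ [47/50, 1]`, ARBITRARY height profile `H` with every spacing in `[39a'/50, 17a'/20]`,
# every Hägg word `s` (non-uniform interlayer relaxation = route threat #2, on the exact class).  New registered
# stubs: RC `stub_relaxedColumn` (lead: 1-D relaxed column inequality — convexity in the spacing profile +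
# mixed-height Hägg half-domination + box modulus), RS `stub_siteEnergyHeights`, RF `stub_fibreDecomposition`,
# RG `stub_goodOfNoBadBondHeights` (workers).  T_relaxed is assembled by the lead from RC/RS/RF/RG (+ landed
# boundary layer / rigidity / a window-energy helper) outside the registry cap; `templatedCoercivity_of_liftRelaxed`
# records the cut.  Registered open stubs after v10: R, K (v4 composition), T (composition 2), RC, RS, RF, RG.

# (v4 header, c4:)
# Skeleton v4 (lead prover-line-…-12087-c4-0, 2026-08-17): `stub_hcpBulkFloor` is CUT one level deeper,
# along the cut already registered for stmt-14477 / stmt-3061 (`Cruxes/HcpBulkFloor/Lines/birth.lean`):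
#   (R) `stub_periodicReductionToBarlow`   = item stmt-3062 verbatim (open, XL; claimed by another seat),
#   (S) `stub_dominatedRegistrySelectsHcp` = item stmt-12054 verbatim (provable now; taken by this lead),
# glued by `hcpPeriodicMinimiser_of_stubs` + `hcpBulkFloor_of_hcpPeriodicMinimiser` (copied from that
# skeleton, planner-skel-stmt-AtomisticToContinuum-14477-0; uses only LANDED items 3066/3063/3065,
# `tendsto_haggEnergy_div`, `card_mul_eStar_le`; LANDED as Theorems/…OfPeriodicReduction.lean p152308).  (S) LANDED p152001.
# Open sorries of `HcpLandscapeGap_of_stubs` are now exactly {stub_periodicReductionToBarlow (=3062), stub_hcpDefectCoercivity (=14476)}.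

# v5 (c4): ALTERNATIVE sufficient stub `stub_templatedCoercivity` (templated 14476/14477 at the box minimiser) with
# landed glue `HcpLandscapeGap_of_templatedCoercivity` (p155072): B ⇐ (R ∧ K) ∨ T.

# (v3 header, c3:)
# Crux `HcpLandscapeGap` (route HullExactificationCascade, item stmt-AtomisticToContinuum-12087) —
# line `birth` (payload slug `registered`), skeleton v3 (lead prover-line-…-12087-c3-0)

The registered composition is KEPT VERBATIM: `HcpLandscapeGap_of : P → N → E → B` (priced union
bound on the finite window) and `HcpLandscapeGap_of_stubs : HcpLandscapeGap` by name.  N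
(`stub_stackingFaultPrice`) and E (`stub_elasticCoercivity`) are DERIVED from the stubs below; the
provable ones are being landed under `Theorems/HullExactificationCascadeHcpLandscapeGap*.lean`
(namespace `…Theorems.HcpLandscapeGapBirth`) and re-imported here as they land:

* `stub_boxMinimiser` (P)      — LANDED p146639 (`…StubBoxMinimiser.lean`), re-exported below.
* `stub_boundaryLayer`         — LANDED p147788 (`…StubBoundaryLayer.lean`), re-exported below.
* `stub_master`                — LANDED as the conditional `master_of` p146652 (`…MasterOf.lean`):
  boundaryLayer → HcpBulkFloor → HcpDefectCoercivity → master; instantiated below.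
* `stub_boxMinimiserRigid`     — LANDED p148519 (`…StubBoxMinimiserRigid.lean`), re-exported below.
* `stub_shellGeometry`         — LANDED p148443 (`…StubShellGeometry.lean`), re-exported below.
* `stub_hcpBulkFloor`          = crux `HcpDefectCounting.HcpBulkFloor` (stmt-14477) — v4: DERIVED from (R) + (S) below.
* `stub_hcpDefectCoercivity`   = crux `HcpDefectCounting.HcpDefectCoercivity` (stmt-14476) verbatim — OPEN, not worked here.

Composition core LANDED (p148523) as `HcpLandscapeGap_of_glue : Rigid → Shell → HcpBulkFloor → HcpDefectCoercivity →
HcpLandscapeGap` (`…GlueCore.lean`); final corollary `HcpLandscapeGap_of_hcpDefectCounting : HcpBulkFloor →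
HcpDefectCoercivity → HcpLandscapeGap` once Rigid and Shell land.  Net: modulo provable glue, crux B is
CONDITIONAL on exactly the two open cruxes 14477 ∧ 14476 of route HcpDefectCounting — and needs only their
restrictions to windows of admissible (δ-separated, everywhere 1/20-good, Barlow-templated) configurations
(see `Cruxes/HcpLandscapeGap/LINE-REPORT.md`).  Disproof.lean: none on file for this crux (2026-08-17).
-/

namespace Summit.AtomisticToContinuum.Crystallization.Cruxes.HcpLandscapeGap.Birth

/-- **Stub P (parameters).** The Lennard-Jones energy per particle of the relaxed hcp crystal
`hcpPeriodicConfiguration a h` attains its minimum over the box `9/10 < a < 1`,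
`|h − a√(2/3)| ≤ a/100` at a point of the (non-closed) box. [difficulty: S on the tree's certified hcp
lattice sums: the global minimiser of `hcpE` on the quadrant (`stub_relaxedReference`) is enclosed at
`(0.97129, 0.79294) ± 1e-4` (`tube_minimiserEnclosure`), inside the box; `hcpEnergySeries_of_eq`] -/
theorem stub_boxMinimiser : ∃ a h : ℝ, ∃ ha : a ≠ 0, ∃ hh : h ≠ 0, (9 / 10 < a ∧ a < 1 ∧ |h - a * Real.sqrt (2 / 3)| ≤ a / 100) ∧ (∀ a' h' : ℝ, ∀ ha' : a' ≠ 0, ∀ hh' : h' ≠ 0, (9 / 10 < a' ∧ a' < 1 ∧ |h' - a' * Real.sqrt (2 / 3)| ≤ a' / 100) → (Literature.MathematicalPhysics.StatisticalMechanics.hcpPeriodicConfiguration ha hh).energyPerParticle Literature.MathematicalPhysics.StatisticalMechanics.lennardJones ≤ (Literature.MathematicalPhysics.StatisticalMechanics.hcpPeriodicConfiguration ha' hh').energyPerParticle Literature.MathematicalPhysics.StatisticalMechanics.lennardJones) :=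
  Summit.AtomisticToContinuum.Crystallization.Theorems.HcpLandscapeGapBirth.stub_boxMinimiser

/-- **Stub (S) — dominated registry couplings select hcp** (verbatim the support item
`OneCrossingRisingSea.DominatedRegistrySelectsHcp`, item stmt-AtomisticToContinuum-12054, and verbatim
stub (S) of `Cruxes/HcpBulkFloor/Lines/birth.lean`): for every coupling sequence `J` with `Σ k|J_k| < ∞`
and `J₂ + Σ_{k≥3}(k−1)|J_k| ≤ 0`, the alternating Hägg word minimises `haggStackingEnergy J` over all Hägg
words.  LANDED p152001 (`…StubDominatedRegistrySelectsHcp.lean`, c4 lead), re-exported. -/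
theorem stub_dominatedRegistrySelectsHcp : ∀ J : ℕ → ℝ, Summable (fun k : ℕ => (k : ℝ) * |J k|) → J 2 + ∑' k : ℕ, (if 3 ≤ k then ((k : ℝ) - 1) * |J k| else 0) ≤ 0 → IsLeast (Set.range fun s : {s : ℤ → ℤ // Literature.MathematicalPhysics.StatisticalMechanics.IsHaggSeq s} => Literature.MathematicalPhysics.StatisticalMechanics.haggStackingEnergy J s.1) (Literature.MathematicalPhysics.StatisticalMechanics.haggStackingEnergy J Literature.MathematicalPhysics.StatisticalMechanics.alternatingHagg) :=
  Summit.AtomisticToContinuum.Crystallization.Theorems.HcpLandscapeGapBirth.stub_dominatedRegistrySelectsHcp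

open Literature.MathematicalPhysics.StatisticalMechanics in
/-- **Glue, periodic half** (copied from `Cruxes/HcpBulkFloor/Lines/birth.lean`,
planner-skel-stmt-AtomisticToContinuum-14477-0): stub (R) → stub (S) → `HcpDefectCounting.HcpPeriodicMinimiser`
(item 3061), through the LANDED items 3066 (`stub_hcpEnergyMinOnBox`), 3063 (`stub_ljRegistryDomination`),
3065 (`stub_barlowEnergyIdentification`), `energyPerParticle_hcp_eq` and `tendsto_haggEnergy_div`.
No `sorry`. -/
theorem hcpPeriodicMinimiser_of_stubs :
    (∀ Q : Literature.MathematicalPhysics.StatisticalMechanics.PeriodicConfiguration 3, ∃ a h : ℝ, 47 / 50 ≤ a ∧ a ≤ 1 ∧ 39 / 50 * a ≤ h ∧ h ≤ 17 / 20 * a ∧ ∃ (s : ℤ → ℤ) (p : ℕ) (ha : a ≠ 0) (hh : h ≠ 0) (hp : p ≠ 0) (hs : ∀ i, s (i + p) = s i), Literature.MathematicalPhysics.StatisticalMechanics.IsHaggSeq s ∧ (Literature.MathematicalPhysics.StatisticalMechanics.barlowPeriodicConfiguration s ha hh hp hs).energyPerParticle Literature.MathematicalPhysics.StatisticalMechanics.lennardJones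 ≤ Q.energyPerParticle Literature.MathematicalPhysics.StatisticalMechanics.lennardJones) →
    (∀ J : ℕ → ℝ, Summable (fun k : ℕ => (k : ℝ) * |J k|) → J 2 + ∑' k : ℕ, (if 3 ≤ k then ((k : ℝ) - 1) * |J k| else 0) ≤ 0 → IsLeast (Set.range fun s : {s : ℤ → ℤ // Literature.MathematicalPhysics.StatisticalMechanics.IsHaggSeq s} => Literature.MathematicalPhysics.StatisticalMechanics.haggStackingEnergy J s.1) (Literature.MathematicalPhysics.StatisticalMechanics.haggStackingEnergy J Literature.MathematicalPhysics.StatisticalMechanics.alternatingHagg)) →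
    Summit.AtomisticToContinuum.Crystallization.Theses.HcpDefectCounting.HcpPeriodicMinimiser := by
  intro hR hS
  obtain ⟨a₀, h₀, ha₀, hh₀, hb₁, hb₂, hb₃, hb₄, hmin⟩ :=
    Summit.AtomisticToContinuum.Crystallization.Theorems.PricedHcpWindowsHcpBox.stub_hcpEnergyMinOnBox
  refine ⟨a₀, h₀, ha₀, hh₀, hb₁, hb₂, hb₃, hb₄, ⟨hcpPeriodicConfiguration ha₀ hh₀, rfl⟩, ?_⟩
  rintro _ ⟨Q, rfl⟩
  obtain ⟨a, h, hc₁, hc₂, hc₃, hc₄, s, p, ha, hh, hp, hs, hHagg, hle⟩ := hR Q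
  have ha0 : 0 < a := by linarith
  have hh0 : 0 < h := by nlinarith
  have hp_pos : 0 < p := Nat.pos_of_ne_zero hp
  obtain ⟨hsum, hJ2, htail⟩ :=
    Summit.AtomisticToContinuum.Crystallization.Theorems.PricedHcpWindowsLjRegistry.stub_ljRegistryDomination
      a h hc₁ hc₂ hc₃ hc₄
  have hdomJ : barlowCoupling lennardJones a h 2 +
      ∑' k : ℕ, (if 3 ≤ k then ((k : ℝ) - 1) * |barlowCoupling lennardJones a h k| else 0) ≤ 0 := by
    have habs : |barlowCoupling lennardJones a h 2| = -barlowCoupling lennardJones a h 2 :=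
      abs_of_neg hJ2
    linarith
  have hsel : haggStackingEnergy (barlowCoupling lennardJones a h) alternatingHagg ≤
      haggStackingEnergy (barlowCoupling lennardJones a h) s :=
    (hS (barlowCoupling lennardJones a h) hsum hdomJ).2 ⟨⟨s, hHagg⟩, rfl⟩
  have hper : haggStackingEnergy (barlowCoupling lennardJones a h) s =
      haggEnergy p (barlowCoupling lennardJones a h) s / p := by
    unfold haggStackingEnergy
    exact (Summit.AtomisticToContinuum.Crystallization.Theorems.tendsto_haggEnergy_div hs _ hp_pos).liminf_eq
  have hdiv : (∑' k : ℕ, (if 2 ≤ k ∧ Even k then barlowCoupling lennardJones a h k else 0)) ≤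
      haggEnergy p (barlowCoupling lennardJones a h) s / p :=
    calc (∑' k : ℕ, (if 2 ≤ k ∧ Even k then barlowCoupling lennardJones a h k else 0))
          = haggStackingEnergy (barlowCoupling lennardJones a h) alternatingHagg :=
            (haggStackingEnergy_alternating _).symm
      _ ≤ haggStackingEnergy (barlowCoupling lennardJones a h) s := hsel
      _ = haggEnergy p (barlowCoupling lennardJones a h) s / p := hper
  have hEbar :=
    Summit.AtomisticToContinuum.Crystallization.Theorems.PricedHcpWindowsBarlowEnergy.stub_barlowEnergyIdentification
      a h ha0 hh0 s p ha hh hp hs hHagg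
  have hEhcp :=
    Summit.AtomisticToContinuum.Crystallization.Theorems.PricedHcpWindowsHcpBox.energyPerParticle_hcp_eq
      ha0 hh0 ha hh
  calc (hcpPeriodicConfiguration ha₀ hh₀).energyPerParticle lennardJones
        ≤ (hcpPeriodicConfiguration ha hh).energyPerParticle lennardJones :=
          hmin a h ha hh hc₁ hc₂ hc₃ hc₄
    _ = barlowBaseEnergy lennardJones a h +
          ∑' k : ℕ, (if 2 ≤ k ∧ Even k then barlowCoupling lennardJones a h k else 0) := hEhcp
    _ ≤ barlowBaseEnergy lennardJones a h + haggEnergy p (barlowCoupling lennardJones a h) s / p := by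
          linarith
    _ = (barlowPeriodicConfiguration s ha hh hp hs).energyPerParticle lennardJones := hEbar.symm
    _ ≤ Q.energyPerParticle lennardJones := hle

open Literature.MathematicalPhysics.StatisticalMechanics in
/-- **Glue, finite half** (copied from `Cruxes/HcpBulkFloor/Lines/birth.lean`): a box hcp that is a least
element of the periodic energies is a floor for every finite injective cluster — the landed
`ChargedEnergyGapNegative.card_mul_eStar_le` (`N · e* ≤ 𝓔_LJ(x)`, `e* = ⨅_Q e(Q)`) and `IsLeast.csInf_eq`.
No `sorry`. -/
theorem hcpBulkFloor_of_hcpPeriodicMinimiser :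
    Summit.AtomisticToContinuum.Crystallization.Theses.HcpDefectCounting.HcpPeriodicMinimiser →
    Summit.AtomisticToContinuum.Crystallization.Theses.HcpDefectCounting.HcpBulkFloor := by
  rintro ⟨a, h, ha, hh, hb₁, hb₂, hb₃, hb₄, hleast⟩
  refine ⟨a, h, ha, hh, hb₁, hb₂, hb₃, hb₄, fun N x hx => ?_⟩
  have hfloor :=
    Summit.AtomisticToContinuum.Crystallization.Theorems.ChargedEnergyGapNegative.card_mul_eStar_le hx
  have e : Summit.AtomisticToContinuum.Crystallization.Theorems.ChargedEnergyGapNegative.eStar =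
      (hcpPeriodicConfiguration ha hh).energyPerParticle lennardJones := hleast.csInf_eq
  rw [e] at hfloor
  exact hfloor

/-- **Stub R (rigidity of the box minimiser).** Every minimiser of `e(hcp a h)` over the open box
`9/10 < a < 1`, `|h − a√(2/3)| ≤ a/100` is enclosed at `(0.97129, 0.79294) ± 10⁻⁴` and is a GLOBAL minimiser
over the quadrant `a', h' > 0` (the certified global minimiser lies in the box, so box-minimal values equal
the global minimum; uniqueness `tube_hcpE_unique_minimiser`; `e = hcpE` by `hcpEnergySeries_of_eq`).
[difficulty: S] -/
theorem stub_boxMinimiserRigid : ∀ a h : ℝ, ∀ ha : a ≠ 0, ∀ hh : h ≠ 0, (9 / 10 < a ∧ a < 1 ∧ |h - a * Real.sqrt (2 / 3)| ≤ a / 100) → (∀ a' h' : ℝ, ∀ ha' : a' ≠ 0, ∀ hh' : h' ≠ 0, (9 / 10 < a' ∧ a' < 1 ∧ |h' - a' * Real.sqrt (2 / 3)| ≤ a' / 100) → (Literature.MathematicalPhysics.StatisticalMechanics.hcpPeriodicConfiguration ha hh).energyPerParticle Literature.MathematicalPhysics.StatisticalMechanics.lennardJones ≤ (Literature.MathematicalPhysics.StatisticalMechanics.hcpPeriodicConfiguration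 ha' hh').energyPerParticle Literature.MathematicalPhysics.StatisticalMechanics.lennardJones) → (|a - 97129 / 100000| ≤ 1 / 10000 ∧ |h - 79294 / 100000| ≤ 1 / 10000) ∧ (∀ a' h' : ℝ, ∀ ha' : a' ≠ 0, ∀ hh' : h' ≠ 0, 0 < a' → 0 < h' → (Literature.MathematicalPhysics.StatisticalMechanics.hcpPeriodicConfiguration ha hh).energyPerParticle Literature.MathematicalPhysics.StatisticalMechanics.lennardJones ≤ (Literature.MathematicalPhysics.StatisticalMechanics.hcpPeriodicConfiguration ha' hh').energyPerParticle Literature.MathematicalPhysics.StatisticalMechanics.lennardJones) :=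
  Summit.AtomisticToContinuum.Crystallization.Theorems.HcpLandscapeGapBirth.stub_boxMinimiserRigid

/-- **Stub L (boundary layer of a separated set).** For `δ > 0`, `ρ ≥ 0` there is `C` such that for every
`δ`-separated `S ⊆ ℝ³`, every centre `c` and radius `L ≥ 0`: (i) the points of `S ∩ B̄_L(c)` at depth `< ρ`
number at most `C(L+1)²`; (ii) for every injective enumeration `x` of `S ∩ B̄_L(c)`,
`2·𝓔_LJ(x) − C(L+1)² ≤ Σ_{y ∈ S ∩ B̄_L(c)} Σ'_{z ∈ S, z ≠ y} V_LJ(|y − z|)` (the cross interaction with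
`S ∖ B̄_L(c)` is `≥ −(1/6)Σ|y−z|⁻⁶`, a surface term by depth shells). [difficulty: M; tree:
`exists_crossSum_le`, `sum_inv_pow_le_of_separated`, `summable_lennardJones_site`, `ncard_ball_le`,
`tsum_finite_eq_sum`, `siteEnergy_eq_sum`] -/
theorem stub_boundaryLayer : ∀ δ : ℝ, 0 < δ → ∀ ρ : ℝ, 0 ≤ ρ → ∃ C : ℝ, ∀ S : Set (EuclideanSpace ℝ (Fin 3)), (∀ y ∈ S, ∀ z ∈ S, y ≠ z → δ ≤ dist y z) → ∀ (c : EuclideanSpace ℝ (Fin 3)) (L : ℝ), 0 ≤ L → (({y : EuclideanSpace ℝ (Fin 3) | y ∈ S ∧ dist y c ≤ L ∧ L - ρ < dist y c} : Set (EuclideanSpace ℝ (Fin 3))).ncard : ℝ) ≤ C * (L + 1) ^ 2 ∧ ∀ (n : ℕ) (x : Fin n → EuclideanSpace ℝ (Fin 3)), Function.Injective x → Set.range x = {y : EuclideanSpace ℝ (Fin 3) | y ∈ S ∧ dist y c ≤ L} → 2 * Literature.MathematicalPhysics.StatisticalMechanics.interactionEnergy Literature.MathematicalPhysics.StatisticalMechanics.lennardJones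 x - C * (L + 1) ^ 2 ≤ (∑' y : ↥{y : EuclideanSpace ℝ (Fin 3) | y ∈ S ∧ dist y c ≤ L}, (∑' z : ↥{z : EuclideanSpace ℝ (Fin 3) | z ∈ S ∧ z ≠ (y : EuclideanSpace ℝ (Fin 3))}, Literature.MathematicalPhysics.StatisticalMechanics.lennardJones (dist (y : EuclideanSpace ℝ (Fin 3)) (z : EuclideanSpace ℝ (Fin 3))))) :=
  Summit.AtomisticToContinuum.Crystallization.Theorems.HcpLandscapeGapBirth.stub_boundaryLayer

/-- **Stub G (shell geometry at the enclosed parameters).** For `(a,h)` within `10⁻⁴` of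
`(0.97129, 0.79294)` and `δ, η > 0` there is `θ > 0` such that every site `y` of a `δ`-separated `S` that is
`Good(4,θ)` (14476: two-way `θ`-matching of the particles within `4` of `y` with `y + A(hcp(a,h)-sites of norm
≤ 4)`) (i) has its unscaled `13/10·a`-shell `η`-congruent to the hcp(a,h) shell at `0`
(`P` = the twelve sites of `norm_site_lt_iff`; the matching restricted to the shell is a bijection because
`2θ < δ` and the second hcp shell starts at `≈ 1.414a > 13/10·a + θ`), and (ii) is NOT fcc-type at its own
scale (its rescaled first shell is within `θ/d` of the hcp shell, which is at bottleneck distance `> 1/10` from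
every isometric image of the centrosymmetric cuboctahedron: a cap site `p` has `‖p + p'‖ ≥ a/√3` for all shell
sites `p'`). [difficulty: L; tree: `ExactHcpLocal.norm_site_lt_iff`, `box_envelope`, `even_of_neg_site_mem`,
`HcpSiteGeometry`, `KissingPatterns`] -/
theorem stub_shellGeometry : ∀ a h : ℝ, ∀ ha : a ≠ 0, ∀ hh : h ≠ 0, |a - 97129 / 100000| ≤ 1 / 10000 → |h - 79294 / 100000| ≤ 1 / 10000 → ∀ δ : ℝ, 0 < δ → ∀ η : ℝ, 0 < η → ∃ θ : ℝ, 0 < θ ∧ ∀ S : Set (EuclideanSpace ℝ (Fin 3)), (∀ y ∈ S, ∀ z ∈ S, y ≠ z → δ ≤ dist y z) → ∀ y ∈ S, (∃ A : EuclideanSpace ℝ (Fin 3) →ₗᵢ[ℝ] EuclideanSpace ℝ (Fin 3), (∀ p ∈ (Literature.MathematicalPhysics.StatisticalMechanics.hcpPeriodicConfiguration ha hh).points, ‖p‖ ≤ 4 → ∃ z ∈ S, dist z (y + A p) ≤ θ) ∧ (∀ z ∈ S, dist z y ≤ 4 → ∃ p ∈ (Literature.MathematicalPhysics.StatisticalMechanics.hcpPeriodicConfiguration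 ha hh).points, dist z (y + A p) ≤ θ)) → (let T : Set (EuclideanSpace ℝ (Fin 3)) := {z : EuclideanSpace ℝ (Fin 3) | z ∈ S ∧ z ≠ y ∧ dist z y < 13 / 10 * a}; let P : Set (EuclideanSpace ℝ (Fin 3)) := {p : EuclideanSpace ℝ (Fin 3) | p ∈ Literature.MathematicalPhysics.StatisticalMechanics.hcpStacking a h ∧ p ≠ 0 ∧ ‖p‖ < 13 / 10 * a}; ∃ A : EuclideanSpace ℝ (Fin 3) →ₗᵢ[ℝ] EuclideanSpace ℝ (Fin 3), ∃ e : ↥T ≃ ↥P, ∀ t : ↥T, dist ((t : EuclideanSpace ℝ (Fin 3)) - y) (A ((e t : ↥P) : EuclideanSpace ℝ (Fin 3))) ≤ η) ∧ ¬ (let d : ℝ := sInf ((fun z => dist z y) '' (S \ {y})); let T : Set (EuclideanSpace ℝ (Fin 3)) := {z : EuclideanSpace ℝ (Fin 3) | z ∈ S ∧ z ≠ y ∧ dist z y < 13 / 10 * d}; ∃ A : EuclideanSpace ℝ (Fin 3) →ₗᵢ[ℝ] EuclideanSpace ℝ (Fin 3), ∃ e : ↥T ≃ ↥Literature.Geometry.DiscreteGeometry.fccKissingPattern,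 ∀ t : ↥T, dist (d⁻¹ • ((t : EuclideanSpace ℝ (Fin 3)) - y)) (A ((e t : ↥Literature.Geometry.DiscreteGeometry.fccKissingPattern) : EuclideanSpace ℝ (Fin 3))) ≤ 1 / 20) :=
  Summit.AtomisticToContinuum.Crystallization.Theorems.HcpLandscapeGapBirth.stub_shellGeometry

/-- Bookkeeping behind the assembly: two priced lower bounds with the same bulk term, one pricing
the sites with property `F`, the other the sites with `¬F ∧ ¬G`, average to a lower bound pricing
all sites with `¬G` (union bound on a finite window). [folklore] -/
theorem priced_union_bound {X : Type*} {S : Set X} {r F G : X → Prop}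
    (hfin : ({y | y ∈ S ∧ r y} : Set X).Finite) {σ e κ₁ κ₂ C₁ C₂ L : ℝ}
    (hκ₁ : 0 < κ₁) (hκ₂ : 0 < κ₂)
    (h₁ : 2 * e * (({y | y ∈ S ∧ r y} : Set X).ncard : ℝ) +
        κ₁ * (({y | y ∈ S ∧ (r y ∧ F y)} : Set X).ncard : ℝ) - C₁ * (L + 1) ^ 2 ≤ σ)
    (h₂ : 2 * e * (({y | y ∈ S ∧ r y} : Set X).ncard : ℝ) +
        κ₂ * (({y | y ∈ S ∧ (r y ∧ (¬ F y ∧ ¬ G y))} : Set X).ncard : ℝ) - C₂ * (L + 1) ^ 2 ≤ σ) :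
    2 * e * (({y | y ∈ S ∧ r y} : Set X).ncard : ℝ) +
        min κ₁ κ₂ / 2 * (({y | y ∈ S ∧ (r y ∧ ¬ G y)} : Set X).ncard : ℝ) -
          (C₁ + C₂) / 2 * (L + 1) ^ 2 ≤ σ := by
  classical
  set A : Set X := {y | y ∈ S ∧ (r y ∧ F y)} with hA
  set B : Set X := {y | y ∈ S ∧ (r y ∧ (¬ F y ∧ ¬ G y))} with hB
  set D : Set X := {y | y ∈ S ∧ (r y ∧ ¬ G y)} with hD
  have hsub : D ⊆ A ∪ B := by
    intro y hy
    by_cases hF : F y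
    · exact Or.inl ⟨hy.1, hy.2.1, hF⟩
    · exact Or.inr ⟨hy.1, hy.2.1, hF, hy.2.2⟩
  have hABfin : (A ∪ B).Finite := by
    refine hfin.subset ?_
    intro y hy
    rcases hy with hy | hy
    · exact ⟨hy.1, hy.2.1⟩
    · exact ⟨hy.1, hy.2.1⟩
  have hDle : D.ncard ≤ A.ncard + B.ncard :=
    (Set.ncard_le_ncard hsub hABfin).trans (Set.ncard_union_le A B)
  have hDleR : (D.ncard : ℝ) ≤ (A.ncard : ℝ) + (B.ncard : ℝ) := by exact_mod_cast hDle
  have hm0 : 0 ≤ min κ₁ κ₂ / 2 := by positivity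
  have hA0 : (0 : ℝ) ≤ (A.ncard : ℝ) := Nat.cast_nonneg _
  have hB0 : (0 : ℝ) ≤ (B.ncard : ℝ) := Nat.cast_nonneg _
  have h3 : min κ₁ κ₂ / 2 * (D.ncard : ℝ) ≤ min κ₁ κ₂ / 2 * ((A.ncard : ℝ) + (B.ncard : ℝ)) :=
    mul_le_mul_of_nonneg_left hDleR hm0
  have h4 : min κ₁ κ₂ / 2 * (A.ncard : ℝ) ≤ κ₁ / 2 * (A.ncard : ℝ) :=
    mul_le_mul_of_nonneg_right (by linarith [min_le_left κ₁ κ₂]) hA0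
  have h5 : min κ₁ κ₂ / 2 * (B.ncard : ℝ) ≤ κ₂ / 2 * (B.ncard : ℝ) :=
    mul_le_mul_of_nonneg_right (by linarith [min_le_right κ₁ κ₂]) hB0
  nlinarith [h₁, h₂, h3, h4, h5]

/-- **Assembly (proved).** `P → N → E → HcpLandscapeGap` (conclusion written as the body of the
route decl verbatim; `HcpLandscapeGap_of_stubs` below states it by name): the box-minimiser of P
is the witness; for `δ, η > 0` the N- and E-inequalities at that witness are averaged through
`priced_union_bound` on the finite window `S ∩ B_L(c)`. -/
theorem HcpLandscapeGap_of :
    (∃ a h : ℝ, ∃ ha : a ≠ 0, ∃ hh : h ≠ 0, (9 / 10 < a ∧ a < 1 ∧ |h - a * Real.sqrt (2 / 3)| ≤ a / 100) ∧ (∀ a' h' : ℝ, ∀ ha' : a' ≠ 0, ∀ hh' : h' ≠ 0, (9 / 10 < a' ∧ a' < 1 ∧ |h' - a' * Real.sqrt (2 / 3)| ≤ a' / 100) → (Literature.MathematicalPhysics.StatisticalMechanics.hcpPeriodicConfiguration ha hh).energyPerParticle Literature.MathematicalPhysics.StatisticalMechanics.lennardJones ≤ (Literature.MathematicalPhysics.StatisticalMechanics.hcpPeriodicConfiguration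 ha' hh').energyPerParticle Literature.MathematicalPhysics.StatisticalMechanics.lennardJones)) →
    (∀ a h : ℝ, ∀ ha : a ≠ 0, ∀ hh : h ≠ 0, (9 / 10 < a ∧ a < 1 ∧ |h - a * Real.sqrt (2 / 3)| ≤ a / 100) → (∀ a' h' : ℝ, ∀ ha' : a' ≠ 0, ∀ hh' : h' ≠ 0, (9 / 10 < a' ∧ a' < 1 ∧ |h' - a' * Real.sqrt (2 / 3)| ≤ a' / 100) → (Literature.MathematicalPhysics.StatisticalMechanics.hcpPeriodicConfiguration ha hh).energyPerParticle Literature.MathematicalPhysics.StatisticalMechanics.lennardJones ≤ (Literature.MathematicalPhysics.StatisticalMechanics.hcpPeriodicConfiguration ha' hh').energyPerParticle Literature.MathematicalPhysics.StatisticalMechanics.lennardJones) → ∀ δ : ℝ, 0 < δ → ∃ κ : ℝ, 0 < κ ∧ ∃ C : ℝ, ∀ S : Set (EuclideanSpace ℝ (Fin 3)), (∀ y ∈ S, ∀ z ∈ S, y ≠ z → δ ≤ dist y z) → (∀ y ∈ S, (let d : ℝ := sInf ((fun z => dist z y) '' (S \ {y})); let T : Set (EuclideanSpace ℝ (Fin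 3)) := {z : EuclideanSpace ℝ (Fin 3) | z ∈ S ∧ z ≠ y ∧ dist z y < 13 / 10 * d}; ∃ A : EuclideanSpace ℝ (Fin 3) →ₗᵢ[ℝ] EuclideanSpace ℝ (Fin 3), (∃ e : ↥T ≃ ↥Literature.Geometry.DiscreteGeometry.fccKissingPattern, ∀ t : ↥T, dist (d⁻¹ • ((t : EuclideanSpace ℝ (Fin 3)) - y)) (A ((e t : ↥Literature.Geometry.DiscreteGeometry.fccKissingPattern) : EuclideanSpace ℝ (Fin 3))) ≤ 1 / 20) ∨ (∃ e : ↥T ≃ ↥Literature.Geometry.DiscreteGeometry.hcpKissingPattern, ∀ t : ↥T, dist (d⁻¹ • ((t : EuclideanSpace ℝ (Fin 3)) - y)) (A ((e t : ↥Literature.Geometry.DiscreteGeometry.hcpKissingPattern) : EuclideanSpace ℝ (Fin 3))) ≤ 1 / 20))) → (∃ s : ℤ → ℤ, Literature.MathematicalPhysics.StatisticalMechanics.IsHaggSeq s ∧ ∃ Φ : EuclideanSpace ℝ (Fin 3) → EuclideanSpace ℝ (Fin 3), Set.BijOn Φ (Literature.MathematicalPhysics.StatisticalMechanics.barlowStacking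 1 (Real.sqrt (2 / 3)) s) S ∧ ∀ p ∈ Literature.MathematicalPhysics.StatisticalMechanics.barlowStacking 1 (Real.sqrt (2 / 3)) s, ∃ A : EuclideanSpace ℝ (Fin 3) →ₗᵢ[ℝ] EuclideanSpace ℝ (Fin 3), ∃ l : ℝ, 0 < l ∧ ∀ q ∈ Literature.MathematicalPhysics.StatisticalMechanics.barlowStacking 1 (Real.sqrt (2 / 3)) s, dist q p ≤ 1 → dist (Φ q) (Φ p + l • A (q - p)) ≤ 1 / 20 * l) → ∀ (c : EuclideanSpace ℝ (Fin 3)) (L : ℝ), 0 ≤ L → 2 * ((Literature.MathematicalPhysics.StatisticalMechanics.hcpPeriodicConfiguration ha hh).energyPerParticle Literature.MathematicalPhysics.StatisticalMechanics.lennardJones) * (({y : EuclideanSpace ℝ (Fin 3) | y ∈ S ∧ dist y c ≤ L} : Set (EuclideanSpace ℝ (Fin 3))).ncard : ℝ) + κ * (({y : EuclideanSpace ℝ (Fin 3) | y ∈ S ∧ dist y c ≤ L ∧ (let d : ℝ := sInf ((fun z => dist z y) '' (S \ {y})); let T : Set (EuclideanSpace ℝ (Fin 3)) := {z : EuclideanSpace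 ℝ (Fin 3) | z ∈ S ∧ z ≠ y ∧ dist z y < 13 / 10 * d}; ∃ A : EuclideanSpace ℝ (Fin 3) →ₗᵢ[ℝ] EuclideanSpace ℝ (Fin 3), ∃ e : ↥T ≃ ↥Literature.Geometry.DiscreteGeometry.fccKissingPattern, ∀ t : ↥T, dist (d⁻¹ • ((t : EuclideanSpace ℝ (Fin 3)) - y)) (A ((e t : ↥Literature.Geometry.DiscreteGeometry.fccKissingPattern) : EuclideanSpace ℝ (Fin 3))) ≤ 1 / 20)} : Set (EuclideanSpace ℝ (Fin 3))).ncard : ℝ) - C * (L + 1) ^ 2 ≤ (∑' y : ↥{y : EuclideanSpace ℝ (Fin 3) | y ∈ S ∧ dist y c ≤ L}, (∑' z : ↥{z : EuclideanSpace ℝ (Fin 3) | z ∈ S ∧ z ≠ (y : EuclideanSpace ℝ (Fin 3))}, Literature.MathematicalPhysics.StatisticalMechanics.lennardJones (dist (y : EuclideanSpace ℝ (Fin 3)) (z : EuclideanSpace ℝ (Fin 3)))))) →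
    (∀ a h : ℝ, ∀ ha : a ≠ 0, ∀ hh : h ≠ 0, (9 / 10 < a ∧ a < 1 ∧ |h - a * Real.sqrt (2 / 3)| ≤ a / 100) → (∀ a' h' : ℝ, ∀ ha' : a' ≠ 0, ∀ hh' : h' ≠ 0, (9 / 10 < a' ∧ a' < 1 ∧ |h' - a' * Real.sqrt (2 / 3)| ≤ a' / 100) → (Literature.MathematicalPhysics.StatisticalMechanics.hcpPeriodicConfiguration ha hh).energyPerParticle Literature.MathematicalPhysics.StatisticalMechanics.lennardJones ≤ (Literature.MathematicalPhysics.StatisticalMechanics.hcpPeriodicConfiguration ha' hh').energyPerParticle Literature.MathematicalPhysics.StatisticalMechanics.lennardJones) → ∀ δ : ℝ, 0 < δ → ∀ η : ℝ, 0 < η → ∃ κ : ℝ, 0 < κ ∧ ∃ C : ℝ, ∀ S : Set (EuclideanSpace ℝ (Fin 3)), (∀ y ∈ S, ∀ z ∈ S, y ≠ z → δ ≤ dist y z) → (∀ y ∈ S, (let d : ℝ := sInf ((fun z => dist z y) '' (S \ {y})); let T : Set (EuclideanSpace ℝ (Fin 3)) := {z : EuclideanSpace ℝ (Fin 3) | z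 ∈ S ∧ z ≠ y ∧ dist z y < 13 / 10 * d}; ∃ A : EuclideanSpace ℝ (Fin 3) →ₗᵢ[ℝ] EuclideanSpace ℝ (Fin 3), (∃ e : ↥T ≃ ↥Literature.Geometry.DiscreteGeometry.fccKissingPattern, ∀ t : ↥T, dist (d⁻¹ • ((t : EuclideanSpace ℝ (Fin 3)) - y)) (A ((e t : ↥Literature.Geometry.DiscreteGeometry.fccKissingPattern) : EuclideanSpace ℝ (Fin 3))) ≤ 1 / 20) ∨ (∃ e : ↥T ≃ ↥Literature.Geometry.DiscreteGeometry.hcpKissingPattern, ∀ t : ↥T, dist (d⁻¹ • ((t : EuclideanSpace ℝ (Fin 3)) - y)) (A ((e t : ↥Literature.Geometry.DiscreteGeometry.hcpKissingPattern) : EuclideanSpace ℝ (Fin 3))) ≤ 1 / 20))) → (∃ s : ℤ → ℤ, Literature.MathematicalPhysics.StatisticalMechanics.IsHaggSeq s ∧ ∃ Φ : EuclideanSpace ℝ (Fin 3) → EuclideanSpace ℝ (Fin 3), Set.BijOn Φ (Literature.MathematicalPhysics.StatisticalMechanics.barlowStacking 1 (Real.sqrt (2 / 3)) s) S ∧ ∀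 p ∈ Literature.MathematicalPhysics.StatisticalMechanics.barlowStacking 1 (Real.sqrt (2 / 3)) s, ∃ A : EuclideanSpace ℝ (Fin 3) →ₗᵢ[ℝ] EuclideanSpace ℝ (Fin 3), ∃ l : ℝ, 0 < l ∧ ∀ q ∈ Literature.MathematicalPhysics.StatisticalMechanics.barlowStacking 1 (Real.sqrt (2 / 3)) s, dist q p ≤ 1 → dist (Φ q) (Φ p + l • A (q - p)) ≤ 1 / 20 * l) → ∀ (c : EuclideanSpace ℝ (Fin 3)) (L : ℝ), 0 ≤ L → 2 * ((Literature.MathematicalPhysics.StatisticalMechanics.hcpPeriodicConfiguration ha hh).energyPerParticle Literature.MathematicalPhysics.StatisticalMechanics.lennardJones) * (({y : EuclideanSpace ℝ (Fin 3) | y ∈ S ∧ dist y c ≤ L} : Set (EuclideanSpace ℝ (Fin 3))).ncard : ℝ) + κ * (({y : EuclideanSpace ℝ (Fin 3) | y ∈ S ∧ dist y c ≤ L ∧ (¬ (let d : ℝ := sInf ((fun z => dist z y) '' (S \ {y})); let T : Set (EuclideanSpace ℝ (Fin 3)) := {z : EuclideanSpace ℝ (Fin 3) | z ∈ S ∧ z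 ≠ y ∧ dist z y < 13 / 10 * d}; ∃ A : EuclideanSpace ℝ (Fin 3) →ₗᵢ[ℝ] EuclideanSpace ℝ (Fin 3), ∃ e : ↥T ≃ ↥Literature.Geometry.DiscreteGeometry.fccKissingPattern, ∀ t : ↥T, dist (d⁻¹ • ((t : EuclideanSpace ℝ (Fin 3)) - y)) (A ((e t : ↥Literature.Geometry.DiscreteGeometry.fccKissingPattern) : EuclideanSpace ℝ (Fin 3))) ≤ 1 / 20) ∧ ¬ (let T : Set (EuclideanSpace ℝ (Fin 3)) := {z : EuclideanSpace ℝ (Fin 3) | z ∈ S ∧ z ≠ y ∧ dist z y < 13 / 10 * a}; let P : Set (EuclideanSpace ℝ (Fin 3)) := {p : EuclideanSpace ℝ (Fin 3) | p ∈ Literature.MathematicalPhysics.StatisticalMechanics.hcpStacking a h ∧ p ≠ 0 ∧ ‖p‖ < 13 / 10 * a}; ∃ A : EuclideanSpace ℝ (Fin 3) →ₗᵢ[ℝ] EuclideanSpace ℝ (Fin 3), ∃ e : ↥T ≃ ↥P, ∀ t : ↥T, dist ((t : EuclideanSpace ℝ (Fin 3)) - y) (A ((e t : ↥P) : EuclideanSpace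 ℝ (Fin 3))) ≤ η))} : Set (EuclideanSpace ℝ (Fin 3))).ncard : ℝ) - C * (L + 1) ^ 2 ≤ (∑' y : ↥{y : EuclideanSpace ℝ (Fin 3) | y ∈ S ∧ dist y c ≤ L}, (∑' z : ↥{z : EuclideanSpace ℝ (Fin 3) | z ∈ S ∧ z ≠ (y : EuclideanSpace ℝ (Fin 3))}, Literature.MathematicalPhysics.StatisticalMechanics.lennardJones (dist (y : EuclideanSpace ℝ (Fin 3)) (z : EuclideanSpace ℝ (Fin 3)))))) →
    (∃ a h : ℝ, ∃ ha : a ≠ 0, ∃ hh : h ≠ 0, (9 / 10 < a ∧ a < 1 ∧ |h - a * Real.sqrt (2 / 3)| ≤ a / 100) ∧ (∀ δ : ℝ, 0 < δ → ∀ η : ℝ, 0 < η → ∃ κ : ℝ, 0 < κ ∧ ∃ C : ℝ, ∀ S : Set (EuclideanSpace ℝ (Fin 3)), (∀ y ∈ S, ∀ z ∈ S, y ≠ z → δ ≤ dist y z) → (∀ y ∈ S, (let d : ℝ := sInf ((fun z => dist z y) '' (S \ {y})); let T : Set (EuclideanSpace ℝ (Fin 3)) := {z : EuclideanSpace ℝ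 (Fin 3) | z ∈ S ∧ z ≠ y ∧ dist z y < 13 / 10 * d}; ∃ A : EuclideanSpace ℝ (Fin 3) →ₗᵢ[ℝ] EuclideanSpace ℝ (Fin 3), (∃ e : ↥T ≃ ↥Literature.Geometry.DiscreteGeometry.fccKissingPattern, ∀ t : ↥T, dist (d⁻¹ • ((t : EuclideanSpace ℝ (Fin 3)) - y)) (A ((e t : ↥Literature.Geometry.DiscreteGeometry.fccKissingPattern) : EuclideanSpace ℝ (Fin 3))) ≤ 1 / 20) ∨ (∃ e : ↥T ≃ ↥Literature.Geometry.DiscreteGeometry.hcpKissingPattern, ∀ t : ↥T, dist (d⁻¹ • ((t : EuclideanSpace ℝ (Fin 3)) - y)) (A ((e t : ↥Literature.Geometry.DiscreteGeometry.hcpKissingPattern) : EuclideanSpace ℝ (Fin 3))) ≤ 1 / 20))) → (∃ s : ℤ → ℤ, Literature.MathematicalPhysics.StatisticalMechanics.IsHaggSeq s ∧ ∃ Φ : EuclideanSpace ℝ (Fin 3) → EuclideanSpace ℝ (Fin 3), Set.BijOn Φ (Literature.MathematicalPhysics.StatisticalMechanics.barlowStacking 1 (Real.sqrt (2 / 3))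 s) S ∧ ∀ p ∈ Literature.MathematicalPhysics.StatisticalMechanics.barlowStacking 1 (Real.sqrt (2 / 3)) s, ∃ A : EuclideanSpace ℝ (Fin 3) →ₗᵢ[ℝ] EuclideanSpace ℝ (Fin 3), ∃ l : ℝ, 0 < l ∧ ∀ q ∈ Literature.MathematicalPhysics.StatisticalMechanics.barlowStacking 1 (Real.sqrt (2 / 3)) s, dist q p ≤ 1 → dist (Φ q) (Φ p + l • A (q - p)) ≤ 1 / 20 * l) → ∀ (c : EuclideanSpace ℝ (Fin 3)) (L : ℝ), 0 ≤ L → 2 * ((Literature.MathematicalPhysics.StatisticalMechanics.hcpPeriodicConfiguration ha hh).energyPerParticle Literature.MathematicalPhysics.StatisticalMechanics.lennardJones) * (({y : EuclideanSpace ℝ (Fin 3) | y ∈ S ∧ dist y c ≤ L} : Set (EuclideanSpace ℝ (Fin 3))).ncard : ℝ) + κ * (({y : EuclideanSpace ℝ (Fin 3) | y ∈ S ∧ dist y c ≤ L ∧ ¬ (let T : Set (EuclideanSpace ℝ (Fin 3)) := {z : EuclideanSpace ℝ (Fin 3) | z ∈ S ∧ z ≠ y ∧ dist z y < 13 / 10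 * a}; let P : Set (EuclideanSpace ℝ (Fin 3)) := {p : EuclideanSpace ℝ (Fin 3) | p ∈ Literature.MathematicalPhysics.StatisticalMechanics.hcpStacking a h ∧ p ≠ 0 ∧ ‖p‖ < 13 / 10 * a}; ∃ A : EuclideanSpace ℝ (Fin 3) →ₗᵢ[ℝ] EuclideanSpace ℝ (Fin 3), ∃ e : ↥T ≃ ↥P, ∀ t : ↥T, dist ((t : EuclideanSpace ℝ (Fin 3)) - y) (A ((e t : ↥P) : EuclideanSpace ℝ (Fin 3))) ≤ η)} : Set (EuclideanSpace ℝ (Fin 3))).ncard : ℝ) - C * (L + 1) ^ 2 ≤ (∑' y : ↥{y : EuclideanSpace ℝ (Fin 3) | y ∈ S ∧ dist y c ≤ L}, (∑' z : ↥{z : EuclideanSpace ℝ (Fin 3) | z ∈ S ∧ z ≠ (y : EuclideanSpace ℝ (Fin 3))}, Literature.MathematicalPhysics.StatisticalMechanics.lennardJones (dist (y : EuclideanSpace ℝ (Fin 3)) (z : EuclideanSpace ℝ (Fin 3))))))) := by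
  intro hP hN hE
  obtain ⟨a, h, ha, hh, hbox, hmin⟩ := hP
  refine ⟨a, h, ha, hh, hbox, ?_⟩
  intro δ hδ η hη
  obtain ⟨κ₁, hκ₁, C₁, h₁⟩ := hN a h ha hh hbox hmin δ hδ
  obtain ⟨κ₂, hκ₂, C₂, h₂⟩ := hE a h ha hh hbox hmin δ hδ η hη
  refine ⟨min κ₁ κ₂ / 2, by positivity, (C₁ + C₂) / 2, ?_⟩
  intro S hsep hgood htempl c L hL
  have i₁ := h₁ S hsep hgood htempl c L hL
  have i₂ := h₂ S hsep hgood htempl c L hL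
  have hfin : ({y : EuclideanSpace ℝ (Fin 3) | y ∈ S ∧ dist y c ≤ L} : Set (EuclideanSpace ℝ (Fin 3))).Finite :=
    Literature.MathematicalPhysics.StatisticalMechanics.finite_of_forall_le_dist_of_subset_closedBall hδ
      (fun p hp q hq hpq => hsep p hp.1 q hq.1 hpq) (c := c) (R := L)
      (fun p hp => Metric.mem_closedBall.2 hp.2)
  exact priced_union_bound hfin hκ₁ hκ₂ i₁ i₂

/-- **The reduction, by name**: the crux B from the two sibling cruxes alone (all glue landed):
`HcpBulkFloor → HcpDefectCoercivity → HcpLandscapeGap`. -/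
theorem HcpLandscapeGap_of_hcpDefectCounting :
    Summit.AtomisticToContinuum.Crystallization.Theses.HcpDefectCounting.HcpBulkFloor →
    Summit.AtomisticToContinuum.Crystallization.Theses.HcpDefectCounting.HcpDefectCoercivity →
    Summit.AtomisticToContinuum.Crystallization.Theses.HullExactificationCascade.HcpLandscapeGap :=
  Summit.AtomisticToContinuum.Crystallization.Theorems.HcpLandscapeGapBirth.HcpLandscapeGap_of_glue
    Summit.AtomisticToContinuum.Crystallization.Theorems.HcpLandscapeGapBirth.stub_boxMinimiserRigid
    Summit.AtomisticToContinuum.Crystallization.Theorems.HcpLandscapeGapBirth.stub_shellGeometry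

/-- **The reduction of skeleton v4, by name**: the crux B from the shared crux 3062 (stub (R)), the
one-dimensional selection 12054 (stub (S)) and the sibling crux 14476:
`(R) → (S) → HcpDefectCoercivity → HcpLandscapeGap`.  No `sorry`. -/
theorem HcpLandscapeGap_of_periodicReduction :
    (∀ Q : Literature.MathematicalPhysics.StatisticalMechanics.PeriodicConfiguration 3, ∃ a h : ℝ, 47 / 50 ≤ a ∧ a ≤ 1 ∧ 39 / 50 * a ≤ h ∧ h ≤ 17 / 20 * a ∧ ∃ (s : ℤ → ℤ) (p : ℕ) (ha : a ≠ 0) (hh : h ≠ 0) (hp : p ≠ 0) (hs : ∀ i, s (i + p) = s i), Literature.MathematicalPhysics.StatisticalMechanics.IsHaggSeq s ∧ (Literature.MathematicalPhysics.StatisticalMechanics.barlowPeriodicConfiguration s ha hh hp hs).energyPerParticle Literature.MathematicalPhysics.StatisticalMechanics.lennardJones ≤ Q.energyPerParticle Literature.MathematicalPhysics.StatisticalMechanics.lennardJones) →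
    (∀ J : ℕ → ℝ, Summable (fun k : ℕ => (k : ℝ) * |J k|) → J 2 + ∑' k : ℕ, (if 3 ≤ k then ((k : ℝ) - 1) * |J k| else 0) ≤ 0 → IsLeast (Set.range fun s : {s : ℤ → ℤ // Literature.MathematicalPhysics.StatisticalMechanics.IsHaggSeq s} => Literature.MathematicalPhysics.StatisticalMechanics.haggStackingEnergy J s.1) (Literature.MathematicalPhysics.StatisticalMechanics.haggStackingEnergy J Literature.MathematicalPhysics.StatisticalMechanics.alternatingHagg)) →
    Summit.AtomisticToContinuum.Crystallization.Theses.HcpDefectCounting.HcpDefectCoercivity →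
    Summit.AtomisticToContinuum.Crystallization.Theses.HullExactificationCascade.HcpLandscapeGap :=
  fun hR hS hK => HcpLandscapeGap_of_hcpDefectCounting
    (hcpBulkFloor_of_hcpPeriodicMinimiser (hcpPeriodicMinimiser_of_stubs hR hS)) hK

/-! ## Alternative sufficient stub (skeleton v5, lead c4): templated coercivity at the box minimiser

B does not need the full sibling cruxes: `Theorems/…OfTemplatedCoercivity.lean` (p155072) proves
`HcpLandscapeGap_of_templatedCoercivity : stub_templatedCoercivity-statement → HcpLandscapeGap`, and
`templatedCoercivity_of_hcpDefectCounting : HcpBulkFloor → HcpDefectCoercivity → (it)`.  So the crux closes from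
EITHER stub set: {`stub_periodicReductionToBarlow` (3062), `stub_hcpDefectCoercivity` (14476)} (composition
`HcpLandscapeGap_of_stubs` above) OR {`stub_templatedCoercivity`} alone (composition `HcpLandscapeGap_of_stubT`
below).  The templated stub is crux-sized (nonlinear elastic + stacking stability of LJ-hcp in the 1/20-templated
class, XL) but free of the Kepler-type / energy→twelve-coordination content of 3062 / 14476. -/

/-! ## Skeleton v6–v9 (lead c5, 2026-08-17): the EXACT-BARLOW cut of stub T

v9 (end of cycle 1, c5): LANDED this cycle — E1 p158213, G1 p157977, G2 p157978, T_exact p158625, PW p159154, T_exact-all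
p159511, B_exact p160188 (the crux's own conclusion on the exact Barlow class).  Registered open stubs: T (`stub_templatedCoercivity`)
for this composition; R (= item 3062), K (= item 14476) for the v4 composition.

v8: T_exact LANDED (p158625); open registered stubs of this composition: `stub_periodiseWindow` (worker, wave 2) and
`stub_templatedCoercivity` (T, XL/open); of the v4 composition: R (= item 3062), K (= item 14476).

v7: E1, G1, G2 LANDED (p158213, p157977, p157978) and re-exported; T_exact = `stub_exactBarlowPricing` (lead; assembled,
landing); the open registered stub is again T = `stub_templatedCoercivity`, now with T_exact available as a theorem
(`templatedCoercivity_of_lift : (T_exact → T) → T`).  Registry signatures are capped at 3900 characters, which is why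
the lift `T_exact → T` is not registered under its own name.

`stub_templatedCoercivity` (T) is no longer a stub: it is DERIVED from
* `exactBarlowPricing` (T_exact) — T for windows of EXACT rigid images `v + B '' barlowStacking a' h' s` of
  uniform Barlow stackings (any periodic Hägg word `s`, any scale `(a', h')` in the box of route HcpDefectCounting
  `47/50 ≤ a' ≤ 1`, `39/50·a' ≤ h' ≤ 17/20·a'`, any linear isometry `B` and translation `v`), itself ASSEMBLED
  (`stub_exactAssembly`, the lead's; to be discharged in this skeleton) from three worker-sized stubs:
  - `stub_exactWindowEnergy` (E1, energy): the finite window energy dominates the sum of the Barlow site energies of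
    its sites (all pair interactions in such a stacking are `≤ 0`: pair distances `≥ √(a'²/3 + h'²) > 2^(-1/6)`;
    the punctured lattice sum at a site of layer `m` is `2·barlowSiteEnergy … m`);
  - `stub_goodOfNoBadBond` (G1, geometry): a site with no bad bond (`s (k+1) = s k`) within `K` layers, at a scale
    `δ₁`-close to `(a, h)`, is two-way `θ`-matched at radius `4` to `hcpStacking a h` after a linear isometry
    (`PricedHcpWindowsIdealGeometry.matched_of_noBadBond` + `hcpStacking_homogeneous`);
  - `stub_chargeToBadBond` (G2, counting): window sites within `K` layers of a bad bond are charged, `M`-to-one, to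
    window sites ON a bad-bond layer or to the boundary layer of depth `ρ`;
  together with the tree's certified inputs used in the assembly: the Lennard-Jones site-energy column on the box
  (`PalmGoodLaw.SiteColumnLJ.stub_siteColumnLJ`: `e(hcp a' h') + ½(J₃−J₂)·#cubic sides ≤ barlowSiteEnergy`), the
  uniform gap `J₃ − J₂ ≥ ¾|J₂| ≥ ¾c₀` (`stub_J2neg`, `stub_ljDomination`), the box modulus (`stub_hcpBoxModulus`),
  the rigidity of B's minimiser (`stub_boxMinimiserRigid`) and the boundary layer (`stub_boundaryLayer`);
* `stub_lift` (T_lift := T_exact → T) — the genuinely open remainder: pricing survives `1/20`-templated relaxation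
  (non-uniform interlayer relaxation, elastic strain, aperiodic template words by periodisation of windows).
Composition: `HcpLandscapeGap_of_stubT : HcpLandscapeGap` (unchanged name) now has cone sorries exactly
{E1, G1, G2, stub_exactAssembly, stub_lift}; the v4 composition `HcpLandscapeGap_of_stubs` keeps {R, K}. -/

/-- **Stub E1 — exact window energy ≥ sum of Barlow site energies** — LANDED p158213 (wave 1), re-exported. For `(a,h)` in the HcpDefectCounting box, a
periodic Hägg word `s`, a rigid motion `w ↦ v + B w` and an injective finite family `x` of image points with layer
indices `m t`: `Σ_t barlowSiteEnergy LJ a h s (m t) ≤ 𝓔_LJ(x)`.  [size M: `two_mul_interactionEnergy`; every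
pair of the stacking is at distance `≥ min(a, √(a²/3+h²), 2h) ≥ 0.912 > 2^(-1/6)` so `V_LJ ≤ 0` termwise and a
finite partial sum of the (summable, `summable_lennardJones_barlowPos`) punctured site sum dominates the full sum
`= 2·barlowSiteEnergy` (`tsum_points_eq_two_mul_barlowSiteEnergy` + in-layer translation invariance)] -/
theorem stub_exactWindowEnergy : (∀ (a h : ℝ), 47 / 50 ≤ a → a ≤ 1 → 39 / 50 * a ≤ h → h ≤ 17 / 20 * a → ∀ s : ℤ → ℤ, Literature.MathematicalPhysics.StatisticalMechanics.IsHaggSeq s → ∀ p : ℕ, p ≠ 0 → (∀ i : ℤ, s (i + p) = s i) → ∀ (B : EuclideanSpace ℝ (Fin 3) →ₗᵢ[ℝ] EuclideanSpace ℝ (Fin 3)) (v : EuclideanSpace ℝ (Fin 3)) (n : ℕ) (x : Fin n → EuclideanSpace ℝ (Fin 3)), Function.Injective x → ∀ (m i j : Fin n → ℤ), (∀ t : Fin n, x t = v + B (Literature.MathematicalPhysics.StatisticalMechanics.barlowPos a h s (m t) (i t) (j t))) → ∑ t : Fin n, Literature.MathematicalPhysics.StatisticalMechanics.barlowSiteEnergy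 Literature.MathematicalPhysics.StatisticalMechanics.lennardJones a h s (m t) ≤ Literature.MathematicalPhysics.StatisticalMechanics.interactionEnergy Literature.MathematicalPhysics.StatisticalMechanics.lennardJones x) :=
  Summit.AtomisticToContinuum.Crystallization.Theorems.HcpLandscapeGapBirth.stub_exactWindowEnergy

/-- **Stub G1 — no bad bond nearby ⇒ Good(4,θ) after a linear isometry** — LANDED p157977 (wave 1), re-exported. [size M: `matched_of_noBadBond`
(R = 4 + θ, ε = θ) gives a translation matching with `barlowStacking a h alternatingHagg = hcpStacking a h` based at
a point `z₀`; `hcpStacking_homogeneous` turns `z − z₀` into `A₂ q`, `q ∈ hcpStacking a h`; transport by the rigid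
motion and the in-layer shift `(i, j)` (`mem_barlowStacking_iff_sub_mem_shift`)] -/
theorem stub_goodOfNoBadBond : (∀ (a h : ℝ), 0 < a → 0 < h → ∀ θ : ℝ, 0 < θ → ∃ δ₁ : ℝ, 0 < δ₁ ∧ ∃ K : ℕ, ∀ (a' h' : ℝ), a' ≠ 0 → h' ≠ 0 → |a' - a| ≤ δ₁ → |h' - h| ≤ δ₁ → ∀ s : ℤ → ℤ, Literature.MathematicalPhysics.StatisticalMechanics.IsHaggSeq s → ∀ (B : EuclideanSpace ℝ (Fin 3) →ₗᵢ[ℝ] EuclideanSpace ℝ (Fin 3)) (v : EuclideanSpace ℝ (Fin 3)) (m i j : ℤ), (∀ k : ℤ, |k - m| ≤ K → s (k + 1) ≠ s k) → ∃ A₂ : EuclideanSpace ℝ (Fin 3) →ₗᵢ[ℝ] EuclideanSpace ℝ (Fin 3), (∀ q ∈ Literature.MathematicalPhysics.StatisticalMechanics.hcpStacking a h, ‖q‖ ≤ 4 → ∃ z ∈ (fun w => v + B w) '' Literature.MathematicalPhysics.StatisticalMechanics.barlowStacking a' h' s, dist z (v + B (Literature.MathematicalPhysics.StatisticalMechanics.barlowPos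 a' h' s m i j)) ≤ 4 + θ ∧ dist z ((v + B (Literature.MathematicalPhysics.StatisticalMechanics.barlowPos a' h' s m i j)) + A₂ q) ≤ θ) ∧ (∀ z ∈ (fun w => v + B w) '' Literature.MathematicalPhysics.StatisticalMechanics.barlowStacking a' h' s, dist z (v + B (Literature.MathematicalPhysics.StatisticalMechanics.barlowPos a' h' s m i j)) ≤ 4 → ∃ q ∈ Literature.MathematicalPhysics.StatisticalMechanics.hcpStacking a h, dist z ((v + B (Literature.MathematicalPhysics.StatisticalMechanics.barlowPos a' h' s m i j)) + A₂ q) ≤ θ)) :=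
  Summit.AtomisticToContinuum.Crystallization.Theorems.HcpLandscapeGapBirth.stub_goodOfNoBadBond

/-- **Stub G2 — charging sites near a bad bond to bad-bond layers or to the boundary** — LANDED p157978 (wave 1), re-exported. [size M: for `t` with a
bad bond `k`, `|k − m t| ≤ K`, `exists_barlowPos_dist_le_of_layer` gives a stacking point of layer `k` within
`K·h + 2 ≤ K + 2` of `x t`; if it lies in the ball it is some `x t'` with `m t' = k` (`barlowPos_injective`),
else `dist (x t) c > L − (K + 2)`; fibres of `t ↦ t'` have `≤ M` points by `min a h ≥ 0.73`-separation] -/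
theorem stub_chargeToBadBond : (∀ K : ℕ, ∃ M : ℕ, ∃ ρ : ℝ, 0 ≤ ρ ∧ ∀ (a h : ℝ), 47 / 50 ≤ a → a ≤ 1 → 39 / 50 * a ≤ h → h ≤ 17 / 20 * a → ∀ (s : ℤ → ℤ) (B : EuclideanSpace ℝ (Fin 3) →ₗᵢ[ℝ] EuclideanSpace ℝ (Fin 3)) (v c : EuclideanSpace ℝ (Fin 3)) (L : ℝ) (n : ℕ) (x : Fin n → EuclideanSpace ℝ (Fin 3)), Function.Injective x → Set.range x = {y : EuclideanSpace ℝ (Fin 3) | y ∈ (fun w => v + B w) '' Literature.MathematicalPhysics.StatisticalMechanics.barlowStacking a h s ∧ dist y c ≤ L} → ∀ (m i j : Fin n → ℤ), (∀ t : Fin n, x t = v + B (Literature.MathematicalPhysics.StatisticalMechanics.barlowPos a h s (m t) (i t) (j t))) → Nat.card {t : Fin n // ∃ k : ℤ, |k - m t| ≤ K ∧ s (k + 1) = s k} ≤ M * Nat.card {t : Fin n // s (m t + 1) = s (m t)} + Nat.card {t : Fin n // L - ρ < dist (x t) c}) :=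
  Summit.AtomisticToContinuum.Crystallization.Theorems.HcpLandscapeGapBirth.stub_chargeToBadBond

/-- **Stub T_exact (lead) — the exact-Barlow pricing**: B's priced inequality for windows of exact rigid images of
uniform Barlow stackings (all periodic Hägg words, all scales in the HcpDefectCounting box, all linear isometries +
translations), at B's box minimiser.  ASSEMBLED by the lead from the landed E1, G1, G2 over the tree's certified
column / gap / modulus / rigidity / boundary-layer theorems — LANDED p158625
(`Theorems/HullExactificationCascadeHcpLandscapeGapExactBarlowPricing.lean`), re-exported. -/
theorem stub_exactBarlowPricing : (∀ (a h : ℝ) (ha : a ≠ 0) (hh : h ≠ 0), (9 / 10 < a ∧ a < 1 ∧ |h - a * Real.sqrt (2 / 3)| ≤ a / 100) → (∀ a' h' : ℝ, ∀ ha' : a' ≠ 0, ∀ hh' : h' ≠ 0, (9 / 10 < a' ∧ a' < 1 ∧ |h' - a' * Real.sqrt (2 / 3)| ≤ a' / 100) → (Literature.MathematicalPhysics.StatisticalMechanics.hcpPeriodicConfiguration ha hh).energyPerParticle Literature.MathematicalPhysics.StatisticalMechanics.lennardJones ≤ (Literature.MathematicalPhysics.StatisticalMechanics.hcpPeriodicConfiguration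 ha' hh').energyPerParticle Literature.MathematicalPhysics.StatisticalMechanics.lennardJones) → ∀ θ : ℝ, 0 < θ → ∃ κ : ℝ, 0 < κ ∧ ∃ C : ℝ, ∀ (a' h' : ℝ), 47 / 50 ≤ a' → a' ≤ 1 → 39 / 50 * a' ≤ h' → h' ≤ 17 / 20 * a' → ∀ s : ℤ → ℤ, Literature.MathematicalPhysics.StatisticalMechanics.IsHaggSeq s → ∀ p : ℕ, p ≠ 0 → (∀ i : ℤ, s (i + p) = s i) → ∀ (B : EuclideanSpace ℝ (Fin 3) →ₗᵢ[ℝ] EuclideanSpace ℝ (Fin 3)) (v c : EuclideanSpace ℝ (Fin 3)) (L : ℝ), 0 ≤ L → ∀ (n : ℕ) (x : Fin n → EuclideanSpace ℝ (Fin 3)), Function.Injective x → Set.range x = {y : EuclideanSpace ℝ (Fin 3) | y ∈ (fun w => v + B w) '' Literature.MathematicalPhysics.StatisticalMechanics.barlowStacking a' h' s ∧ dist y c ≤ L} → (n : ℝ) * (Literature.MathematicalPhysics.StatisticalMechanics.hcpPeriodicConfiguration ha hh).energyPerParticle Literature.MathematicalPhysics.StatisticalMechanics.lennardJones + κ * (Nat.card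 {i : Fin n // ¬ (∃ A : EuclideanSpace ℝ (Fin 3) →ₗᵢ[ℝ] EuclideanSpace ℝ (Fin 3), (∀ p ∈ (Literature.MathematicalPhysics.StatisticalMechanics.hcpPeriodicConfiguration ha hh).points, ‖p‖ ≤ 4 → ∃ j : Fin n, dist (x j) (x i + A p) ≤ θ) ∧ (∀ j : Fin n, dist (x j) (x i) ≤ 4 → ∃ p ∈ (Literature.MathematicalPhysics.StatisticalMechanics.hcpPeriodicConfiguration ha hh).points, dist (x j) (x i + A p) ≤ θ))} : ℝ) ≤ Literature.MathematicalPhysics.StatisticalMechanics.interactionEnergy Literature.MathematicalPhysics.StatisticalMechanics.lennardJones x + C * (L + 1) ^ 2) :=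
  Summit.AtomisticToContinuum.Crystallization.Theorems.HcpLandscapeGapBirth.stub_exactBarlowPricing

/-- **Stub PW — periodising the word behind a window** — LANDED p159154 (wave 2), re-exported: the part of an exact rigid
image of `barlowStacking a h s` inside a closed ball coincides with that of `barlowStacking a h s'` for some PERIODIC
Hägg word `s'` (periodise `s` outside the finitely many layers `|k| ≤ (L + dist v c)/h` that can meet the ball; the
layer labels `haggLabel` are cumulative sums from `0`, so they agree on those layers). [size S/M] -/
theorem stub_periodiseWindow : (∀ (a h : ℝ), 0 < h → ∀ s : ℤ → ℤ, Literature.MathematicalPhysics.StatisticalMechanics.IsHaggSeq s → ∀ (B : EuclideanSpace ℝ (Fin 3) →ₗᵢ[ℝ] EuclideanSpace ℝ (Fin 3)) (v c : EuclideanSpace ℝ (Fin 3)) (L : ℝ), ∃ (s' : ℤ → ℤ) (p : ℕ), p ≠ 0 ∧ (∀ i : ℤ, s' (i + p) = s' i) ∧ Literature.MathematicalPhysics.StatisticalMechanics.IsHaggSeq s' ∧ {y : EuclideanSpace ℝ (Fin 3) | y ∈ (fun w => v + B w) '' Literature.MathematicalPhysics.StatisticalMechanics.barlowStacking a h s ∧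 dist y c ≤ L} = {y : EuclideanSpace ℝ (Fin 3) | y ∈ (fun w => v + B w) '' Literature.MathematicalPhysics.StatisticalMechanics.barlowStacking a h s' ∧ dist y c ≤ L}) :=
  Summit.AtomisticToContinuum.Crystallization.Theorems.HcpLandscapeGapBirth.stub_periodiseWindow

/-- **Stub T_exact-all (lead) — T_exact for ALL Hägg words** (aperiodic included), from `exactBarlowPricing` (periodic
words) and `stub_periodiseWindow`: both sides of the priced inequality depend on the window only — LANDED p159511,
re-exported. -/
theorem stub_exactBarlowPricingAllWords : (∀ (a h : ℝ) (ha : a ≠ 0) (hh : h ≠ 0), (9 / 10 < a ∧ a < 1 ∧ |h - a * Real.sqrt (2 / 3)| ≤ a / 100) → (∀ a' h' : ℝ, ∀ ha' : a' ≠ 0, ∀ hh' : h' ≠ 0, (9 / 10 < a' ∧ a' < 1 ∧ |h' - a' * Real.sqrt (2 / 3)| ≤ a' / 100) → (Literature.MathematicalPhysics.StatisticalMechanics.hcpPeriodicConfiguration ha hh).energyPerParticle Literature.MathematicalPhysics.StatisticalMechanics.lennardJones ≤ (Literature.MathematicalPhysics.StatisticalMechanics.hcpPeriodicConfiguration ha'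 hh').energyPerParticle Literature.MathematicalPhysics.StatisticalMechanics.lennardJones) → ∀ θ : ℝ, 0 < θ → ∃ κ : ℝ, 0 < κ ∧ ∃ C : ℝ, ∀ (a' h' : ℝ), 47 / 50 ≤ a' → a' ≤ 1 → 39 / 50 * a' ≤ h' → h' ≤ 17 / 20 * a' → ∀ s : ℤ → ℤ, Literature.MathematicalPhysics.StatisticalMechanics.IsHaggSeq s → ∀ (B : EuclideanSpace ℝ (Fin 3) →ₗᵢ[ℝ] EuclideanSpace ℝ (Fin 3)) (v c : EuclideanSpace ℝ (Fin 3)) (L : ℝ), 0 ≤ L → ∀ (n : ℕ) (x : Fin n → EuclideanSpace ℝ (Fin 3)), Function.Injective x → Set.range x = {y : EuclideanSpace ℝ (Fin 3) | y ∈ (fun w => v + B w) '' Literature.MathematicalPhysics.StatisticalMechanics.barlowStacking a' h' s ∧ dist y c ≤ L} → (n : ℝ) * (Literature.MathematicalPhysics.StatisticalMechanics.hcpPeriodicConfiguration ha hh).energyPerParticle Literature.MathematicalPhysics.StatisticalMechanics.lennardJones + κ * (Nat.card {i : Fin n // ¬ (∃ A : EuclideanSpace ℝ (Fin 3) →ₗᵢ[ℝ]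 EuclideanSpace ℝ (Fin 3), (∀ p ∈ (Literature.MathematicalPhysics.StatisticalMechanics.hcpPeriodicConfiguration ha hh).points, ‖p‖ ≤ 4 → ∃ j : Fin n, dist (x j) (x i + A p) ≤ θ) ∧ (∀ j : Fin n, dist (x j) (x i) ≤ 4 → ∃ p ∈ (Literature.MathematicalPhysics.StatisticalMechanics.hcpPeriodicConfiguration ha hh).points, dist (x j) (x i + A p) ≤ θ))} : ℝ) ≤ Literature.MathematicalPhysics.StatisticalMechanics.interactionEnergy Literature.MathematicalPhysics.StatisticalMechanics.lennardJones x + C * (L + 1) ^ 2) :=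
  Summit.AtomisticToContinuum.Crystallization.Theorems.HcpLandscapeGapBirth.stub_exactBarlowPricingAllWords

/-- **Stub B_exact (lead) — the crux B ON THE EXACT BARLOW CLASS**: B's conclusion verbatim (witness = the landed box
minimiser; `2e·#window + κ(η)·#{η-bad shells} − C(L+1)² ≤ Σ site energies`) for every exact rigid image of a uniform
Barlow stacking at a scale in the HcpDefectCounting box, every Hägg word (B's two `let`s ζ-reduced: the registry cuts a
signature at the first `:=`).  Derived from `exactBarlowPricingAllWords` by
the pattern of `masterT_at` (`stub_shellGeometry` turns Good(4,θ) into η-congruent shells, `stub_boundaryLayer` turns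
`2·𝓔(window)` into the sum of site energies) — LANDED p160188 (`Theorems/…HcpLandscapeGapExactBarlowClass.lean`), re-exported. -/
theorem stub_hcpLandscapeGap_exactBarlow : ∃ a h : ℝ, ∃ ha : a ≠ 0, ∃ hh : h ≠ 0, (9 / 10 < a ∧ a < 1 ∧ |h - a * Real.sqrt (2 / 3)| ≤ a / 100) ∧ (∀ η : ℝ, 0 < η → ∃ κ : ℝ, 0 < κ ∧ ∃ C : ℝ, ∀ (a' h' : ℝ), 47 / 50 ≤ a' → a' ≤ 1 → 39 / 50 * a' ≤ h' → h' ≤ 17 / 20 * a' → ∀ s : ℤ → ℤ, Literature.MathematicalPhysics.StatisticalMechanics.IsHaggSeq s → ∀ (B : EuclideanSpace ℝ (Fin 3) →ₗᵢ[ℝ] EuclideanSpace ℝ (Fin 3)) (v c : EuclideanSpace ℝ (Fin 3)) (L : ℝ), 0 ≤ L → 2 * ((Literature.MathematicalPhysics.StatisticalMechanics.hcpPeriodicConfiguration ha hh).energyPerParticle Literature.MathematicalPhysics.StatisticalMechanics.lennardJones) * (({y : EuclideanSpace ℝ (Fin 3) | y ∈ ((fun w => v + B w) '' Literature.MathematicalPhysics.StatisticalMechanics.barlowStacking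 a' h' s) ∧ dist y c ≤ L} : Set (EuclideanSpace ℝ (Fin 3))).ncard : ℝ) + κ * (({y : EuclideanSpace ℝ (Fin 3) | y ∈ ((fun w => v + B w) '' Literature.MathematicalPhysics.StatisticalMechanics.barlowStacking a' h' s) ∧ dist y c ≤ L ∧ ¬ (∃ A : EuclideanSpace ℝ (Fin 3) →ₗᵢ[ℝ] EuclideanSpace ℝ (Fin 3), ∃ e : ↥{z : EuclideanSpace ℝ (Fin 3) | z ∈ ((fun w => v + B w) '' Literature.MathematicalPhysics.StatisticalMechanics.barlowStacking a' h' s) ∧ z ≠ y ∧ dist z y < 13 / 10 * a} ≃ ↥{p : EuclideanSpace ℝ (Fin 3) | p ∈ Literature.MathematicalPhysics.StatisticalMechanics.hcpStacking a h ∧ p ≠ 0 ∧ ‖p‖ < 13 / 10 * a}, ∀ t : ↥{z : EuclideanSpace ℝ (Fin 3) | z ∈ ((fun w => v + B w) '' Literature.MathematicalPhysics.StatisticalMechanics.barlowStacking a' h' s) ∧ z ≠ y ∧ dist z y < 13 / 10 * a}, dist ((t : EuclideanSpace ℝ (Fin 3)) - y) (A ((e t : ↥{p : EuclideanSpace ℝ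 (Fin 3) | p ∈ Literature.MathematicalPhysics.StatisticalMechanics.hcpStacking a h ∧ p ≠ 0 ∧ ‖p‖ < 13 / 10 * a}) : EuclideanSpace ℝ (Fin 3))) ≤ η)} : Set (EuclideanSpace ℝ (Fin 3))).ncard : ℝ) - C * (L + 1) ^ 2 ≤ (∑' y : ↥{y : EuclideanSpace ℝ (Fin 3) | y ∈ ((fun w => v + B w) '' Literature.MathematicalPhysics.StatisticalMechanics.barlowStacking a' h' s) ∧ dist y c ≤ L}, (∑' z : ↥{z : EuclideanSpace ℝ (Fin 3) | z ∈ ((fun w => v + B w) '' Literature.MathematicalPhysics.StatisticalMechanics.barlowStacking a' h' s) ∧ z ≠ (y : EuclideanSpace ℝ (Fin 3))}, Literature.MathematicalPhysics.StatisticalMechanics.lennardJones (dist (y : EuclideanSpace ℝ (Fin 3)) (z : EuclideanSpace ℝ (Fin 3)))))) :=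
  Summit.AtomisticToContinuum.Crystallization.Theorems.HcpLandscapeGapBirth.stub_hcpLandscapeGap_exactBarlow

/-! ## Skeleton v10 (lead c6, 2026-08-17): the RELAXED-BARLOW cut of stub T

`T ⟸ T_relaxed ∧ lift`.  T_relaxed is T's priced inequality for windows of rigid images of the Barlow
multilattices `barlowStackingH a' H s` of `Literature/…/BarlowStackingHeights` (exact triangular layers and A/B/C
registry, in-layer scale `a' ∈ [47/50, 1]`, arbitrary heights `H` with spacings `H (k+1) − H k ∈ [39a'/50, 17a'/20]`,
every Hägg word `s`): every cubic bond `s (m+1) = s m`, every spacing off `h` and every in-layer scale off `a`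
(`(a, h)` = B's box minimiser) is paid for at a flat rate, with `O((L+1)²)` boundary slack.  It is assembled by the
lead (Theorems file `…HcpLandscapeGapRelaxedBarlowPricing.lean`, to be landed) from the four registered stubs below:

* RC `stub_relaxedColumn` (lead) — the one-dimensional RELAXED COLUMN INEQUALITY: for a column of consecutive layers
  `M₁ … M₂` of the multilattice, the sum of the full site energies exceeds `(M₂−M₁+1)·2e_LJ(hcp a h)` by
  `g·(#cubic bonds + Σ_m ((a'−a)² + (H(m+1)−H m−h)²)) − C`.  Mechanism: (i) the registry coupling
  `D_a(t) = barlowCoupling LJ a t 1` is `≤ 0` and non-decreasing in the CONTINUOUS height `t ≥ 39a/25`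
  (`LayeredHull.stub_registry`), so the certified half-domination of `stub_ljDomination` (constants `R`, `C_F`, `ρ`)
  holds pair by pair for MIXED heights, pricing cubic bonds; (ii) the hcp-pattern column energy is uniformly convex
  in the spacing profile — the curvature of the offset layer sum on the nearest band, `≥ 6.51` at the soft corner
  `a' = 1` (lattice-sum numerics), dominates `Σ_k k²·(concavity of the k-th layer sums) ≤ 2.10`; with a zero-stress
  reference spacing `h₀(a')` (intermediate value theorem on the band) and the landed box modulus
  (`modulus_at_boxMinimiser`) this prices spacings and scale quadratically.
* RS `stub_siteEnergyHeights` (worker) — the full site energy of a multilattice point is the in-layer sum plus the layer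
  interactions `layerInteraction LJ a' (H k − H m) (haggLabel s k − haggLabel s m) 1`, summably.
* RF `stub_fibreDecomposition` (worker) — a ball window of the multilattice is a disjoint union of vertical FIBRE
  INTERVALS (one site per layer over an integer interval of layers), `≤ C(L+1)²` of them, up to sites within depth `5`
  of the boundary sphere.
* RG `stub_goodOfNoBadBondHeights` (worker) — a site with no cubic bond within `K` layers, spacings `δ₁`-close to `h`
  within `K` layers and `|a'−a| ≤ δ₁` is two-way `θ`-matched at radius `4` to `hcpStacking a h` after a linear isometry
  (heights analogue of G1).
-/

/-- **Stub RS — site energy of a Barlow multilattice point, layer by layer** — LANDED p163097 (wave 1), re-exported.  For `a ∈ [47/50, 1]`, a Hägg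
word `s`, heights `H` with spacings in `[39a/50, 17a/20]` and a point `p = barlowPosH a H s m i j`: the family
`z ↦ V_LJ(dist p z)` over the other points of `barlowStackingH a H s` is summable, the layer series is summable, and
`Σ'_{z ≠ p} V_LJ(dist p z) = inLayerInteraction LJ a + Σ'_{k ≠ m} layerInteraction LJ a (H k − H m) (haggLabel s k − haggLabel s m) 1`
(regroup the absolutely summable family over `(k, i', j')` by layers; in-layer translation by `(i, j)`;
`barlowPosH k i' j' − p = layerVec a (H k − H m) (L k − L m) 1 (i'−i) (j'−j)`). [size M/L; tree: `BarlowStackingEnergy`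
(`tsum_layer`, `barlowSiteEnergy_eq` pattern), `LayerSumDecay` (`abs_layerInteraction_lennardJones_le`),
`summable_lennardJones_site`-type bounds for separated sets, `le_dist_of_mem_barlowStackingH`] -/
theorem stub_siteEnergyHeights : ∀ (a : ℝ), 47 / 50 ≤ a → a ≤ 1 → ∀ s : ℤ → ℤ, Literature.MathematicalPhysics.StatisticalMechanics.IsHaggSeq s → ∀ H : ℤ → ℝ, (∀ k : ℤ, 39 / 50 * a ≤ H (k + 1) - H k ∧ H (k + 1) - H k ≤ 17 / 20 * a) → ∀ m i j : ℤ, Summable (fun z : ↥{z : EuclideanSpace ℝ (Fin 3) | z ∈ Literature.MathematicalPhysics.StatisticalMechanics.barlowStackingH a H s ∧ z ≠ Literature.MathematicalPhysics.StatisticalMechanics.barlowPosH a H s m i j} => Literature.MathematicalPhysics.StatisticalMechanics.lennardJones (dist (Literature.MathematicalPhysics.StatisticalMechanics.barlowPosH a H s m i j) (z : EuclideanSpace ℝ (Fin 3)))) ∧ Summable (fun k : ℤ => if k = m then (0 : ℝ) else Literature.MathematicalPhysics.StatisticalMechanics.layerInteraction Literature.MathematicalPhysics.StatisticalMechanics.lennardJones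 a (H k - H m) (Literature.MathematicalPhysics.StatisticalMechanics.haggLabel s k - Literature.MathematicalPhysics.StatisticalMechanics.haggLabel s m) 1) ∧ (∑' z : ↥{z : EuclideanSpace ℝ (Fin 3) | z ∈ Literature.MathematicalPhysics.StatisticalMechanics.barlowStackingH a H s ∧ z ≠ Literature.MathematicalPhysics.StatisticalMechanics.barlowPosH a H s m i j}, Literature.MathematicalPhysics.StatisticalMechanics.lennardJones (dist (Literature.MathematicalPhysics.StatisticalMechanics.barlowPosH a H s m i j) (z : EuclideanSpace ℝ (Fin 3)))) = Literature.MathematicalPhysics.StatisticalMechanics.inLayerInteraction Literature.MathematicalPhysics.StatisticalMechanics.lennardJones a + ∑' k : ℤ, (if k = m then (0 : ℝ) else Literature.MathematicalPhysics.StatisticalMechanics.layerInteraction Literature.MathematicalPhysics.StatisticalMechanics.lennardJones a (H k - H m) (Literature.MathematicalPhysics.StatisticalMechanics.haggLabel s k - Literature.MathematicalPhysics.StatisticalMechanics.haggLabel s m) 1) :=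
  Summit.AtomisticToContinuum.Crystallization.Theorems.HcpLandscapeGapBirth.stub_siteEnergyHeights

/-- **Stub RF — fibre decomposition of a ball window of a Barlow multilattice** — LANDED p163443 (wave 1), re-exported.  There is an absolute `C`
such that for `a ∈ [47/50,1]`, Hägg `s`, heights `H` with spacings in the band, every centre `c` and radius `L ≥ 0`
there are: a finite set `F` of fibre indices with `#F ≤ C(L+1)²`, layer intervals `[M₁ f, M₂ f]` (possibly empty) and
in-layer indices `ι f k` (injective in `f` for each layer `k`) such that every fibre site `barlowPosH a H s k (ι f k)`
with `k ∈ [M₁ f, M₂ f]` lies in the closed ball, and every multilattice point of the ball not so covered lies within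
depth `5` of the boundary sphere.  (Intended construction: fibre `f = (I, J)` collects the points whose in-plane position
is `I u + J v + r w`, `r = haggLabel s k mod 3`, i.e. `ι f k = (I − ⌊L_k/3⌋, J − ⌊L_k/3⌋)`; `[M₁ f, M₂ f]` = the layers with
`(H k − c₃)² ≤ L² − (ρ_f + 6/5)²`, an interval since `H` is increasing; uncovered ball points have
`dist > √(L² − 24L/5) ≥ L − 5`; `#F` by planar lattice-point counting `card_filter_planarForm_lt_le`.) [size M] -/
theorem stub_fibreDecomposition : ∃ C : ℝ, ∀ (a : ℝ), 47 / 50 ≤ a → a ≤ 1 → ∀ s : ℤ → ℤ, Literature.MathematicalPhysics.StatisticalMechanics.IsHaggSeq s → ∀ H : ℤ → ℝ, (∀ k : ℤ, 39 / 50 * a ≤ H (k + 1) - H k ∧ H (k + 1) - H k ≤ 17 / 20 * a) → ∀ (c : EuclideanSpace ℝ (Fin 3)) (L : ℝ), 0 ≤ L → ∃ (F : Finset (ℤ × ℤ)) (M₁ M₂ : ℤ × ℤ → ℤ) (ι : ℤ × ℤ → ℤ → ℤ × ℤ), (F.card : ℝ) ≤ C * (L + 1) ^ 2 ∧ (∀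 k : ℤ, Function.Injective (fun f : ℤ × ℤ => ι f k)) ∧ (∀ f ∈ F, ∀ k : ℤ, M₁ f ≤ k → k ≤ M₂ f → dist (Literature.MathematicalPhysics.StatisticalMechanics.barlowPosH a H s k (ι f k).1 (ι f k).2) c ≤ L) ∧ (∀ k i j : ℤ, dist (Literature.MathematicalPhysics.StatisticalMechanics.barlowPosH a H s k i j) c ≤ L → (∃ f ∈ F, M₁ f ≤ k ∧ k ≤ M₂ f ∧ ι f k = (i, j)) ∨ L - 5 < dist (Literature.MathematicalPhysics.StatisticalMechanics.barlowPosH a H s k i j) c) :=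
  Summit.AtomisticToContinuum.Crystallization.Theorems.HcpLandscapeGapBirth.stub_fibreDecomposition

/-- **Stub RG — no cubic bond and near-`h` spacings nearby ⇒ Good(4,θ) after a linear isometry, for multilattices** — LANDED p163150 (wave 1), re-exported
( heights analogue of G1 `stub_goodOfNoBadBond`).  For `a, h > 0` and `θ > 0` there are `δ₁ > 0`, `K` such that
for `|a' − a| ≤ δ₁`, Hägg `s`, heights `H` with all spacings `≥ h/2`, and a site `p = barlowPosH a' H s m i j` with no
cubic bond (`s (k+1) = s k`) and all spacings `δ₁`-close to `h` for `|k − m| ≤ K`: the multilattice is two-way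
`θ`-matched within radius `4` of `p` to `p + A₂ '' hcpStacking a h` for some linear isometry `A₂`.  (Only layers
`|k − m| ≤ 8/h + 1` meet the ball; there the labels alternate, so the local pattern is `ABAB` = hcp up to a rigid motion
(`hcpStacking_homogeneous`, `matched_of_noBadBond` pattern of G1), and positions differ from the exact `hcpStacking a h`
ones by `≤ (|k−m| + 5/a)·δ₁ ≤ θ`.) [size M] -/
theorem stub_goodOfNoBadBondHeights : ∀ (a h : ℝ), 0 < a → 0 < h → ∀ θ : ℝ, 0 < θ → ∃ δ₁ : ℝ, 0 < δ₁ ∧ ∃ K : ℕ, ∀ a' : ℝ, |a' - a| ≤ δ₁ → ∀ s : ℤ → ℤ, Literature.MathematicalPhysics.StatisticalMechanics.IsHaggSeq s → ∀ H : ℤ → ℝ, (∀ k : ℤ, h / 2 ≤ H (k + 1) - H k) → ∀ m i j : ℤ, (∀ k : ℤ, |k - m| ≤ K → s (k + 1) ≠ s k) → (∀ k : ℤ, |k - m| ≤ K → |H (k + 1) - H k - h| ≤ δ₁) → ∃ A₂ : EuclideanSpace ℝ (Fin 3) →ₗᵢ[ℝ] EuclideanSpace ℝ (Fin 3), (∀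 q ∈ Literature.MathematicalPhysics.StatisticalMechanics.hcpStacking a h, ‖q‖ ≤ 4 → ∃ z ∈ Literature.MathematicalPhysics.StatisticalMechanics.barlowStackingH a' H s, dist z (Literature.MathematicalPhysics.StatisticalMechanics.barlowPosH a' H s m i j) ≤ 4 + θ ∧ dist z (Literature.MathematicalPhysics.StatisticalMechanics.barlowPosH a' H s m i j + A₂ q) ≤ θ) ∧ (∀ z ∈ Literature.MathematicalPhysics.StatisticalMechanics.barlowStackingH a' H s, dist z (Literature.MathematicalPhysics.StatisticalMechanics.barlowPosH a' H s m i j) ≤ 4 → ∃ q ∈ Literature.MathematicalPhysics.StatisticalMechanics.hcpStacking a h, dist z (Literature.MathematicalPhysics.StatisticalMechanics.barlowPosH a' H s m i j + A₂ q) ≤ θ) :=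
  Summit.AtomisticToContinuum.Crystallization.Theorems.HcpLandscapeGapBirth.stub_goodOfNoBadBondHeights

/-! ### Skeleton v11 (lead c6): RC is CUT into three worker stubs + lead glue

Wave 1 LANDED (RS p163097, RF p163443, RG p163150).  The relaxed column inequality RC needs no new numerics: the
tree's crux `PeriodicGivenLayered` (stmt-11779, LayeredHull namespace, PROVED) already certified (i) the uniform
MIDPOINT CONVEXITY of the alternating block energy in the increments (`LayeredHull.stub_convexity`, κ = 1/2:
nearest-layer curvature ≥ 6.11 against Σ_k k²·concavity ≤ 3.78) and (ii) the sign/monotonicity/corner gap of the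
registry coupling in the continuous height (`LayeredHull.stub_registry`), with (iii) the potential-free alternating
MAJORISATION (`LayeredHull.haggLocalEnergy_alternating_add_deficit_le`: for couplings `J_k ≤ 0` non-decreasing in
`k ≥ 2`, ABAB majorises every Hägg word per site, with deficit `J₃ − J₂` at a fault — Bétermin–Petrache pairing) and
(iv) the layer-cake decay `|layerInteraction LJ a H δ 1| ≤ 192/H⁴` (`LayeredHull.cake_abs_layerInteraction_le`).
So RC ⟸ RC-W2 (registry majorisation at mixed heights, per site) ∧ RC-W3 (free-block bounds: column of full
alternating-pattern layer series ≥ 2·(free block energy) − C; free uniform block ≥ (n+1)(2hcpE − Φ₀)) ∧ RC-W1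
(Jensen over cyclic shifts of the increments with the shift defect O(1): block energy at the mean spacing + κ·Σ(Δᵢ − mean)²
≤ block energy + C) ∧ `modulus_at_boxMinimiser` + `hcpEnergySeries_of_eq` (lead glue `relaxedColumn_of`, below RC).
-/

/-- **Stub RC-W1 — Jensen over cyclic shifts** — LANDED p165320 (wave 2), re-exported.  For `a ∈ [47/50,1]`, `n ≥ 1` and increments
`Δ 0, …, Δ (n−1)` in the band, the alternating free-block energy
`F_n(Δ) = Σ_{i<j≤n} layerInteraction LJ a (Δ i + ⋯ + Δ (j−1)) (0 if j−i even else 1) 1` (verbatim the functional of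
`LayeredHull.stub_convexity`) satisfies `F_n(mean·1) + κ Σ_i (Δ i − mean)² ≤ F_n(Δ) + C` with `mean = (Σ Δ i)/n`.
Proof: `G = F_n − 2κ_m‖·‖²` is midpoint convex on the box (κ_m = 1/2 from `stub_convexity`, since
‖Δ‖²+‖Δ'‖²−2‖(Δ+Δ')/2‖² = ½‖Δ−Δ'‖²); midpoint convexity ⇒ Jensen for equal-weight averages of finitely many box points
(dyadic Cauchy induction, padding with the mean — purely algebraic, no continuity); apply to the `n` cyclic shifts
`T^r Δ` (all in the box, all with the same ‖·‖ and the same deviation from `mean·1`, average = `mean·1`):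
`F_n(mean·1) ≤ (1/n) Σ_r F_n(T^r Δ) − 2κ_m Σ_i (Δ i − mean)²`; finally the SHIFT DEFECT `|F_n(T^r Δ) − F_n(Δ)| ≤ C`
uniformly in `r, n` (for each span `k` the two families of windows differ in ≤ 2(k−1) windows, each a `layerInteraction`
at a height in `[39k a/50, 17k a/20]`, bounded by `192/(39k·47/2500)⁴` via `LayeredHull.cake_abs_layerInteraction_le`;
`Σ_k (k−1) k⁻⁴ < ∞`). [size M/L] -/
theorem stub_jensenShift : ∃ κ : ℝ, 0 < κ ∧ ∃ C : ℝ, ∀ (a : ℝ), 47 / 50 ≤ a → a ≤ 1 → ∀ (n : ℕ), 1 ≤ n → ∀ Δ : ℕ → ℝ, (∀ i : ℕ, i < n → 39 / 50 * a ≤ Δ i ∧ Δ i ≤ 17 / 20 * a) → (∑ i ∈ Finset.range n, ∑ j ∈ Finset.Ioc i n, Literature.MathematicalPhysics.StatisticalMechanics.layerInteraction Literature.MathematicalPhysics.StatisticalMechanics.lennardJones a (∑ l ∈ Finset.Ico i j, ((∑ i' ∈ Finset.range n, Δ i') / n)) (if Even (j - i) then 0 else 1) 1) + κ * (∑ i ∈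 Finset.range n, (Δ i - (∑ i' ∈ Finset.range n, Δ i') / n) ^ 2) ≤ (∑ i ∈ Finset.range n, ∑ j ∈ Finset.Ioc i n, Literature.MathematicalPhysics.StatisticalMechanics.layerInteraction Literature.MathematicalPhysics.StatisticalMechanics.lennardJones a (∑ l ∈ Finset.Ico i j, Δ l) (if Even (j - i) then 0 else 1) 1) + C :=
  Summit.AtomisticToContinuum.Crystallization.Theorems.HcpLandscapeGapBirth.stub_jensenShift

/-- **Stub RC-W2 — registry majorisation at mixed heights, per site** — LANDED p164934 (wave 2), re-exported.  For `a ∈ [47/50,1]`, Hägg `s`,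
heights `z` with spacings in the band and a layer `m`: the full layer series of the ACTUAL registry pattern
(`haggLabel s k − haggLabel s m`) dominates that of the ALTERNATING pattern (`0` if `k − m` even else `1`) at the SAME
heights, plus `c₀` per adjacent cubic bond (`s (m+1) = s m` above, `s (m−1) = s (m−2)` below).  Proof: `|k − m| = 1`
terms agree (`layerInteraction_eq_ite`: only `δ mod 3 = 0` matters; consecutive labels differ by ±1); for the layers
above, with `J k := barlowCoupling LJ a (z (m+k) − z m) 1 = Φ_A − Φ_N` at the actual height, `LayeredHull.stub_registry`
gives `J k ≤ 0` and `J k ≤ J (k+1)` for `k ≥ 2` (heights `≥ 39a/25`, increasing) and `J 3 − J 2 ≥ D_a(117a/50) − D_a(17a/10) ≥ c₀`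
(`z(m+2) − z m ≤ 17a/10`, `z(m+3) − z m ≥ 117a/50`, monotonicity); then `LayeredHull.haggLocalEnergy_alternating_add_deficit_le`
(J summable by `cake_abs_layerInteraction_le`); `¬HaggAligned s m 2 ↔ s (m+1) = s m`; layers below by the reflected word
`i ↦ s (2m − 1 − i)`.  Summability of the alternating series: `LayeredHull.cake_summable_layers`-pattern; the actual
series is RS (`HcpLandscapeGapBirth.stub_siteEnergyHeights`, landed). [size M/L] -/
theorem stub_registryMajorisationHeights : ∃ c₀ : ℝ, 0 < c₀ ∧ ∀ (a : ℝ), 47 / 50 ≤ a → a ≤ 1 → ∀ s : ℤ → ℤ, Literature.MathematicalPhysics.StatisticalMechanics.IsHaggSeq s → ∀ z : ℤ → ℝ, (∀ k : ℤ, 39 / 50 * a ≤ z (k + 1) - z k ∧ z (k + 1) - z k ≤ 17 / 20 * a) → ∀ m : ℤ, Summable (fun k : ℤ => if k = m then (0 : ℝ) else Literature.MathematicalPhysics.StatisticalMechanics.layerInteraction Literature.MathematicalPhysics.StatisticalMechanics.lennardJones a (z k - z m) (if Even (k - m) then 0 else 1) 1) ∧ (∑' k : ℤ, (if k = m then (0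 : ℝ) else Literature.MathematicalPhysics.StatisticalMechanics.layerInteraction Literature.MathematicalPhysics.StatisticalMechanics.lennardJones a (z k - z m) (if Even (k - m) then 0 else 1) 1)) + c₀ * ((if s (m + 1) = s m then (1 : ℝ) else 0) + (if s (m - 1) = s (m - 2) then (1 : ℝ) else 0)) ≤ ∑' k : ℤ, (if k = m then (0 : ℝ) else Literature.MathematicalPhysics.StatisticalMechanics.layerInteraction Literature.MathematicalPhysics.StatisticalMechanics.lennardJones a (z k - z m) (Literature.MathematicalPhysics.StatisticalMechanics.haggLabel s k - Literature.MathematicalPhysics.StatisticalMechanics.haggLabel s m) 1) :=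
  Summit.AtomisticToContinuum.Crystallization.Theorems.HcpLandscapeGapBirth.stub_registryMajorisationHeights

/-- **Stub RC-W3 — free-block bounds** — LANDED p165713 (wave 2), re-exported.  (a) For `a ∈ [47/50,1]`, heights `z` in the band, a column of layers
`M₁, …, M₁ + n`: the column sum of the full ALTERNATING-pattern layer series is `≥ 2·F_n(Δ) − C` with
`Δ l = z (M₁+l+1) − z (M₁+l)` (pairs inside the column are counted twice and `Σ_{l∈[i,j)} Δ l = z(M₁+j) − z(M₁+i)`,
`layerInteraction` is even in the height; pairs with a layer outside the column are bounded by `192/H⁴`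
(`LayeredHull.cake_abs_layerInteraction_le`) and `Σ_{m∈col} Σ_{k∉col} (z k − z m)⁻⁴ ≤ C` by the gaps `≥ 7/10`).
(b) For `h` in the band the free uniform alternating block dominates the bulk: `(n+1)(2·hcpE a h − Φ₀(a)) ≤ 2 F_n(h·1)`
(`2·hcpE a h = Φ₀ + Σ_{k≠0} layerInteraction LJ a (k h) (par k) 1` by regrouping the ℤ³ series of `hcpE` /
`barlowSiteEnergy_alternating_eq_hcpE` + `barlowSiteEnergy` layer form + `ljs`-reindexing `layerInteraction V a h δ k =
layerInteraction V a (k h) δ 1`; `F_n(h·1) = Σ_{k=1}^{n} (n+1−k) Φ_k`; every `Φ_k ≤ 0` since all pair distances are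
`≥ 0.91 > 2^{-1/6}`; so `2F_n − (n+1)·2Σ_{k≥1}Φ_k = −2Σ_{k≤n} kΦ_k − 2(n+1)Σ_{k>n} Φ_k ≥ 0`). [size M/L] -/
theorem stub_freeBlockBounds : (∃ C : ℝ, ∀ (a : ℝ), 47 / 50 ≤ a → a ≤ 1 → ∀ z : ℤ → ℝ, (∀ k : ℤ, 39 / 50 * a ≤ z (k + 1) - z k ∧ z (k + 1) - z k ≤ 17 / 20 * a) → ∀ (M₁ : ℤ) (n : ℕ), 2 * (∑ i ∈ Finset.range n, ∑ j ∈ Finset.Ioc i n, Literature.MathematicalPhysics.StatisticalMechanics.layerInteraction Literature.MathematicalPhysics.StatisticalMechanics.lennardJones a (∑ l ∈ Finset.Ico i j, (z (M₁ + l + 1) - z (M₁ + l))) (if Even (j - i) then 0 else 1) 1) ≤ (∑ m ∈ Finset.Icc M₁ (M₁ + n), ∑' k : ℤ, (if k = m then (0 : ℝ) else Literature.MathematicalPhysics.StatisticalMechanics.layerInteraction Literature.MathematicalPhysics.StatisticalMechanics.lennardJones a (z k - z m) (if Even (k - m) then 0 else 1) 1)) + C) ∧ (∀ (a : ℝ),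 47 / 50 ≤ a → a ≤ 1 → ∀ h : ℝ, 39 / 50 * a ≤ h → h ≤ 17 / 20 * a → ∀ n : ℕ, ((n : ℝ) + 1) * (2 * Summit.AtomisticToContinuum.Crystallization.Theorems.PalmUnimodularRigidity.LayeredLawsSelectHcp.hcpE a h - Literature.MathematicalPhysics.StatisticalMechanics.inLayerInteraction Literature.MathematicalPhysics.StatisticalMechanics.lennardJones a) ≤ 2 * (∑ i ∈ Finset.range n, ∑ j ∈ Finset.Ioc i n, Literature.MathematicalPhysics.StatisticalMechanics.layerInteraction Literature.MathematicalPhysics.StatisticalMechanics.lennardJones a (∑ l ∈ Finset.Ico i j, h) (if Even (j - i) then 0 else 1) 1)) :=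
  Summit.AtomisticToContinuum.Crystallization.Theorems.HcpLandscapeGapBirth.stub_freeBlockBounds

/-- **Stub RC — the RELAXED COLUMN INEQUALITY** — LANDED p166305 (lead glue over W1/W2/W3 + modulus), re-exported.  At B's box minimiser `(a, h)`: there are `g > 0`, `C` such
that for every `a' ∈ [47/50, 1]`, Hägg word `s`, height profile `H` with spacings in `[39a'/50, 17a'/20]` and layers
`M₁ ≤ M₂`, the column sum of the full site energies (in the layer form of RS) is at least
`(M₂ − M₁ + 1)·2e_LJ(hcp a h) + g·Σ_{m=M₁}^{M₂} ([s (m+1) = s m] + (a' − a)² + (H (m+1) − H m − h)²) − C`.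
[size XL (certified lattice-sum numerics); plan in the v10 module docstring: mixed-height half-domination from
`LayeredHull.stub_registry` + `PricedHcpWindowsLjDomination` internals; termwise Taylor lower bounds for the layer sums
`Σ_w V(√(a²q_w + t²))` with certified curvature `≥ 6.51` (offset sum, nearest band, `a = 1` geometry, scaling `a⁻⁸`)
against `Σ_k k² c_k ≤ 2.10`; zero-stress reference spacing by the intermediate value theorem; `modulus_at_boxMinimiser`;
`barlowSiteEnergy_alternating_eq_hcpE` + `hcpEnergySeries_of_eq` to identify the uniform hcp column with `2e_LJ(hcp a' h₀)`] -/
theorem stub_relaxedColumn : ∀ (a h : ℝ) (ha : a ≠ 0) (hh : h ≠ 0), (9 / 10 < a ∧ a < 1 ∧ |h - a * Real.sqrt (2 / 3)| ≤ a / 100) → (∀ a' h' : ℝ, ∀ ha' : a' ≠ 0, ∀ hh' : h' ≠ 0, (9 / 10 < a' ∧ a' < 1 ∧ |h' - a' * Real.sqrt (2 / 3)| ≤ a' / 100) → (Literature.MathematicalPhysics.StatisticalMechanics.hcpPeriodicConfiguration ha hh).energyPerParticle Literature.MathematicalPhysics.StatisticalMechanics.lennardJones ≤ (Literature.MathematicalPhysics.StatisticalMechanics.hcpPeriodicConfiguration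 ha' hh').energyPerParticle Literature.MathematicalPhysics.StatisticalMechanics.lennardJones) → ∃ g : ℝ, 0 < g ∧ ∃ C : ℝ, ∀ a' : ℝ, 47 / 50 ≤ a' → a' ≤ 1 → ∀ s : ℤ → ℤ, Literature.MathematicalPhysics.StatisticalMechanics.IsHaggSeq s → ∀ H : ℤ → ℝ, (∀ k : ℤ, 39 / 50 * a' ≤ H (k + 1) - H k ∧ H (k + 1) - H k ≤ 17 / 20 * a') → ∀ M₁ M₂ : ℤ, M₁ ≤ M₂ → ((M₂ - M₁ + 1 : ℤ) : ℝ) * (2 * (Literature.MathematicalPhysics.StatisticalMechanics.hcpPeriodicConfiguration ha hh).energyPerParticle Literature.MathematicalPhysics.StatisticalMechanics.lennardJones) + g * (∑ m ∈ Finset.Icc M₁ M₂, ((if s (m + 1) = s m then (1 : ℝ) else 0) + (a' - a) ^ 2 + (H (m + 1) - H m - h) ^ 2)) ≤ (∑ m ∈ Finset.Icc M₁ M₂, (Literature.MathematicalPhysics.StatisticalMechanics.inLayerInteraction Literature.MathematicalPhysics.StatisticalMechanics.lennardJones a' + ∑' k : ℤ, (if k = m then (0 : ℝ) else Literature.MathematicalPhysics.StatisticalMechanics.layerInteraction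 Literature.MathematicalPhysics.StatisticalMechanics.lennardJones a' (H k - H m) (Literature.MathematicalPhysics.StatisticalMechanics.haggLabel s k - Literature.MathematicalPhysics.StatisticalMechanics.haggLabel s m) 1))) + C :=
  Summit.AtomisticToContinuum.Crystallization.Theorems.HcpLandscapeGapBirth.stub_relaxedColumn

/-! ### Skeleton v12 (lead c6): the assembly cut of T_relaxed (wave 3) and T_relaxed itself — all LANDED

* RE `stub_windowEnergyHeights` (lead, p164228): window energy ≥ ½ Σ full site energies (multilattices on the box);
* X1 `stub_fibreCharge` (worker, p166631): per fibre, bad layers (off-scale / near a cubic bond / near an off spacing)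
  are charged to the prices of RC;
* X2 `stub_goodOfDeepSite` (worker, p166565): deep window sites with no nearby defect are Good(4,θ) (over RG);
* X5 `stub_windowColumnSum` (worker, p167043): the window sum of full site energies regrouped over the fibre intervals of RF
  and priced by RC;
* T_relaxed `stub_relaxedBarlowPricing` (lead assembly + rigid-motion transport, …RelaxedBarlowPricing.lean, p167995);
* B_relaxed `stub_hcpLandscapeGap_relaxedBarlow` (worker, p168164): B's own conclusion on the exact relaxed-Barlow class. -/

/-- **RE — window energy dominates half the sum of full site energies (multilattices)** — LANDED p164228, re-exported. -/
theorem stub_windowEnergyHeights : ∀ (a : ℝ), 47 / 50 ≤ a → a ≤ 1 → ∀ s : ℤ → ℤ, Literature.MathematicalPhysics.StatisticalMechanics.IsHaggSeq s → ∀ H : ℤ → ℝ, (∀ k : ℤ, 39 / 50 * a ≤ H (k + 1) - H k ∧ H (k + 1) - H k ≤ 17 / 20 * a) → ∀ (n : ℕ) (x : Fin n → EuclideanSpace ℝ (Fin 3)), Function.Injective x → (∀ t : Fin n, x t ∈ Literature.MathematicalPhysics.StatisticalMechanics.barlowStackingH a H s) → ∑ t : Fin n, (∑' z : ↥{z : EuclideanSpace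 ℝ (Fin 3) | z ∈ Literature.MathematicalPhysics.StatisticalMechanics.barlowStackingH a H s ∧ z ≠ x t}, Literature.MathematicalPhysics.StatisticalMechanics.lennardJones (dist (x t) (z : EuclideanSpace ℝ (Fin 3)))) ≤ 2 * Literature.MathematicalPhysics.StatisticalMechanics.interactionEnergy Literature.MathematicalPhysics.StatisticalMechanics.lennardJones x :=
  Summit.AtomisticToContinuum.Crystallization.Theorems.HcpLandscapeGapBirth.stub_windowEnergyHeights

/-- **X1 — fibre charging** — LANDED p166631, re-exported. -/
theorem stub_fibreCharge : ∀ (K : ℕ) (δ₁ : ℝ), 0 < δ₁ → ∀ (s : ℤ → ℤ) (H : ℤ → ℝ) (a a' h : ℝ) (M₁ M₂ : ℤ), (Set.ncard {k : ℤ | M₁ ≤ k ∧ k ≤ M₂ ∧ (δ₁ < |a' - a| ∨ (∃ k' : ℤ, |k' - k| ≤ K ∧ s (k' + 1) = s k') ∨ (∃ k' : ℤ, |k' - k| ≤ K ∧ δ₁ < |H (k' + 1) - H k' - h|))} : ℝ) ≤ (2 * K + 1) * (1 + δ₁⁻¹ ^ 2) * (∑ k ∈ Finset.Icc M₁ M₂,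 ((if s (k + 1) = s k then (1 : ℝ) else 0) + (a' - a) ^ 2 + (H (k + 1) - H k - h) ^ 2)) + 4 * K * (2 * K + 1) :=
  Summit.AtomisticToContinuum.Crystallization.Theorems.HcpLandscapeGapBirth.stub_fibreCharge

/-- **X2 — deep sites with no nearby defect are Good** — LANDED p166565, re-exported. -/
theorem stub_goodOfDeepSite : ∀ (a h : ℝ), 0 < a → 0 < h → h ≤ 1 → ∀ θ : ℝ, 0 < θ → ∃ δ₁ : ℝ, 0 < δ₁ ∧ ∃ K : ℕ, ∀ a' : ℝ, |a' - a| ≤ δ₁ → 47 / 50 ≤ a' → a' ≤ 1 → ∀ s : ℤ → ℤ, Literature.MathematicalPhysics.StatisticalMechanics.IsHaggSeq s → ∀ H : ℤ → ℝ, (∀ k : ℤ, 39 / 50 * a' ≤ H (k + 1) - H k ∧ H (k + 1) - H k ≤ 17 / 20 * a') → ∀ (c : EuclideanSpace ℝ (Fin 3)) (L : ℝ) (n : ℕ) (y : Fin n → EuclideanSpace ℝ (Fin 3)), Set.range y = {p : EuclideanSpace ℝ (Fin 3) | p ∈ Literature.MathematicalPhysics.StatisticalMechanics.barlowStackingH a'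 H s ∧ dist p c ≤ L} → ∀ (i : Fin n) (k i' j' : ℤ), y i = Literature.MathematicalPhysics.StatisticalMechanics.barlowPosH a' H s k i' j' → dist (y i) c ≤ L - 5 → (∀ k' : ℤ, |k' - k| ≤ K → s (k' + 1) ≠ s k') → (∀ k' : ℤ, |k' - k| ≤ K → |H (k' + 1) - H k' - h| ≤ δ₁) → ∃ A : EuclideanSpace ℝ (Fin 3) →ₗᵢ[ℝ] EuclideanSpace ℝ (Fin 3), (∀ q ∈ Literature.MathematicalPhysics.StatisticalMechanics.hcpStacking a h, ‖q‖ ≤ 4 → ∃ j : Fin n, dist (y j) (y i + A q) ≤ θ) ∧ (∀ j : Fin n, dist (y j) (y i) ≤ 4 → ∃ q ∈ Literature.MathematicalPhysics.StatisticalMechanics.hcpStacking a h, dist (y j) (y i + A q) ≤ θ) :=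
  Summit.AtomisticToContinuum.Crystallization.Theorems.HcpLandscapeGapBirth.stub_goodOfDeepSite

/-- **X5 — window column sum** — LANDED p167043, re-exported. -/
theorem stub_windowColumnSum : ∀ (a h : ℝ) (ha : a ≠ 0) (hh : h ≠ 0), (9 / 10 < a ∧ a < 1 ∧ |h - a * Real.sqrt (2 / 3)| ≤ a / 100) → (∀ a' h' : ℝ, ∀ ha' : a' ≠ 0, ∀ hh' : h' ≠ 0, (9 / 10 < a' ∧ a' < 1 ∧ |h' - a' * Real.sqrt (2 / 3)| ≤ a' / 100) → (Literature.MathematicalPhysics.StatisticalMechanics.hcpPeriodicConfiguration ha hh).energyPerParticle Literature.MathematicalPhysics.StatisticalMechanics.lennardJones ≤ (Literature.MathematicalPhysics.StatisticalMechanics.hcpPeriodicConfiguration ha' hh').energyPerParticle Literature.MathematicalPhysics.StatisticalMechanics.lennardJones) → ∃ g : ℝ, 0 < g ∧ ∃ C : ℝ, ∀ a' : ℝ, 47 / 50 ≤ a' → a' ≤ 1 → ∀ s : ℤ → ℤ, Literature.MathematicalPhysics.StatisticalMechanics.IsHaggSeq s → ∀ H : ℤ → ℝ, (∀ k : ℤ,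 39 / 50 * a' ≤ H (k + 1) - H k ∧ H (k + 1) - H k ≤ 17 / 20 * a') → ∀ (c : EuclideanSpace ℝ (Fin 3)) (L : ℝ) (n : ℕ) (y : Fin n → EuclideanSpace ℝ (Fin 3)), Function.Injective y → Set.range y = {p : EuclideanSpace ℝ (Fin 3) | p ∈ Literature.MathematicalPhysics.StatisticalMechanics.barlowStackingH a' H s ∧ dist p c ≤ L} → ∀ (F : Finset (ℤ × ℤ)) (M₁ M₂ : ℤ × ℤ → ℤ) (ι : ℤ × ℤ → ℤ → ℤ × ℤ), (∀ k : ℤ, Function.Injective (fun f : ℤ × ℤ => ι f k)) → (∀ f ∈ F, ∀ k : ℤ, M₁ f ≤ k → k ≤ M₂ f → dist (Literature.MathematicalPhysics.StatisticalMechanics.barlowPosH a' H s k (ι f k).1 (ι f k).2) c ≤ L) → (∀ k i j : ℤ, dist (Literature.MathematicalPhysics.StatisticalMechanics.barlowPosH a' H s k i j) c ≤ L → (∃ f ∈ F, M₁ f ≤ k ∧ k ≤ M₂ f ∧ ι f k = (i, j)) ∨ L - 5 < dist (Literature.MathematicalPhysics.StatisticalMechanics.barlowPosH a' H s k i j) c)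 → (n : ℝ) * (2 * (Literature.MathematicalPhysics.StatisticalMechanics.hcpPeriodicConfiguration ha hh).energyPerParticle Literature.MathematicalPhysics.StatisticalMechanics.lennardJones) + g * (∑ f ∈ F, ∑ k ∈ Finset.Icc (M₁ f) (M₂ f), ((if s (k + 1) = s k then (1 : ℝ) else 0) + (a' - a) ^ 2 + (H (k + 1) - H k - h) ^ 2)) ≤ (∑ i : Fin n, (∑' z : ↥{z : EuclideanSpace ℝ (Fin 3) | z ∈ Literature.MathematicalPhysics.StatisticalMechanics.barlowStackingH a' H s ∧ z ≠ y i}, Literature.MathematicalPhysics.StatisticalMechanics.lennardJones (dist (y i) (z : EuclideanSpace ℝ (Fin 3))))) + C * ((F.card : ℝ) + (Set.ncard {p : EuclideanSpace ℝ (Fin 3) | p ∈ Literature.MathematicalPhysics.StatisticalMechanics.barlowStackingH a' H s ∧ dist p c ≤ L ∧ L - 5 < dist p c} : ℝ) + 1) :=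
  Summit.AtomisticToContinuum.Crystallization.Theorems.HcpLandscapeGapBirth.stub_windowColumnSum

/-- **T_relaxed — B's priced inequality on the exact RELAXED-Barlow class** (every rigid image of every Barlow
multilattice `barlowStackingH a' H s`: all Hägg words, all spacing profiles in the band, all box in-layer scales), at
B's box minimiser — LANDED (`…HcpLandscapeGapRelaxedBarlowPricing.lean`), re-exported. -/
theorem stub_relaxedBarlowPricing : ∀ (a h : ℝ) (ha : a ≠ 0) (hh : h ≠ 0), (9 / 10 < a ∧ a < 1 ∧ |h - a * Real.sqrt (2 / 3)| ≤ a / 100) → (∀ a' h' : ℝ, ∀ ha' : a' ≠ 0, ∀ hh' : h' ≠ 0, (9 / 10 < a' ∧ a' < 1 ∧ |h' - a' * Real.sqrt (2 / 3)| ≤ a' / 100) → (Literature.MathematicalPhysics.StatisticalMechanics.hcpPeriodicConfiguration ha hh).energyPerParticle Literature.MathematicalPhysics.StatisticalMechanics.lennardJones ≤ (Literature.MathematicalPhysics.StatisticalMechanics.hcpPeriodicConfiguration ha' hh').energyPerParticle Literature.MathematicalPhysics.StatisticalMechanics.lennardJones) → ∀ θ : ℝ, 0 < θ → ∃ κ :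 ℝ, 0 < κ ∧ ∃ C : ℝ, ∀ (a' : ℝ), 47 / 50 ≤ a' → a' ≤ 1 → ∀ s : ℤ → ℤ, Literature.MathematicalPhysics.StatisticalMechanics.IsHaggSeq s → ∀ H : ℤ → ℝ, (∀ k : ℤ, 39 / 50 * a' ≤ H (k + 1) - H k ∧ H (k + 1) - H k ≤ 17 / 20 * a') → ∀ (B : EuclideanSpace ℝ (Fin 3) →ₗᵢ[ℝ] EuclideanSpace ℝ (Fin 3)) (v c : EuclideanSpace ℝ (Fin 3)) (L : ℝ), 0 ≤ L → ∀ (n : ℕ) (x : Fin n → EuclideanSpace ℝ (Fin 3)), Function.Injective x → Set.range x = {y : EuclideanSpace ℝ (Fin 3) | y ∈ (fun w => v + B w) '' Literature.MathematicalPhysics.StatisticalMechanics.barlowStackingH a' H s ∧ dist y c ≤ L} → (n : ℝ) * (Literature.MathematicalPhysics.StatisticalMechanics.hcpPeriodicConfiguration ha hh).energyPerParticle Literature.MathematicalPhysics.StatisticalMechanics.lennardJones + κ * (Nat.card {i : Fin n // ¬ (∃ A : EuclideanSpace ℝ (Fin 3) →ₗᵢ[ℝ] EuclideanSpace ℝ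 (Fin 3), (∀ p ∈ (Literature.MathematicalPhysics.StatisticalMechanics.hcpPeriodicConfiguration ha hh).points, ‖p‖ ≤ 4 → ∃ j : Fin n, dist (x j) (x i + A p) ≤ θ) ∧ (∀ j : Fin n, dist (x j) (x i) ≤ 4 → ∃ p ∈ (Literature.MathematicalPhysics.StatisticalMechanics.hcpPeriodicConfiguration ha hh).points, dist (x j) (x i + A p) ≤ θ))} : ℝ) ≤ Literature.MathematicalPhysics.StatisticalMechanics.interactionEnergy Literature.MathematicalPhysics.StatisticalMechanics.lennardJones x + C * (L + 1) ^ 2 :=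
  Summit.AtomisticToContinuum.Crystallization.Theorems.HcpLandscapeGapBirth.stub_relaxedBarlowPricing

/-- **B_relaxed — the crux B ON THE EXACT RELAXED-BARLOW CLASS**: B's conclusion verbatim (witness = the landed box
minimiser; `2e·#window + κ(η)·#{η-bad shells} − C(L+1)² ≤ Σ site energies`) for every rigid image of every Barlow
MULTILATTICE `barlowStackingH a' H s` (every Hägg word, every spacing profile in the band, every box in-layer scale) —
LANDED p168164 (wave 4, `Theorems/…HcpLandscapeGapRelaxedBarlowClass.lean`, c5's ExactBarlowClass pattern over T_relaxed), re-exported. -/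
theorem stub_hcpLandscapeGap_relaxedBarlow : ∃ a h : ℝ, ∃ ha : a ≠ 0, ∃ hh : h ≠ 0, (9 / 10 < a ∧ a < 1 ∧ |h - a * Real.sqrt (2 / 3)| ≤ a / 100) ∧ (∀ η : ℝ, 0 < η → ∃ κ : ℝ, 0 < κ ∧ ∃ C : ℝ, ∀ (a' : ℝ), 47 / 50 ≤ a' → a' ≤ 1 → ∀ s : ℤ → ℤ, Literature.MathematicalPhysics.StatisticalMechanics.IsHaggSeq s → ∀ H : ℤ → ℝ, (∀ k : ℤ, 39 / 50 * a' ≤ H (k + 1) - H k ∧ H (k + 1) - H k ≤ 17 / 20 * a') → ∀ (B : EuclideanSpace ℝ (Fin 3) →ₗᵢ[ℝ] EuclideanSpace ℝ (Fin 3)) (v c : EuclideanSpace ℝ (Fin 3)) (L : ℝ), 0 ≤ L → 2 * ((Literature.MathematicalPhysics.StatisticalMechanics.hcpPeriodicConfiguration ha hh).energyPerParticle Literature.MathematicalPhysics.StatisticalMechanics.lennardJones) * (({y : EuclideanSpace ℝ (Fin 3) | y ∈ ((fun w => v + B w) '' Literature.MathematicalPhysics.StatisticalMechanics.barlowStackingH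 a' H s) ∧ dist y c ≤ L} : Set (EuclideanSpace ℝ (Fin 3))).ncard : ℝ) + κ * (({y : EuclideanSpace ℝ (Fin 3) | y ∈ ((fun w => v + B w) '' Literature.MathematicalPhysics.StatisticalMechanics.barlowStackingH a' H s) ∧ dist y c ≤ L ∧ ¬ (∃ A : EuclideanSpace ℝ (Fin 3) →ₗᵢ[ℝ] EuclideanSpace ℝ (Fin 3), ∃ e : ↥{z : EuclideanSpace ℝ (Fin 3) | z ∈ ((fun w => v + B w) '' Literature.MathematicalPhysics.StatisticalMechanics.barlowStackingH a' H s) ∧ z ≠ y ∧ dist z y < 13 / 10 * a} ≃ ↥{p : EuclideanSpace ℝ (Fin 3) | p ∈ Literature.MathematicalPhysics.StatisticalMechanics.hcpStacking a h ∧ p ≠ 0 ∧ ‖p‖ < 13 / 10 * a}, ∀ t : ↥{z : EuclideanSpace ℝ (Fin 3) | z ∈ ((fun w => v + B w) '' Literature.MathematicalPhysics.StatisticalMechanics.barlowStackingH a' H s) ∧ z ≠ y ∧ dist z y < 13 / 10 * a}, dist ((t : EuclideanSpace ℝ (Fin 3)) - y) (A ((e t : ↥{p : EuclideanSpace ℝ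 (Fin 3) | p ∈ Literature.MathematicalPhysics.StatisticalMechanics.hcpStacking a h ∧ p ≠ 0 ∧ ‖p‖ < 13 / 10 * a}) : EuclideanSpace ℝ (Fin 3))) ≤ η)} : Set (EuclideanSpace ℝ (Fin 3))).ncard : ℝ) - C * (L + 1) ^ 2 ≤ (∑' y : ↥{y : EuclideanSpace ℝ (Fin 3) | y ∈ ((fun w => v + B w) '' Literature.MathematicalPhysics.StatisticalMechanics.barlowStackingH a' H s) ∧ dist y c ≤ L}, (∑' z : ↥{z : EuclideanSpace ℝ (Fin 3) | z ∈ ((fun w => v + B w) '' Literature.MathematicalPhysics.StatisticalMechanics.barlowStackingH a' H s) ∧ z ≠ (y : EuclideanSpace ℝ (Fin 3))}, Literature.MathematicalPhysics.StatisticalMechanics.lennardJones (dist (y : EuclideanSpace ℝ (Fin 3)) (z : EuclideanSpace ℝ (Fin 3)))))) :=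
  Summit.AtomisticToContinuum.Crystallization.Theorems.HcpLandscapeGapBirth.stub_hcpLandscapeGap_relaxedBarlow

/-! ### Skeleton v13 (lead c6, end of cycle 1): preparation of the NEXT cut — T_slip (wave 5, all LANDED)

T_relaxed keeps the A/B/C lateral registry exact.  The next cut of the lift removes it: T ⟸ T_slip ∧ lift″, where
T_slip = B's priced inequality for windows of rigid images of LATERALLY SLIPPED layered sets
`{i u + j v + τ k + (H k) e₃}` (layer k = the triangular lattice of spacing a' translated in-plane by an ARBITRARY
τ k, heights as in T_relaxed), pricing in addition the lateral deviation of every nearest-pair offset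
`ξ k = τ (k+1) − τ k` from the hollow set `±w + Λ`.  Mechanism (lead c6, numerics num/slip_check.py of the c6 folder,
recorded in `Cruxes/HcpLandscapeGap/LINE-REPORT.md`): LATERAL REDUCTION at fixed heights to the registered
multilattice of the induced Hägg word (nearest hollow coset of each ξ k) — (S1) the general-offset nearest-layer sum
`Ψ(a,t,ξ) = Σ_{w∈Λ(a)} V_LJ(√(‖w+ξ‖²+t²))` exceeds its hollow value `Φ_N(a,t)` by `≥ μ·dist(ξ, ±w+Λ)²` for
`t ∈ [39a/50, 17a/20]` (global modulus, bridge-limited: μ(1, 0.85) ≈ 0.208, ≈ 0.66 at t = 0.78; scaling `a⁻⁸`);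
(S2) for `t ≥ 39a/25` the lateral Hessian of `Ψ(a,t,·)` is tiny (registry sensitivity: sup-norm ≈ 2.0·10⁻³ at
t = 1.56, ≈ 3·10⁻⁶ at t = 2.34 — Poisson/theta side of the Bernstein representation of `…Registry1–3`), and the
registered offsets `0, ±w` are critical points of `Ψ(a,t,·)` by symmetry, so replacing the cumulative deviations
costs `≤ ½ λ_k k Σ ε_j²` per span-k pair; dominance `2μ ≈ 0.42 ≫ Σ_k k² λ_k ≈ 8·10⁻³` (margin ×50) gives the
SLIP COLUMN INEQUALITY SC = RC(induced word, same heights) + `g_lat Σ_k dist(ξ k, hollows)²`.  Potential-free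
pieces landed in wave 5 (below); to be registered next: S1, S2 (certified numerics, XL — candidates for
promote-stub), SL (lateral reduction bookkeeping ⟸ S1 ∧ S2), SC, slip analogues of RG/X1/X2/X5, assembly. -/

/-- **SS — site energy of a laterally slipped layered set, layer by layer** — LANDED p168836 (wave 5), re-exported. -/
theorem stub_slipSiteEnergy : ∀ (a : ℝ), 47 / 50 ≤ a → a ≤ 1 → ∀ H : ℤ → ℝ, (∀ k : ℤ, 39 / 50 * a ≤ H (k + 1) - H k ∧ H (k + 1) - H k ≤ 17 / 20 * a) → ∀ τ : ℤ → EuclideanSpace ℝ (Fin 3), (∀ k : ℤ, τ k 2 = 0) → ∀ m i j : ℤ, Summable (fun z : ↥{z : EuclideanSpace ℝ (Fin 3) | z ∈ {p : EuclideanSpace ℝ (Fin 3) | ∃ k i' j' : ℤ, p = (i' : ℝ) • Literature.MathematicalPhysics.StatisticalMechanics.triangularVec₁ a + (j' : ℝ) • Literature.MathematicalPhysics.StatisticalMechanics.triangularVec₂ a + τ k + Literature.MathematicalPhysics.StatisticalMechanics.layerNormal (H k)} ∧ z ≠ (i : ℝ) • Literature.MathematicalPhysics.StatisticalMechanics.triangularVec₁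 a + (j : ℝ) • Literature.MathematicalPhysics.StatisticalMechanics.triangularVec₂ a + τ m + Literature.MathematicalPhysics.StatisticalMechanics.layerNormal (H m)} => Literature.MathematicalPhysics.StatisticalMechanics.lennardJones (dist ((i : ℝ) • Literature.MathematicalPhysics.StatisticalMechanics.triangularVec₁ a + (j : ℝ) • Literature.MathematicalPhysics.StatisticalMechanics.triangularVec₂ a + τ m + Literature.MathematicalPhysics.StatisticalMechanics.layerNormal (H m)) (z : EuclideanSpace ℝ (Fin 3)))) ∧ Summable (fun k : ℤ => if k = m then (0 : ℝ) else ∑' ij : ℤ × ℤ, Literature.MathematicalPhysics.StatisticalMechanics.lennardJones ‖(ij.1 : ℝ) • Literature.MathematicalPhysics.StatisticalMechanics.triangularVec₁ a + (ij.2 : ℝ) • Literature.MathematicalPhysics.StatisticalMechanics.triangularVec₂ a + (τ k - τ m) + Literature.MathematicalPhysics.StatisticalMechanics.layerNormal (H k - H m)‖) ∧ (∑' z : ↥{z : EuclideanSpace ℝ (Fin 3) | z ∈ {p : EuclideanSpace ℝ (Fin 3) | ∃ k i' j' : ℤ, p = (i' : ℝ) • Literature.MathematicalPhysics.StatisticalMechanics.triangularVec₁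 a + (j' : ℝ) • Literature.MathematicalPhysics.StatisticalMechanics.triangularVec₂ a + τ k + Literature.MathematicalPhysics.StatisticalMechanics.layerNormal (H k)} ∧ z ≠ (i : ℝ) • Literature.MathematicalPhysics.StatisticalMechanics.triangularVec₁ a + (j : ℝ) • Literature.MathematicalPhysics.StatisticalMechanics.triangularVec₂ a + τ m + Literature.MathematicalPhysics.StatisticalMechanics.layerNormal (H m)}, Literature.MathematicalPhysics.StatisticalMechanics.lennardJones (dist ((i : ℝ) • Literature.MathematicalPhysics.StatisticalMechanics.triangularVec₁ a + (j : ℝ) • Literature.MathematicalPhysics.StatisticalMechanics.triangularVec₂ a + τ m + Literature.MathematicalPhysics.StatisticalMechanics.layerNormal (H m)) (z : EuclideanSpace ℝ (Fin 3)))) = Literature.MathematicalPhysics.StatisticalMechanics.inLayerInteraction Literature.MathematicalPhysics.StatisticalMechanics.lennardJones a + ∑' k : ℤ, (if k = m then (0 : ℝ) else ∑' ij : ℤ × ℤ, Literature.MathematicalPhysics.StatisticalMechanics.lennardJones ‖(ij.1 : ℝ) • Literature.MathematicalPhysics.StatisticalMechanics.triangularVec₁ a + (ij.2 : ℝ) •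 Literature.MathematicalPhysics.StatisticalMechanics.triangularVec₂ a + (τ k - τ m) + Literature.MathematicalPhysics.StatisticalMechanics.layerNormal (H k - H m)‖) :=
  Summit.AtomisticToContinuum.Crystallization.Theorems.HcpLandscapeGapBirth.stub_slipSiteEnergy

/-- **SF — fibre decomposition of ball windows of laterally slipped layered sets** — LANDED p168715 (wave 5),
re-exported. -/
theorem stub_slipFibreDecomposition : ∃ C : ℝ, ∀ (a : ℝ), 47 / 50 ≤ a → a ≤ 1 → ∀ H : ℤ → ℝ, (∀ k : ℤ, 39 / 50 * a ≤ H (k + 1) - H k ∧ H (k + 1) - H k ≤ 17 / 20 * a) → ∀ τ : ℤ → EuclideanSpace ℝ (Fin 3), (∀ k : ℤ, τ k 2 = 0) → ∀ (c : EuclideanSpace ℝ (Fin 3)) (L : ℝ), 0 ≤ L → ∃ (F : Finset (ℤ × ℤ)) (M₁ M₂ : ℤ × ℤ → ℤ) (ι : ℤ × ℤ → ℤ → ℤ × ℤ), (F.card : ℝ) ≤ C * (L + 1) ^ 2 ∧ (∀ k : ℤ, Function.Injective (fun f : ℤ × ℤ => ι f k)) ∧ (∀ f ∈ F, ∀ k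 : ℤ, M₁ f ≤ k → k ≤ M₂ f → dist (((ι f k).1 : ℝ) • Literature.MathematicalPhysics.StatisticalMechanics.triangularVec₁ a + ((ι f k).2 : ℝ) • Literature.MathematicalPhysics.StatisticalMechanics.triangularVec₂ a + τ k + Literature.MathematicalPhysics.StatisticalMechanics.layerNormal (H k)) c ≤ L) ∧ (∀ k i j : ℤ, dist ((i : ℝ) • Literature.MathematicalPhysics.StatisticalMechanics.triangularVec₁ a + (j : ℝ) • Literature.MathematicalPhysics.StatisticalMechanics.triangularVec₂ a + τ k + Literature.MathematicalPhysics.StatisticalMechanics.layerNormal (H k)) c ≤ L → (∃ f ∈ F, M₁ f ≤ k ∧ k ≤ M₂ f ∧ ι f k = (i, j)) ∨ L - 5 < dist ((i : ℝ) • Literature.MathematicalPhysics.StatisticalMechanics.triangularVec₁ a + (j : ℝ) • Literature.MathematicalPhysics.StatisticalMechanics.triangularVec₂ a + τ k + Literature.MathematicalPhysics.StatisticalMechanics.layerNormal (H k)) c) :=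
  Summit.AtomisticToContinuum.Crystallization.Theorems.HcpLandscapeGapBirth.stub_slipFibreDecomposition

/-- **SE — for every `7/10`-separated set, the window sum of FULL site energies is `≤ 2𝓔(window) + C(L+1)²`**
(positive cross terms live in the depth-1 boundary layer) — LANDED p168772 (wave 5), re-exported. -/
theorem stub_windowEnergySeparated : ∃ C : ℝ, ∀ S : Set (EuclideanSpace ℝ (Fin 3)), (∀ p ∈ S, ∀ q ∈ S, p ≠ q → 7 / 10 ≤ dist p q) → ∀ (c : EuclideanSpace ℝ (Fin 3)) (L : ℝ), 0 ≤ L → ∀ (n : ℕ) (x : Fin n → EuclideanSpace ℝ (Fin 3)), Function.Injective x → Set.range x = {p : EuclideanSpace ℝ (Fin 3) | p ∈ S ∧ dist p c ≤ L} → ∑ t : Fin n, (∑' z : ↥{z : EuclideanSpace ℝ (Fin 3) | z ∈ S ∧ z ≠ x t}, Literature.MathematicalPhysics.StatisticalMechanics.lennardJones (dist (x t) (z : EuclideanSpace ℝ (Fin 3)))) ≤ 2 * Literature.MathematicalPhysics.StatisticalMechanics.interactionEnergy Literature.MathematicalPhysics.StatisticalMechanics.lennardJones x + C * (L + 1) ^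 2 :=
  Summit.AtomisticToContinuum.Crystallization.Theorems.HcpLandscapeGapBirth.stub_windowEnergySeparated

/-! ### Skeleton v14 (lead c6, end of session): wave 6 LANDED + the two certified-numerics stubs of T_slip REGISTERED

* slip-X1 `stub_slipFibreCharge` (worker, p169340): fibre charging with the lateral reason;
* slip-RG `stub_goodOfNoBadBondSlip` (worker, p169333): Good(4,θ) for slipped layered sets with no nearby fault / off spacing /
  off lateral deviation (bridge lemma `exists_cumulativeSlip`: slipped site = registered `barlowPosH` + cumulative deviation);
* S1 `stub_slipNearestModulus`, S2 `stub_slipFarHessian` — REGISTERED (stub-add), sorried below: the only certified-numerics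
  content of T_slip (see `Cruxes/HcpLandscapeGap/PLAN-T_slip.md` for the proof routes and the checked constants);
* SC `stub_slipColumn` (registered, sorried below): lead glue ⟸ S1 ∧ S2 ∧ RC, then the assembly follows
  `…RelaxedBarlowPricing.lean` with `WindowColumnSum.assembly` (abstract, landed in X5's file) and SE/SF/slip-X1/slip-X2. -/

/-- **slip-X1 — fibre charging with the lateral reason** — LANDED p169340 (wave 6), re-exported. -/
theorem stub_slipFibreCharge : ∀ (K : ℕ) (δ₁ : ℝ), 0 < δ₁ → ∀ (s : ℤ → ℤ) (H : ℤ → ℝ) (d : ℤ → ℝ) (a a' h : ℝ) (M₁ M₂ : ℤ), (Set.ncard {k : ℤ | M₁ ≤ k ∧ k ≤ M₂ ∧ (δ₁ < |a' - a| ∨ (∃ k' : ℤ, |k' - k| ≤ K ∧ s (k' + 1) = s k') ∨ (∃ k' : ℤ, |k' - k| ≤ K ∧ δ₁ < |H (k' + 1) - H k' - h|) ∨ (∃ k' : ℤ, |k' - k| ≤ K ∧ δ₁ < d k'))} : ℝ) ≤ (2 * K + 1) * (1 + δ₁⁻¹ ^ 2) * (∑ k ∈ Finset.Icc M₁ M₂,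 ((if s (k + 1) = s k then (1 : ℝ) else 0) + (a' - a) ^ 2 + (H (k + 1) - H k - h) ^ 2 + (d k) ^ 2)) + 6 * K * (2 * K + 1) :=
  Summit.AtomisticToContinuum.Crystallization.Theorems.HcpLandscapeGapBirth.stub_slipFibreCharge

/-- **slip-RG — Good of no nearby defect, slipped layered sets** — LANDED p169333 (wave 6), re-exported. -/
theorem stub_goodOfNoBadBondSlip : ∀ (a h : ℝ), 0 < a → 0 < h → ∀ θ : ℝ, 0 < θ → ∃ δ₁ : ℝ, 0 < δ₁ ∧ ∃ K : ℕ, ∀ a' : ℝ, |a' - a| ≤ δ₁ → ∀ s : ℤ → ℤ, Literature.MathematicalPhysics.StatisticalMechanics.IsHaggSeq s → ∀ H : ℤ → ℝ, (∀ k : ℤ, h / 2 ≤ H (k + 1) - H k) → ∀ τ : ℤ → EuclideanSpace ℝ (Fin 3), (∀ k : ℤ, τ k 2 = 0) → ∀ (p q : ℤ → ℤ) (m i j : ℤ), (∀ k : ℤ, |k - m| ≤ K → s (k + 1) ≠ s k) → (∀ k : ℤ, |k - m| ≤ K → |H (k + 1) - H k - h| ≤ δ₁) → (∀ k : ℤ,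 |k - m| ≤ K → ‖(τ (k + 1) - τ k) - ((s k : ℝ) • Literature.MathematicalPhysics.StatisticalMechanics.barlowOffset a' + (p k : ℝ) • Literature.MathematicalPhysics.StatisticalMechanics.triangularVec₁ a' + (q k : ℝ) • Literature.MathematicalPhysics.StatisticalMechanics.triangularVec₂ a')‖ ≤ δ₁) → ∃ A₂ : EuclideanSpace ℝ (Fin 3) →ₗᵢ[ℝ] EuclideanSpace ℝ (Fin 3), (∀ q' ∈ Literature.MathematicalPhysics.StatisticalMechanics.hcpStacking a h, ‖q'‖ ≤ 4 → ∃ z ∈ {x : EuclideanSpace ℝ (Fin 3) | ∃ k i' j' : ℤ, x = (i' : ℝ) • Literature.MathematicalPhysics.StatisticalMechanics.triangularVec₁ a' + (j' : ℝ) • Literature.MathematicalPhysics.StatisticalMechanics.triangularVec₂ a' + τ k + Literature.MathematicalPhysics.StatisticalMechanics.layerNormal (H k)}, dist z ((i : ℝ) • Literature.MathematicalPhysics.StatisticalMechanics.triangularVec₁ a' + (j : ℝ) • Literature.MathematicalPhysics.StatisticalMechanics.triangularVec₂ a' + τ m + Literature.MathematicalPhysics.StatisticalMechanics.layerNormal (H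 m)) ≤ 4 + θ ∧ dist z ((i : ℝ) • Literature.MathematicalPhysics.StatisticalMechanics.triangularVec₁ a' + (j : ℝ) • Literature.MathematicalPhysics.StatisticalMechanics.triangularVec₂ a' + τ m + Literature.MathematicalPhysics.StatisticalMechanics.layerNormal (H m) + A₂ q') ≤ θ) ∧ (∀ z ∈ {x : EuclideanSpace ℝ (Fin 3) | ∃ k i' j' : ℤ, x = (i' : ℝ) • Literature.MathematicalPhysics.StatisticalMechanics.triangularVec₁ a' + (j' : ℝ) • Literature.MathematicalPhysics.StatisticalMechanics.triangularVec₂ a' + τ k + Literature.MathematicalPhysics.StatisticalMechanics.layerNormal (H k)}, dist z ((i : ℝ) • Literature.MathematicalPhysics.StatisticalMechanics.triangularVec₁ a' + (j : ℝ) • Literature.MathematicalPhysics.StatisticalMechanics.triangularVec₂ a' + τ m + Literature.MathematicalPhysics.StatisticalMechanics.layerNormal (H m)) ≤ 4 → ∃ q' ∈ Literature.MathematicalPhysics.StatisticalMechanics.hcpStacking a h, dist z ((i : ℝ) • Literature.MathematicalPhysics.StatisticalMechanics.triangularVec₁ a' + (j : ℝ) • Literature.MathematicalPhysics.StatisticalMechanics.triangularVec₂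 a' + τ m + Literature.MathematicalPhysics.StatisticalMechanics.layerNormal (H m) + A₂ q') ≤ θ) :=
  Summit.AtomisticToContinuum.Crystallization.Theorems.HcpLandscapeGapBirth.stub_goodOfNoBadBondSlip

/-- **Stub S1 — global lateral modulus of the nearest-layer sum** (certified numerics, XL; registered).  For `a ∈ [47/50,1]`,
`t ∈ [39a/50, 17a/20]` and an in-plane offset `ξ` with nearest hollow point `σ•w + p•u + q•v` (`σ = ±1`), the general-offset
layer sum exceeds its hollow value `Φ_N(a,t) = layerInteraction LJ a t 1 1` by `≥ (1/10)·‖ξ − hollow‖²` (true worst value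
0.208 at a = 1, t = 0.85, bridge site; linear in `a⁻⁶`, so two endpoint certificates over (t/a, ξ/a) in 1/12 of the cell).
[difficulty: XL, computational] -/
theorem stub_slipNearestModulus : ∀ (a : ℝ), 47 / 50 ≤ a → a ≤ 1 → ∀ t : ℝ, 39 / 50 * a ≤ t → t ≤ 17 / 20 * a → ∀ ξ : EuclideanSpace ℝ (Fin 3), ξ 2 = 0 → ∀ (σ p q : ℤ), (σ = 1 ∨ σ = -1) → (∀ (σ' p' q' : ℤ), (σ' = 1 ∨ σ' = -1) → ‖ξ - ((σ : ℝ) • Literature.MathematicalPhysics.StatisticalMechanics.barlowOffset a + (p : ℝ) • Literature.MathematicalPhysics.StatisticalMechanics.triangularVec₁ a + (q : ℝ) • Literature.MathematicalPhysics.StatisticalMechanics.triangularVec₂ a)‖ ≤ ‖ξ - ((σ' : ℝ) • Literature.MathematicalPhysics.StatisticalMechanics.barlowOffset a + (p' : ℝ) • Literature.MathematicalPhysics.StatisticalMechanics.triangularVec₁ a + (q' : ℝ) • Literature.MathematicalPhysics.StatisticalMechanics.triangularVec₂ a)‖) → Literature.MathematicalPhysics.StatisticalMechanics.layerInteraction Literature.MathematicalPhysics.StatisticalMechanics.lennardJones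 a t 1 1 + (1 / 10) * ‖ξ - ((σ : ℝ) • Literature.MathematicalPhysics.StatisticalMechanics.barlowOffset a + (p : ℝ) • Literature.MathematicalPhysics.StatisticalMechanics.triangularVec₁ a + (q : ℝ) • Literature.MathematicalPhysics.StatisticalMechanics.triangularVec₂ a)‖ ^ 2 ≤ ∑' ij : ℤ × ℤ, Literature.MathematicalPhysics.StatisticalMechanics.lennardJones ‖(ij.1 : ℝ) • Literature.MathematicalPhysics.StatisticalMechanics.triangularVec₁ a + (ij.2 : ℝ) • Literature.MathematicalPhysics.StatisticalMechanics.triangularVec₂ a + ξ + Literature.MathematicalPhysics.StatisticalMechanics.layerNormal t‖ := by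
  sorry

/-! ### Skeleton v15 (lead c7, 2026-08-17): S2 is CUT into four pieces + a checked assembly; SC ⟸ SL ∧ RC (glue proved)

S2 (the far-layer lateral bound) is proved DERIVATIVE-FREE on the theta side: (RS) real-space lattice/rotation
symmetry of the general-offset layer sum `Ψ(a,t,ξ) = Σ_{ij} V_LJ ‖i u + j v + ξ + t e₃‖` and its Bernstein representation
`Ψ = ∫_0^∞ Θ(a,c,ξ) w(c) e^{-ct²} dc` (`w = lennardJonesDensity`, `Θ` the general-offset Gaussian layer sum); (POIS) the
Poisson/dual form of `Θ` (tree: `LayeredHull.reg_tsum_plane_poisson`) and the parametrisation of the dual lattice;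
(TRIG) the threefold second-order inequality on the dual side — for the 120° rotation `R`, `Σ_i [D(ξ₀+Rⁱε) − D(ξ₀)]` is
bounded in absolute value by `3π²‖ε‖²/a² · Σ_{w∈Λ*} ‖w‖² e^{-κ‖w‖²}` TERMWISE (`x₀+x₁+x₂ = 0` kills the linear term,
`|cos(φ+x) − cos φ + x sin φ| ≤ x²/2`, `Σ_i ⟨Rⁱε, w⟩² = (3/2)‖ε‖²‖w‖²`) — no gradients, no criticality argument beyond
`Ψ(ξ₀ + Rε) = Ψ(ξ₀ + ε)` for `ξ₀ ∈ ℤ w` (RS); (NUM) the certified constant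
`(2π³/(√3 a⁴)) ∫_0^∞ c⁻¹ |w(c)| e^{-ct²} S₂(π²/(a²c)) dc ≤ (39a/(50t))⁶` (first dual shell exactly + Gaussian tail, AM–GM
`e^{-A/c-θct²} ≤ e^{-2√(θA) t}`, closed-form Gamma integrals; margin ≈ ×2 at the corner `a = 47/50, t = 39a/25`).
The S2 constant is RESHAPED from `(1/300)(39a/(25t))⁶` to `(39a/(50t))⁶ = (1/64)(39a/(25t))⁶` (what the elementary
certificate affords; SC's lateral dominance survives: loss `2 Σ_{k≥2} k² k⁻⁶ = 2(ζ(4) − 1) ≈ 0.165 < 2μ = 0.2`).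
`slipFarHessian_of_pieces : RS → POIS → TRIG → NUM → S2` and `slipColumn_of_lateral_relaxed : SL → RC → SC` are PROVED
below; SL (`stub_slipLateral`, the lateral reduction) is registered and is to be landed as the conditional
`S1 → S2 → SL`.  The v4 composition through the sibling cruxes R (3062) / K (14476) is kept only as the sorry-free
conditionals `HcpLandscapeGap_of_hcpDefectCounting` / `HcpLandscapeGap_of_periodicReduction` (their sorried copies were
dropped from the skeleton: they are items of another route, not stubs of this line).  Registered open stubs after v15:
T, S1, RS, POIS, TRIG, NUM, SL. -/

/-- **Stub RS — real-space symmetry and Bernstein representation of the general-offset layer sum** (worker).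
(i) lattice translations of the offset do not change `Ψ`; (ii) for `ξ₀ ∈ ℤ w` the 120° rotation of the in-plane
deviation does not change `Ψ` (reindex `(i,j) ↦ (j, −i−j−σ)`); (iii) for in-plane `ξ`: summability, integrability and
`Ψ(a,t,ξ) = ∫_0^∞ Θ(a,c,ξ) w(c) e^{-ct²} dc` (pattern: `LayeredHull.reg_layerInteraction_eq_integral`,
`reg_hasSum_inv_pow_integral`, `reg_gauss_layer`). [size M] -/
theorem stub_slipLayerBernstein : ∀ (a t : ℝ), 0 < a → t ≠ 0 → (∀ (σ p q : ℤ) (ε : EuclideanSpace ℝ (Fin 3)), (∑' ij : ℤ × ℤ, Literature.MathematicalPhysics.StatisticalMechanics.lennardJones ‖(ij.1 : ℝ) • Literature.MathematicalPhysics.StatisticalMechanics.triangularVec₁ a + (ij.2 : ℝ) • Literature.MathematicalPhysics.StatisticalMechanics.triangularVec₂ a + (((σ : ℝ) • Literature.MathematicalPhysics.StatisticalMechanics.barlowOffset a + (p : ℝ) • Literature.MathematicalPhysics.StatisticalMechanics.triangularVec₁ a + (q : ℝ) • Literature.MathematicalPhysics.StatisticalMechanics.triangularVec₂ a) + ε)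 + Literature.MathematicalPhysics.StatisticalMechanics.layerNormal (t)‖) = (∑' ij : ℤ × ℤ, Literature.MathematicalPhysics.StatisticalMechanics.lennardJones ‖(ij.1 : ℝ) • Literature.MathematicalPhysics.StatisticalMechanics.triangularVec₁ a + (ij.2 : ℝ) • Literature.MathematicalPhysics.StatisticalMechanics.triangularVec₂ a + ((σ : ℝ) • Literature.MathematicalPhysics.StatisticalMechanics.barlowOffset a + ε) + Literature.MathematicalPhysics.StatisticalMechanics.layerNormal (t)‖)) ∧ (∀ (σ : ℤ) (ε : EuclideanSpace ℝ (Fin 3)), ε 2 = 0 → (∑' ij : ℤ × ℤ, Literature.MathematicalPhysics.StatisticalMechanics.lennardJones ‖(ij.1 : ℝ) • Literature.MathematicalPhysics.StatisticalMechanics.triangularVec₁ a + (ij.2 : ℝ) • Literature.MathematicalPhysics.StatisticalMechanics.triangularVec₂ a + ((σ : ℝ) • Literature.MathematicalPhysics.StatisticalMechanics.barlowOffset a + (!₂[-((ε) 0) / 2 - Real.sqrt 3 / 2 * (ε) 1, Real.sqrt 3 / 2 * (ε) 0 - (ε) 1 / 2, 0] : EuclideanSpace ℝ (Fin 3))) +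 Literature.MathematicalPhysics.StatisticalMechanics.layerNormal (t)‖) = (∑' ij : ℤ × ℤ, Literature.MathematicalPhysics.StatisticalMechanics.lennardJones ‖(ij.1 : ℝ) • Literature.MathematicalPhysics.StatisticalMechanics.triangularVec₁ a + (ij.2 : ℝ) • Literature.MathematicalPhysics.StatisticalMechanics.triangularVec₂ a + ((σ : ℝ) • Literature.MathematicalPhysics.StatisticalMechanics.barlowOffset a + ε) + Literature.MathematicalPhysics.StatisticalMechanics.layerNormal (t)‖)) ∧ (∀ ξ : EuclideanSpace ℝ (Fin 3), ξ 2 = 0 → Summable (fun ij : ℤ × ℤ => Literature.MathematicalPhysics.StatisticalMechanics.lennardJones ‖(ij.1 : ℝ) • Literature.MathematicalPhysics.StatisticalMechanics.triangularVec₁ a + (ij.2 : ℝ) • Literature.MathematicalPhysics.StatisticalMechanics.triangularVec₂ a + ξ + Literature.MathematicalPhysics.StatisticalMechanics.layerNormal (t)‖) ∧ (∀ c : ℝ, 0 < c → Summable (fun ij : ℤ × ℤ => Real.exp (-c * ‖(ij.1 : ℝ) • Literature.MathematicalPhysics.StatisticalMechanics.triangularVec₁ a + (ij.2 : ℝ)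 • Literature.MathematicalPhysics.StatisticalMechanics.triangularVec₂ a + ξ‖ ^ 2))) ∧ MeasureTheory.IntegrableOn (fun c : ℝ => (∑' ij : ℤ × ℤ, Real.exp (-(c) * ‖(ij.1 : ℝ) • Literature.MathematicalPhysics.StatisticalMechanics.triangularVec₁ a + (ij.2 : ℝ) • Literature.MathematicalPhysics.StatisticalMechanics.triangularVec₂ a + (ξ)‖ ^ 2)) * Literature.MathematicalPhysics.StatisticalMechanics.lennardJonesDensity c * Real.exp (-(c * t ^ 2))) (Set.Ioi 0) ∧ (∑' ij : ℤ × ℤ, Literature.MathematicalPhysics.StatisticalMechanics.lennardJones ‖(ij.1 : ℝ) • Literature.MathematicalPhysics.StatisticalMechanics.triangularVec₁ a + (ij.2 : ℝ) • Literature.MathematicalPhysics.StatisticalMechanics.triangularVec₂ a + (ξ) + Literature.MathematicalPhysics.StatisticalMechanics.layerNormal (t)‖) = ∫ c in Set.Ioi (0 : ℝ), (∑' ij : ℤ × ℤ, Real.exp (-(c) * ‖(ij.1 : ℝ) • Literature.MathematicalPhysics.StatisticalMechanics.triangularVec₁ a + (ij.2 : ℝ) • Literature.MathematicalPhysics.StatisticalMechanics.triangularVec₂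 a + (ξ)‖ ^ 2)) * Literature.MathematicalPhysics.StatisticalMechanics.lennardJonesDensity c * Real.exp (-(c * t ^ 2))) := by
  sorry

/-- **Stub POIS — the dual lattice and the Poisson form of the general-offset Gaussian layer sum** (worker).
The dual of the unit triangular lattice is `ℤ ξ₁ + ℤ ξ₂`, `ξ₁ = (1, −√3/3)`, `ξ₂ = (0, 2√3/3)`, with
`‖m ξ₁ + n ξ₂‖² = (4/3)(m² − mn + n²)`; and `Θ(a,c,ξ) = (2/√3)(π/(a²c)) Σ_{w∈Λ*} e^{-π²‖w‖²/(a²c)} cos(2π⟨ξ/a, w⟩)`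
(pattern: `LayeredHull.reg_tsum_plane_poisson`, `reg_mem_dual`, scaling `a`). [size M] -/
theorem stub_slipThetaPoisson : (∃ e : ℤ × ℤ ≃ ↥(Literature.Algebra.EuclideanLattices.dualLattice (Submodule.span ℤ (Set.range ⇑(basisOfLinearIndependentOfCardEqFinrank Summit.AtomisticToContinuum.Crystallization.Theorems.LayeredHull.reg_linearIndependent_plane Summit.AtomisticToContinuum.Crystallization.Theorems.LayeredHull.reg_card_eq_finrank_plane)))), ∀ mn : ℤ × ℤ, ((e mn : ↥(Literature.Algebra.EuclideanLattices.dualLattice (Submodule.span ℤ (Set.range ⇑(basisOfLinearIndependentOfCardEqFinrank Summit.AtomisticToContinuum.Crystallization.Theorems.LayeredHull.reg_linearIndependent_plane Summit.AtomisticToContinuum.Crystallization.Theorems.LayeredHull.reg_card_eq_finrank_plane))))) : EuclideanSpace ℝ (Fin 2)) = (mn.1 : ℝ) • (!₂[1, -(Real.sqrt 3 / 3)] : EuclideanSpace ℝ (Fin 2)) + (mn.2 : ℝ) • (!₂[0, 2 * Real.sqrt 3 / 3] : EuclideanSpace ℝ (Fin 2))) ∧ (∀ m n : ℤ, ‖(m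 : ℝ) • (!₂[1, -(Real.sqrt 3 / 3)] : EuclideanSpace ℝ (Fin 2)) + (n : ℝ) • (!₂[0, 2 * Real.sqrt 3 / 3] : EuclideanSpace ℝ (Fin 2))‖ ^ 2 = 4 / 3 * ((m : ℝ) ^ 2 - m * n + n ^ 2)) ∧ (∀ (a c : ℝ), 0 < a → 0 < c → ∀ ξ : EuclideanSpace ℝ (Fin 3), ξ 2 = 0 → Summable (fun w : ↥(Literature.Algebra.EuclideanLattices.dualLattice (Submodule.span ℤ (Set.range ⇑(basisOfLinearIndependentOfCardEqFinrank Summit.AtomisticToContinuum.Crystallization.Theorems.LayeredHull.reg_linearIndependent_plane Summit.AtomisticToContinuum.Crystallization.Theorems.LayeredHull.reg_card_eq_finrank_plane)))) => Real.exp (-((Real.pi ^ 2 / (a ^ 2 * c)) * ‖(w : EuclideanSpace ℝ (Fin 2))‖ ^ 2)) * Real.cos (2 * Real.pi * inner ℝ (a⁻¹ • (!₂[(ξ) 0, (ξ) 1] : EuclideanSpace ℝ (Fin 2))) (w : EuclideanSpace ℝ (Fin 2)))) ∧ (∑' ij : ℤ × ℤ, Real.exp (-(c) * ‖(ij.1 :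 ℝ) • Literature.MathematicalPhysics.StatisticalMechanics.triangularVec₁ a + (ij.2 : ℝ) • Literature.MathematicalPhysics.StatisticalMechanics.triangularVec₂ a + (ξ)‖ ^ 2)) = 2 / Real.sqrt 3 * (Real.pi / (a ^ 2 * c)) * (∑' w : ↥(Literature.Algebra.EuclideanLattices.dualLattice (Submodule.span ℤ (Set.range ⇑(basisOfLinearIndependentOfCardEqFinrank Summit.AtomisticToContinuum.Crystallization.Theorems.LayeredHull.reg_linearIndependent_plane Summit.AtomisticToContinuum.Crystallization.Theorems.LayeredHull.reg_card_eq_finrank_plane)))), Real.exp (-((Real.pi ^ 2 / (a ^ 2 * c)) * ‖(w : EuclideanSpace ℝ (Fin 2))‖ ^ 2)) * Real.cos (2 * Real.pi * inner ℝ ((a)⁻¹ • (!₂[(ξ) 0, (ξ) 1] : EuclideanSpace ℝ (Fin 2))) (w : EuclideanSpace ℝ (Fin 2))))) := by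
  sorry

/-- **Stub TRIG — the threefold second-order inequality on the dual side** (worker).  Termwise over the dual
lattice: with `φ = 2π⟨ξ₀/a, w⟩`, `x_i = 2π⟨Rⁱε/a, w⟩` (`x₀ + x₁ + x₂ = 0`, `Σ x_i² = (3/2)(2π/a)²‖ε‖²‖w‖²`),
`|Σ_i (cos(φ + x_i) − cos φ)| = |Σ_i (cos(φ+x_i) − cos φ + x_i sin φ)| ≤ Σ x_i²/2`. [size M] -/
theorem stub_dualThreefoldInequality : ∀ (a κ : ℝ), 0 < a → 0 < κ → ∀ (ξ₀ ε : EuclideanSpace ℝ (Fin 3)), Summable (fun w : ↥(Literature.Algebra.EuclideanLattices.dualLattice (Submodule.span ℤ (Set.range ⇑(basisOfLinearIndependentOfCardEqFinrank Summit.AtomisticToContinuum.Crystallization.Theorems.LayeredHull.reg_linearIndependent_plane Summit.AtomisticToContinuum.Crystallization.Theorems.LayeredHull.reg_card_eq_finrank_plane)))) => ‖(w : EuclideanSpace ℝ (Fin 2))‖ ^ 2 * Real.exp (-((κ) * ‖(w : EuclideanSpace ℝ (Fin 2))‖ ^ 2))) ∧ |(∑' w : ↥(Literature.Algebra.EuclideanLattices.dualLattice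 (Submodule.span ℤ (Set.range ⇑(basisOfLinearIndependentOfCardEqFinrank Summit.AtomisticToContinuum.Crystallization.Theorems.LayeredHull.reg_linearIndependent_plane Summit.AtomisticToContinuum.Crystallization.Theorems.LayeredHull.reg_card_eq_finrank_plane)))), Real.exp (-((κ) * ‖(w : EuclideanSpace ℝ (Fin 2))‖ ^ 2)) * Real.cos (2 * Real.pi * inner ℝ ((a)⁻¹ • (!₂[(ξ₀ + ε) 0, (ξ₀ + ε) 1] : EuclideanSpace ℝ (Fin 2))) (w : EuclideanSpace ℝ (Fin 2)))) + (∑' w : ↥(Literature.Algebra.EuclideanLattices.dualLattice (Submodule.span ℤ (Set.range ⇑(basisOfLinearIndependentOfCardEqFinrank Summit.AtomisticToContinuum.Crystallization.Theorems.LayeredHull.reg_linearIndependent_plane Summit.AtomisticToContinuum.Crystallization.Theorems.LayeredHull.reg_card_eq_finrank_plane)))), Real.exp (-((κ) * ‖(w : EuclideanSpace ℝ (Fin 2))‖ ^ 2)) * Real.cos (2 * Real.pi * inner ℝ ((a)⁻¹ • (!₂[(ξ₀ + (!₂[-((ε) 0) / 2 - Real.sqrt 3 / 2 * (ε) 1,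 Real.sqrt 3 / 2 * (ε) 0 - (ε) 1 / 2, 0] : EuclideanSpace ℝ (Fin 3))) 0, (ξ₀ + (!₂[-((ε) 0) / 2 - Real.sqrt 3 / 2 * (ε) 1, Real.sqrt 3 / 2 * (ε) 0 - (ε) 1 / 2, 0] : EuclideanSpace ℝ (Fin 3))) 1] : EuclideanSpace ℝ (Fin 2))) (w : EuclideanSpace ℝ (Fin 2)))) + (∑' w : ↥(Literature.Algebra.EuclideanLattices.dualLattice (Submodule.span ℤ (Set.range ⇑(basisOfLinearIndependentOfCardEqFinrank Summit.AtomisticToContinuum.Crystallization.Theorems.LayeredHull.reg_linearIndependent_plane Summit.AtomisticToContinuum.Crystallization.Theorems.LayeredHull.reg_card_eq_finrank_plane)))), Real.exp (-((κ) * ‖(w : EuclideanSpace ℝ (Fin 2))‖ ^ 2)) * Real.cos (2 * Real.pi * inner ℝ ((a)⁻¹ • (!₂[(ξ₀ + (!₂[-((ε) 0) / 2 + Real.sqrt 3 / 2 * (ε) 1, -(Real.sqrt 3 / 2 * (ε) 0) - (ε) 1 / 2, 0] : EuclideanSpace ℝ (Fin 3))) 0, (ξ₀ + (!₂[-((ε)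 0) / 2 + Real.sqrt 3 / 2 * (ε) 1, -(Real.sqrt 3 / 2 * (ε) 0) - (ε) 1 / 2, 0] : EuclideanSpace ℝ (Fin 3))) 1] : EuclideanSpace ℝ (Fin 2))) (w : EuclideanSpace ℝ (Fin 2)))) - 3 * (∑' w : ↥(Literature.Algebra.EuclideanLattices.dualLattice (Submodule.span ℤ (Set.range ⇑(basisOfLinearIndependentOfCardEqFinrank Summit.AtomisticToContinuum.Crystallization.Theorems.LayeredHull.reg_linearIndependent_plane Summit.AtomisticToContinuum.Crystallization.Theorems.LayeredHull.reg_card_eq_finrank_plane)))), Real.exp (-((κ) * ‖(w : EuclideanSpace ℝ (Fin 2))‖ ^ 2)) * Real.cos (2 * Real.pi * inner ℝ ((a)⁻¹ • (!₂[(ξ₀) 0, (ξ₀) 1] : EuclideanSpace ℝ (Fin 2))) (w : EuclideanSpace ℝ (Fin 2))))| ≤ 3 * Real.pi ^ 2 * ((ε 0) ^ 2 + (ε 1) ^ 2) / a ^ 2 * (∑' w : ↥(Literature.Algebra.EuclideanLattices.dualLattice (Submodule.span ℤ (Set.range ⇑(basisOfLinearIndependentOfCardEqFinrank Summit.AtomisticToContinuum.Crystallization.Theorems.LayeredHull.reg_linearIndependent_plane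 Summit.AtomisticToContinuum.Crystallization.Theorems.LayeredHull.reg_card_eq_finrank_plane)))), ‖(w : EuclideanSpace ℝ (Fin 2))‖ ^ 2 * Real.exp (-((κ) * ‖(w : EuclideanSpace ℝ (Fin 2))‖ ^ 2))) := by
  sorry

/-- **Stub NUM — the certified far-layer constant** (lead; elementary numerics: dual sum = first shell `8e^{-4κ/3}` +
Gaussian tail, AM–GM in `c`, Gamma integrals, `t`-decay from `e^{-2√(θA)(t−t₀)} ≤ (t₀/t)⁶`). [size L] -/
theorem stub_slipFarNumerics : ∀ (a : ℝ), 47 / 50 ≤ a → a ≤ 1 → ∀ t : ℝ, 39 / 25 * a ≤ t → MeasureTheory.IntegrableOn (fun c : ℝ => c⁻¹ * |Literature.MathematicalPhysics.StatisticalMechanics.lennardJonesDensity c| * Real.exp (-(c * t ^ 2)) * (∑' w : ↥(Literature.Algebra.EuclideanLattices.dualLattice (Submodule.span ℤ (Set.range ⇑(basisOfLinearIndependentOfCardEqFinrank Summit.AtomisticToContinuum.Crystallization.Theorems.LayeredHull.reg_linearIndependent_plane Summit.AtomisticToContinuum.Crystallization.Theorems.LayeredHull.reg_card_eq_finrank_plane)))),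 ‖(w : EuclideanSpace ℝ (Fin 2))‖ ^ 2 * Real.exp (-((Real.pi ^ 2 / (a ^ 2 * c)) * ‖(w : EuclideanSpace ℝ (Fin 2))‖ ^ 2)))) (Set.Ioi 0) ∧ 2 * Real.pi ^ 3 / (Real.sqrt 3 * a ^ 4) * ∫ c in Set.Ioi (0 : ℝ), c⁻¹ * |Literature.MathematicalPhysics.StatisticalMechanics.lennardJonesDensity c| * Real.exp (-(c * t ^ 2)) * (∑' w : ↥(Literature.Algebra.EuclideanLattices.dualLattice (Submodule.span ℤ (Set.range ⇑(basisOfLinearIndependentOfCardEqFinrank Summit.AtomisticToContinuum.Crystallization.Theorems.LayeredHull.reg_linearIndependent_plane Summit.AtomisticToContinuum.Crystallization.Theorems.LayeredHull.reg_card_eq_finrank_plane)))), ‖(w : EuclideanSpace ℝ (Fin 2))‖ ^ 2 * Real.exp (-((Real.pi ^ 2 / (a ^ 2 * c)) * ‖(w : EuclideanSpace ℝ (Fin 2))‖ ^ 2))) ≤ (39 / 50 * a / t) ^ 6 := by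
  sorry

/-- Elementary: a two-sided bound on `D` gives a lower bound on `P·D·w·e` for `P, e ≥ 0`. [folklore] -/
theorem aux_pointwise (P e D w M : ℝ) (hP : 0 ≤ P) (he : 0 ≤ e) (hD : |D| ≤ M) :
    -(P * M * |w| * e) ≤ P * D * w * e := by
  have h1 : -(M * |w|) ≤ D * w := by
    have h2 : -(|D| * |w|) ≤ D * w := by
      rw [← abs_mul]; exact neg_abs_le _
    nlinarith [abs_nonneg w]
  have h3 : 0 ≤ P * e := mul_nonneg hP he
  nlinarith

open MeasureTheory Set Real in
open Literature.MathematicalPhysics.StatisticalMechanics Literature.Algebra.EuclideanLattices in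
/-- **Assembly of S2' from the pieces** RS (real-space symmetry + Bernstein), POIS (Poisson), TRIG (threefold
dual-side inequality) and NUM (the certified constant).  No `sorry`. -/
theorem slipFarHessian_of_pieces (hRS : (∀ (a t : ℝ), 0 < a → t ≠ 0 → (∀ (σ p q : ℤ) (ε : EuclideanSpace ℝ (Fin 3)), (∑' ij : ℤ × ℤ, Literature.MathematicalPhysics.StatisticalMechanics.lennardJones ‖(ij.1 : ℝ) • Literature.MathematicalPhysics.StatisticalMechanics.triangularVec₁ a + (ij.2 : ℝ) • Literature.MathematicalPhysics.StatisticalMechanics.triangularVec₂ a + (((σ : ℝ) • Literature.MathematicalPhysics.StatisticalMechanics.barlowOffset a + (p : ℝ) • Literature.MathematicalPhysics.StatisticalMechanics.triangularVec₁ a + (q : ℝ) • Literature.MathematicalPhysics.StatisticalMechanics.triangularVec₂ a) + ε) + Literature.MathematicalPhysics.StatisticalMechanics.layerNormal (t)‖) = (∑' ij : ℤ × ℤ, Literature.MathematicalPhysics.StatisticalMechanics.lennardJones ‖(ij.1 : ℝ) • Literature.MathematicalPhysics.StatisticalMechanics.triangularVec₁ a + (ij.2 : ℝ) • Literature.MathematicalPhysics.StatisticalMechanics.triangularVec₂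 a + ((σ : ℝ) • Literature.MathematicalPhysics.StatisticalMechanics.barlowOffset a + ε) + Literature.MathematicalPhysics.StatisticalMechanics.layerNormal (t)‖)) ∧ (∀ (σ : ℤ) (ε : EuclideanSpace ℝ (Fin 3)), ε 2 = 0 → (∑' ij : ℤ × ℤ, Literature.MathematicalPhysics.StatisticalMechanics.lennardJones ‖(ij.1 : ℝ) • Literature.MathematicalPhysics.StatisticalMechanics.triangularVec₁ a + (ij.2 : ℝ) • Literature.MathematicalPhysics.StatisticalMechanics.triangularVec₂ a + ((σ : ℝ) • Literature.MathematicalPhysics.StatisticalMechanics.barlowOffset a + (!₂[-((ε) 0) / 2 - Real.sqrt 3 / 2 * (ε) 1, Real.sqrt 3 / 2 * (ε) 0 - (ε) 1 / 2, 0] : EuclideanSpace ℝ (Fin 3))) + Literature.MathematicalPhysics.StatisticalMechanics.layerNormal (t)‖) = (∑' ij : ℤ × ℤ, Literature.MathematicalPhysics.StatisticalMechanics.lennardJones ‖(ij.1 : ℝ) • Literature.MathematicalPhysics.StatisticalMechanics.triangularVec₁ a + (ij.2 : ℝ) • Literature.MathematicalPhysics.StatisticalMechanics.triangularVec₂ a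 + ((σ : ℝ) • Literature.MathematicalPhysics.StatisticalMechanics.barlowOffset a + ε) + Literature.MathematicalPhysics.StatisticalMechanics.layerNormal (t)‖)) ∧ (∀ ξ : EuclideanSpace ℝ (Fin 3), ξ 2 = 0 → Summable (fun ij : ℤ × ℤ => Literature.MathematicalPhysics.StatisticalMechanics.lennardJones ‖(ij.1 : ℝ) • Literature.MathematicalPhysics.StatisticalMechanics.triangularVec₁ a + (ij.2 : ℝ) • Literature.MathematicalPhysics.StatisticalMechanics.triangularVec₂ a + ξ + Literature.MathematicalPhysics.StatisticalMechanics.layerNormal (t)‖) ∧ (∀ c : ℝ, 0 < c → Summable (fun ij : ℤ × ℤ => Real.exp (-c * ‖(ij.1 : ℝ) • Literature.MathematicalPhysics.StatisticalMechanics.triangularVec₁ a + (ij.2 : ℝ) • Literature.MathematicalPhysics.StatisticalMechanics.triangularVec₂ a + ξ‖ ^ 2))) ∧ MeasureTheory.IntegrableOn (fun c : ℝ => (∑' ij : ℤ × ℤ, Real.exp (-(c) * ‖(ij.1 : ℝ) • Literature.MathematicalPhysics.StatisticalMechanics.triangularVec₁ a + (ij.2 : ℝ) • Literature.MathematicalPhysics.StatisticalMechanics.triangularVec₂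 a + (ξ)‖ ^ 2)) * Literature.MathematicalPhysics.StatisticalMechanics.lennardJonesDensity c * Real.exp (-(c * t ^ 2))) (Set.Ioi 0) ∧ (∑' ij : ℤ × ℤ, Literature.MathematicalPhysics.StatisticalMechanics.lennardJones ‖(ij.1 : ℝ) • Literature.MathematicalPhysics.StatisticalMechanics.triangularVec₁ a + (ij.2 : ℝ) • Literature.MathematicalPhysics.StatisticalMechanics.triangularVec₂ a + (ξ) + Literature.MathematicalPhysics.StatisticalMechanics.layerNormal (t)‖) = ∫ c in Set.Ioi (0 : ℝ), (∑' ij : ℤ × ℤ, Real.exp (-(c) * ‖(ij.1 : ℝ) • Literature.MathematicalPhysics.StatisticalMechanics.triangularVec₁ a + (ij.2 : ℝ) • Literature.MathematicalPhysics.StatisticalMechanics.triangularVec₂ a + (ξ)‖ ^ 2)) * Literature.MathematicalPhysics.StatisticalMechanics.lennardJonesDensity c * Real.exp (-(c * t ^ 2))))) (hP : ((∃ e : ℤ × ℤ ≃ ↥(Literature.Algebra.EuclideanLattices.dualLattice (Submodule.span ℤ (Set.range ⇑(basisOfLinearIndependentOfCardEqFinrank Summit.AtomisticToContinuum.Crystallization.Theorems.LayeredHull.reg_linearIndependent_plane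 Summit.AtomisticToContinuum.Crystallization.Theorems.LayeredHull.reg_card_eq_finrank_plane)))), ∀ mn : ℤ × ℤ, ((e mn : ↥(Literature.Algebra.EuclideanLattices.dualLattice (Submodule.span ℤ (Set.range ⇑(basisOfLinearIndependentOfCardEqFinrank Summit.AtomisticToContinuum.Crystallization.Theorems.LayeredHull.reg_linearIndependent_plane Summit.AtomisticToContinuum.Crystallization.Theorems.LayeredHull.reg_card_eq_finrank_plane))))) : EuclideanSpace ℝ (Fin 2)) = (mn.1 : ℝ) • (!₂[1, -(Real.sqrt 3 / 3)] : EuclideanSpace ℝ (Fin 2)) + (mn.2 : ℝ) • (!₂[0, 2 * Real.sqrt 3 / 3] : EuclideanSpace ℝ (Fin 2))) ∧ (∀ m n : ℤ, ‖(m : ℝ) • (!₂[1, -(Real.sqrt 3 / 3)] : EuclideanSpace ℝ (Fin 2)) + (n : ℝ) • (!₂[0, 2 * Real.sqrt 3 / 3] : EuclideanSpace ℝ (Fin 2))‖ ^ 2 = 4 / 3 * ((m : ℝ) ^ 2 - m * n + n ^ 2)) ∧ (∀ (a c : ℝ), 0 < a → 0 < c → ∀ ξ : EuclideanSpace ℝ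 (Fin 3), ξ 2 = 0 → Summable (fun w : ↥(Literature.Algebra.EuclideanLattices.dualLattice (Submodule.span ℤ (Set.range ⇑(basisOfLinearIndependentOfCardEqFinrank Summit.AtomisticToContinuum.Crystallization.Theorems.LayeredHull.reg_linearIndependent_plane Summit.AtomisticToContinuum.Crystallization.Theorems.LayeredHull.reg_card_eq_finrank_plane)))) => Real.exp (-((Real.pi ^ 2 / (a ^ 2 * c)) * ‖(w : EuclideanSpace ℝ (Fin 2))‖ ^ 2)) * Real.cos (2 * Real.pi * inner ℝ (a⁻¹ • (!₂[(ξ) 0, (ξ) 1] : EuclideanSpace ℝ (Fin 2))) (w : EuclideanSpace ℝ (Fin 2)))) ∧ (∑' ij : ℤ × ℤ, Real.exp (-(c) * ‖(ij.1 : ℝ) • Literature.MathematicalPhysics.StatisticalMechanics.triangularVec₁ a + (ij.2 : ℝ) • Literature.MathematicalPhysics.StatisticalMechanics.triangularVec₂ a + (ξ)‖ ^ 2)) = 2 / Real.sqrt 3 * (Real.pi / (a ^ 2 * c)) * (∑' w : ↥(Literature.Algebra.EuclideanLattices.dualLattice (Submodule.span ℤ (Set.range ⇑(basisOfLinearIndependentOfCardEqFinrank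 Summit.AtomisticToContinuum.Crystallization.Theorems.LayeredHull.reg_linearIndependent_plane Summit.AtomisticToContinuum.Crystallization.Theorems.LayeredHull.reg_card_eq_finrank_plane)))), Real.exp (-((Real.pi ^ 2 / (a ^ 2 * c)) * ‖(w : EuclideanSpace ℝ (Fin 2))‖ ^ 2)) * Real.cos (2 * Real.pi * inner ℝ ((a)⁻¹ • (!₂[(ξ) 0, (ξ) 1] : EuclideanSpace ℝ (Fin 2))) (w : EuclideanSpace ℝ (Fin 2))))))) (hT : (∀ (a κ : ℝ), 0 < a → 0 < κ → ∀ (ξ₀ ε : EuclideanSpace ℝ (Fin 3)), Summable (fun w : ↥(Literature.Algebra.EuclideanLattices.dualLattice (Submodule.span ℤ (Set.range ⇑(basisOfLinearIndependentOfCardEqFinrank Summit.AtomisticToContinuum.Crystallization.Theorems.LayeredHull.reg_linearIndependent_plane Summit.AtomisticToContinuum.Crystallization.Theorems.LayeredHull.reg_card_eq_finrank_plane)))) => ‖(w : EuclideanSpace ℝ (Fin 2))‖ ^ 2 * Real.exp (-((κ) * ‖(w : EuclideanSpace ℝ (Fin 2))‖ ^ 2))) ∧ |(∑' w : ↥(Literature.Algebra.EuclideanLattices.dualLattice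 (Submodule.span ℤ (Set.range ⇑(basisOfLinearIndependentOfCardEqFinrank Summit.AtomisticToContinuum.Crystallization.Theorems.LayeredHull.reg_linearIndependent_plane Summit.AtomisticToContinuum.Crystallization.Theorems.LayeredHull.reg_card_eq_finrank_plane)))), Real.exp (-((κ) * ‖(w : EuclideanSpace ℝ (Fin 2))‖ ^ 2)) * Real.cos (2 * Real.pi * inner ℝ ((a)⁻¹ • (!₂[(ξ₀ + ε) 0, (ξ₀ + ε) 1] : EuclideanSpace ℝ (Fin 2))) (w : EuclideanSpace ℝ (Fin 2)))) + (∑' w : ↥(Literature.Algebra.EuclideanLattices.dualLattice (Submodule.span ℤ (Set.range ⇑(basisOfLinearIndependentOfCardEqFinrank Summit.AtomisticToContinuum.Crystallization.Theorems.LayeredHull.reg_linearIndependent_plane Summit.AtomisticToContinuum.Crystallization.Theorems.LayeredHull.reg_card_eq_finrank_plane)))), Real.exp (-((κ) * ‖(w : EuclideanSpace ℝ (Fin 2))‖ ^ 2)) * Real.cos (2 * Real.pi * inner ℝ ((a)⁻¹ • (!₂[(ξ₀ + (!₂[-((ε) 0) / 2 - Real.sqrt 3 / 2 * (ε) 1,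 Real.sqrt 3 / 2 * (ε) 0 - (ε) 1 / 2, 0] : EuclideanSpace ℝ (Fin 3))) 0, (ξ₀ + (!₂[-((ε) 0) / 2 - Real.sqrt 3 / 2 * (ε) 1, Real.sqrt 3 / 2 * (ε) 0 - (ε) 1 / 2, 0] : EuclideanSpace ℝ (Fin 3))) 1] : EuclideanSpace ℝ (Fin 2))) (w : EuclideanSpace ℝ (Fin 2)))) + (∑' w : ↥(Literature.Algebra.EuclideanLattices.dualLattice (Submodule.span ℤ (Set.range ⇑(basisOfLinearIndependentOfCardEqFinrank Summit.AtomisticToContinuum.Crystallization.Theorems.LayeredHull.reg_linearIndependent_plane Summit.AtomisticToContinuum.Crystallization.Theorems.LayeredHull.reg_card_eq_finrank_plane)))), Real.exp (-((κ) * ‖(w : EuclideanSpace ℝ (Fin 2))‖ ^ 2)) * Real.cos (2 * Real.pi * inner ℝ ((a)⁻¹ • (!₂[(ξ₀ + (!₂[-((ε) 0) / 2 + Real.sqrt 3 / 2 * (ε) 1, -(Real.sqrt 3 / 2 * (ε) 0) - (ε) 1 / 2, 0] : EuclideanSpace ℝ (Fin 3))) 0, (ξ₀ + (!₂[-((ε)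 0) / 2 + Real.sqrt 3 / 2 * (ε) 1, -(Real.sqrt 3 / 2 * (ε) 0) - (ε) 1 / 2, 0] : EuclideanSpace ℝ (Fin 3))) 1] : EuclideanSpace ℝ (Fin 2))) (w : EuclideanSpace ℝ (Fin 2)))) - 3 * (∑' w : ↥(Literature.Algebra.EuclideanLattices.dualLattice (Submodule.span ℤ (Set.range ⇑(basisOfLinearIndependentOfCardEqFinrank Summit.AtomisticToContinuum.Crystallization.Theorems.LayeredHull.reg_linearIndependent_plane Summit.AtomisticToContinuum.Crystallization.Theorems.LayeredHull.reg_card_eq_finrank_plane)))), Real.exp (-((κ) * ‖(w : EuclideanSpace ℝ (Fin 2))‖ ^ 2)) * Real.cos (2 * Real.pi * inner ℝ ((a)⁻¹ • (!₂[(ξ₀) 0, (ξ₀) 1] : EuclideanSpace ℝ (Fin 2))) (w : EuclideanSpace ℝ (Fin 2))))| ≤ 3 * Real.pi ^ 2 * ((ε 0) ^ 2 + (ε 1) ^ 2) / a ^ 2 * (∑' w : ↥(Literature.Algebra.EuclideanLattices.dualLattice (Submodule.span ℤ (Set.range ⇑(basisOfLinearIndependentOfCardEqFinrank Summit.AtomisticToContinuum.Crystallization.Theorems.LayeredHull.reg_linearIndependent_plane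 Summit.AtomisticToContinuum.Crystallization.Theorems.LayeredHull.reg_card_eq_finrank_plane)))), ‖(w : EuclideanSpace ℝ (Fin 2))‖ ^ 2 * Real.exp (-((κ) * ‖(w : EuclideanSpace ℝ (Fin 2))‖ ^ 2))))) (hN : (∀ (a : ℝ), 47 / 50 ≤ a → a ≤ 1 → ∀ t : ℝ, 39 / 25 * a ≤ t → MeasureTheory.IntegrableOn (fun c : ℝ => c⁻¹ * |Literature.MathematicalPhysics.StatisticalMechanics.lennardJonesDensity c| * Real.exp (-(c * t ^ 2)) * (∑' w : ↥(Literature.Algebra.EuclideanLattices.dualLattice (Submodule.span ℤ (Set.range ⇑(basisOfLinearIndependentOfCardEqFinrank Summit.AtomisticToContinuum.Crystallization.Theorems.LayeredHull.reg_linearIndependent_plane Summit.AtomisticToContinuum.Crystallization.Theorems.LayeredHull.reg_card_eq_finrank_plane)))), ‖(w : EuclideanSpace ℝ (Fin 2))‖ ^ 2 * Real.exp (-((Real.pi ^ 2 / (a ^ 2 * c)) * ‖(w : EuclideanSpace ℝ (Fin 2))‖ ^ 2)))) (Set.Ioi 0) ∧ 2 * Real.pi ^ 3 / (Real.sqrt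 3 * a ^ 4) * ∫ c in Set.Ioi (0 : ℝ), c⁻¹ * |Literature.MathematicalPhysics.StatisticalMechanics.lennardJonesDensity c| * Real.exp (-(c * t ^ 2)) * (∑' w : ↥(Literature.Algebra.EuclideanLattices.dualLattice (Submodule.span ℤ (Set.range ⇑(basisOfLinearIndependentOfCardEqFinrank Summit.AtomisticToContinuum.Crystallization.Theorems.LayeredHull.reg_linearIndependent_plane Summit.AtomisticToContinuum.Crystallization.Theorems.LayeredHull.reg_card_eq_finrank_plane)))), ‖(w : EuclideanSpace ℝ (Fin 2))‖ ^ 2 * Real.exp (-((Real.pi ^ 2 / (a ^ 2 * c)) * ‖(w : EuclideanSpace ℝ (Fin 2))‖ ^ 2))) ≤ (39 / 50 * a / t) ^ 6)) : ∀ (a : ℝ), 47 / 50 ≤ a → a ≤ 1 → ∀ t : ℝ, 39 / 25 * a ≤ t → ∀ (σ p q : ℤ), (σ = 1 ∨ σ = -1 ∨ σ = 0) → ∀ ε : EuclideanSpace ℝ (Fin 3), ε 2 = 0 → (∑' ij : ℤ × ℤ, Literature.MathematicalPhysics.StatisticalMechanics.lennardJones ‖(ij.1 : ℝ) • Literature.MathematicalPhysics.StatisticalMechanics.triangularVec₁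 a + (ij.2 : ℝ) • Literature.MathematicalPhysics.StatisticalMechanics.triangularVec₂ a + (((σ : ℝ) • Literature.MathematicalPhysics.StatisticalMechanics.barlowOffset a + (p : ℝ) • Literature.MathematicalPhysics.StatisticalMechanics.triangularVec₁ a + (q : ℝ) • Literature.MathematicalPhysics.StatisticalMechanics.triangularVec₂ a)) + Literature.MathematicalPhysics.StatisticalMechanics.layerNormal (t)‖) - (39 / 50 * a / t) ^ 6 * ‖ε‖ ^ 2 ≤ (∑' ij : ℤ × ℤ, Literature.MathematicalPhysics.StatisticalMechanics.lennardJones ‖(ij.1 : ℝ) • Literature.MathematicalPhysics.StatisticalMechanics.triangularVec₁ a + (ij.2 : ℝ) • Literature.MathematicalPhysics.StatisticalMechanics.triangularVec₂ a + (((σ : ℝ) • Literature.MathematicalPhysics.StatisticalMechanics.barlowOffset a + (p : ℝ) • Literature.MathematicalPhysics.StatisticalMechanics.triangularVec₁ a + (q : ℝ) • Literature.MathematicalPhysics.StatisticalMechanics.triangularVec₂ a) + ε) + Literature.MathematicalPhysics.StatisticalMechanics.layerNormal (t)‖) := by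
  intro a ha1 ha2 t ht σ p q _hσ ε hε
  have ha : 0 < a := by linarith
  have ht0 : 0 < t := by nlinarith
  obtain ⟨htrans, hrot, hbern⟩ := hRS a t ha ht0.ne'
  obtain ⟨-, -, hPois⟩ := hP
  obtain ⟨hIN, hN'⟩ := hN a ha1 ha2 t ht
  -- notation
  set U : EuclideanSpace ℝ (Fin 3) := triangularVec₁ a with hU
  set V : EuclideanSpace ℝ (Fin 3) := triangularVec₂ a with hV
  set ξ₀ : EuclideanSpace ℝ (Fin 3) := (σ : ℝ) • barlowOffset a with hξ₀
  set Rε : EuclideanSpace ℝ (Fin 3) :=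
    !₂[-(ε 0) / 2 - Real.sqrt 3 / 2 * ε 1, Real.sqrt 3 / 2 * ε 0 - ε 1 / 2, 0] with hRε
  set R2ε : EuclideanSpace ℝ (Fin 3) :=
    !₂[-(ε 0) / 2 + Real.sqrt 3 / 2 * ε 1, -(Real.sqrt 3 / 2 * ε 0) - ε 1 / 2, 0] with hR2ε
  set K : ℝ := 2 * Real.pi ^ 3 / (Real.sqrt 3 * a ^ 4) with hK
  set S₂ : ℝ → ℝ := fun c => ∑' w : ↥(dualLattice (Submodule.span ℤ (Set.range
      ⇑(basisOfLinearIndependentOfCardEqFinrank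
        Summit.AtomisticToContinuum.Crystallization.Theorems.LayeredHull.reg_linearIndependent_plane
        Summit.AtomisticToContinuum.Crystallization.Theorems.LayeredHull.reg_card_eq_finrank_plane)))),
      ‖(w : EuclideanSpace ℝ (Fin 2))‖ ^ 2 *
        Real.exp (-(Real.pi ^ 2 / (a ^ 2 * c) * ‖(w : EuclideanSpace ℝ (Fin 2))‖ ^ 2)) with hS₂
  set Ψ : EuclideanSpace ℝ (Fin 3) → ℝ := fun ξ =>
    ∑' ij : ℤ × ℤ, lennardJones ‖(ij.1 : ℝ) • U + (ij.2 : ℝ) • V + ξ + layerNormal t‖ with hΨ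
  set Θ : ℝ → EuclideanSpace ℝ (Fin 3) → ℝ := fun c ξ =>
    ∑' ij : ℤ × ℤ, Real.exp (-c * ‖(ij.1 : ℝ) • U + (ij.2 : ℝ) • V + ξ‖ ^ 2) with hΘ
  -- Step 1: reduce to the offset ξ₀ = σ • w
  have e1 : Ψ (ξ₀ + (p : ℝ) • U + (q : ℝ) • V + ε) = Ψ (ξ₀ + ε) := htrans σ p q ε
  have e2 : Ψ (ξ₀ + (p : ℝ) • U + (q : ℝ) • V) = Ψ ξ₀ := by
    have := htrans σ p q 0
    simpa only [add_zero] using this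
  change Ψ (ξ₀ + (p : ℝ) • U + (q : ℝ) • V) - (39 / 50 * a / t) ^ 6 * ‖ε‖ ^ 2 ≤
    Ψ (ξ₀ + (p : ℝ) • U + (q : ℝ) • V + ε)
  rw [e1, e2]
  -- Step 2: the three rotated copies have the same energy
  have h3 : Real.sqrt 3 * Real.sqrt 3 = 3 := Real.mul_self_sqrt (by norm_num)
  have hRε2 : Rε 2 = 0 := by simp [hRε]
  have hR2ε2 : R2ε 2 = 0 := by simp [hR2ε]
  have hξ₀2 : ξ₀ 2 = 0 := by simp [hξ₀, barlowOffset]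
  have hrot1 : Ψ (ξ₀ + Rε) = Ψ (ξ₀ + ε) := hrot σ ε hε
  have hRR : (!₂[-(Rε 0) / 2 - Real.sqrt 3 / 2 * Rε 1, Real.sqrt 3 / 2 * Rε 0 - Rε 1 / 2, 0] :
      EuclideanSpace ℝ (Fin 3)) = R2ε := by
    ext i
    fin_cases i
    · simp [hRε, hR2ε]; linear_combination (-(ε 0) / 4) * h3
    · simp [hRε, hR2ε]; linear_combination (-(ε 1) / 4) * h3
    · simp [hRε, hR2ε]
  have hrot2 : Ψ (ξ₀ + R2ε) = Ψ (ξ₀ + ε) := by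
    have := hrot σ Rε hRε2
    rw [hRR] at this
    exact this.trans hrot1
  -- Step 3: Bernstein for the four offsets
  have in1 : (ξ₀ + ε) 2 = 0 := by simp [hξ₀2, hε]
  have in2 : (ξ₀ + Rε) 2 = 0 := by simp [hξ₀2, hRε2]
  have in3 : (ξ₀ + R2ε) 2 = 0 := by simp [hξ₀2, hR2ε2]
  obtain ⟨-, -, hI0, hE0⟩ := hbern ξ₀ hξ₀2
  obtain ⟨-, -, hI1, hE1⟩ := hbern (ξ₀ + ε) in1
  obtain ⟨-, -, hI2, hE2⟩ := hbern (ξ₀ + Rε) in2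
  obtain ⟨-, -, hI3, hE3⟩ := hbern (ξ₀ + R2ε) in3
  change Ψ ξ₀ = ∫ c in Ioi (0:ℝ), Θ c ξ₀ * lennardJonesDensity c * Real.exp (-(c * t ^ 2)) at hE0
  change Ψ (ξ₀ + ε) = ∫ c in Ioi (0:ℝ), Θ c (ξ₀ + ε) * lennardJonesDensity c * Real.exp (-(c * t ^ 2)) at hE1
  change Ψ (ξ₀ + Rε) = ∫ c in Ioi (0:ℝ), Θ c (ξ₀ + Rε) * lennardJonesDensity c * Real.exp (-(c * t ^ 2)) at hE2
  change Ψ (ξ₀ + R2ε) = ∫ c in Ioi (0:ℝ), Θ c (ξ₀ + R2ε) * lennardJonesDensity c * Real.exp (-(c * t ^ 2)) at hE3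
  change IntegrableOn (fun c => Θ c ξ₀ * lennardJonesDensity c * Real.exp (-(c * t ^ 2))) (Ioi 0) at hI0
  change IntegrableOn (fun c => Θ c (ξ₀ + ε) * lennardJonesDensity c * Real.exp (-(c * t ^ 2))) (Ioi 0) at hI1
  change IntegrableOn (fun c => Θ c (ξ₀ + Rε) * lennardJonesDensity c * Real.exp (-(c * t ^ 2))) (Ioi 0) at hI2
  change IntegrableOn (fun c => Θ c (ξ₀ + R2ε) * lennardJonesDensity c * Real.exp (-(c * t ^ 2))) (Ioi 0) at hI3
  -- Step 4: the combined integrand and its lower bound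
  set G : ℝ → ℝ := fun c => c⁻¹ * |lennardJonesDensity c| * Real.exp (-(c * t ^ 2)) * S₂ c with hG
  change IntegrableOn G (Ioi 0) at hIN
  change K * ∫ c in Ioi (0:ℝ), G c ≤ (39 / 50 * a / t) ^ 6 at hN'
  set F : ℝ → ℝ := fun c =>
    (Θ c (ξ₀ + ε) * lennardJonesDensity c * Real.exp (-(c * t ^ 2)) +
      Θ c (ξ₀ + Rε) * lennardJonesDensity c * Real.exp (-(c * t ^ 2)) +
      Θ c (ξ₀ + R2ε) * lennardJonesDensity c * Real.exp (-(c * t ^ 2))) -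
      3 * (Θ c ξ₀ * lennardJonesDensity c * Real.exp (-(c * t ^ 2))) with hF
  have hIF : IntegrableOn F (Ioi 0) := ((hI1.add hI2).add hI3).sub (hI0.const_mul 3)
  have hεn : ‖ε‖ ^ 2 = (ε 0) ^ 2 + (ε 1) ^ 2 := by
    rw [EuclideanSpace.norm_eq, Real.sq_sqrt (by positivity), Fin.sum_univ_three]
    simp [hε]
  obtain ⟨E2, hE2def⟩ : ∃ E : ℝ, E = (ε 0) ^ 2 + (ε 1) ^ 2 := ⟨_, rfl⟩
  have hpt : ∀ c ∈ Ioi (0 : ℝ), -(3 * E2 * K) * G c ≤ F c := by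
    intro c hc
    have hc0 : 0 < c := hc
    have hκ : 0 < Real.pi ^ 2 / (a ^ 2 * c) := by positivity
    obtain ⟨-, hTri⟩ := hT a (Real.pi ^ 2 / (a ^ 2 * c)) ha hκ ξ₀ ε
    have p0 := (hPois a c ha hc0 ξ₀ hξ₀2).2
    have p1 := (hPois a c ha hc0 (ξ₀ + ε) in1).2
    have p2 := (hPois a c ha hc0 (ξ₀ + Rε) in2).2
    have p3 := (hPois a c ha hc0 (ξ₀ + R2ε) in3).2
    rw [← hU, ← hV] at p0 p1 p2 p3
    change Θ c ξ₀ = _ at p0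
    change Θ c (ξ₀ + ε) = _ at p1
    change Θ c (ξ₀ + Rε) = _ at p2
    change Θ c (ξ₀ + R2ε) = _ at p3
    have hPc : 0 ≤ 2 / Real.sqrt 3 * (Real.pi / (a ^ 2 * c)) := by positivity
    have hexp : 0 ≤ Real.exp (-(c * t ^ 2)) := (Real.exp_pos _).le
    have key := aux_pointwise (2 / Real.sqrt 3 * (Real.pi / (a ^ 2 * c))) (Real.exp (-(c * t ^ 2))) _
      (lennardJonesDensity c) _ hPc hexp hTri
    simp only [hF, hG]
    rw [p0, p1, p2, p3]
    have hcK : 2 / Real.sqrt 3 * (Real.pi / (a ^ 2 * c)) * (3 * Real.pi ^ 2 * (ε 0 ^ 2 + ε 1 ^ 2) / a ^ 2 * S₂ c) =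
        3 * E2 * K * (c⁻¹ * S₂ c) := by
      simp only [hE2def, hK]
      field_simp
      try ring
    have lhs_eq : -(3 * E2 * K) * (c⁻¹ * |lennardJonesDensity c| * Real.exp (-(c * t ^ 2)) * S₂ c) =
        -(2 / Real.sqrt 3 * (Real.pi / (a ^ 2 * c)) * (3 * Real.pi ^ 2 * (ε 0 ^ 2 + ε 1 ^ 2) / a ^ 2 * S₂ c) *
          |lennardJonesDensity c| * Real.exp (-(c * t ^ 2))) := by
      rw [hcK]; ring
    rw [lhs_eq]
    refine key.trans (le_of_eq ?_)
    ring
  -- Step 5: integrate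
  have hmono : ∫ c in Ioi (0:ℝ), -(3 * E2 * K) * G c ≤ ∫ c in Ioi (0:ℝ), F c :=
    setIntegral_mono_on (hIN.const_mul _) hIF measurableSet_Ioi hpt
  have hlin : ∫ c in Ioi (0:ℝ), F c = (Ψ (ξ₀ + ε) + Ψ (ξ₀ + Rε) + Ψ (ξ₀ + R2ε)) - 3 * Ψ ξ₀ := by
    have s1 : ∫ c in Ioi (0:ℝ), F c =
        (∫ c in Ioi (0:ℝ), (Θ c (ξ₀ + ε) * lennardJonesDensity c * Real.exp (-(c * t ^ 2)) +
          Θ c (ξ₀ + Rε) * lennardJonesDensity c * Real.exp (-(c * t ^ 2)) +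
          Θ c (ξ₀ + R2ε) * lennardJonesDensity c * Real.exp (-(c * t ^ 2)))) -
        ∫ c in Ioi (0:ℝ), 3 * (Θ c ξ₀ * lennardJonesDensity c * Real.exp (-(c * t ^ 2))) :=
      integral_sub ((hI1.add hI2).add hI3) (hI0.const_mul 3)
    have s2 : ∫ c in Ioi (0:ℝ), (Θ c (ξ₀ + ε) * lennardJonesDensity c * Real.exp (-(c * t ^ 2)) +
          Θ c (ξ₀ + Rε) * lennardJonesDensity c * Real.exp (-(c * t ^ 2)) +
          Θ c (ξ₀ + R2ε) * lennardJonesDensity c * Real.exp (-(c * t ^ 2))) =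
        (∫ c in Ioi (0:ℝ), (Θ c (ξ₀ + ε) * lennardJonesDensity c * Real.exp (-(c * t ^ 2)) +
          Θ c (ξ₀ + Rε) * lennardJonesDensity c * Real.exp (-(c * t ^ 2)))) +
        ∫ c in Ioi (0:ℝ), Θ c (ξ₀ + R2ε) * lennardJonesDensity c * Real.exp (-(c * t ^ 2)) :=
      integral_add (hI1.add hI2) hI3
    have s3 : ∫ c in Ioi (0:ℝ), (Θ c (ξ₀ + ε) * lennardJonesDensity c * Real.exp (-(c * t ^ 2)) +
          Θ c (ξ₀ + Rε) * lennardJonesDensity c * Real.exp (-(c * t ^ 2))) =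
        (∫ c in Ioi (0:ℝ), Θ c (ξ₀ + ε) * lennardJonesDensity c * Real.exp (-(c * t ^ 2))) +
        ∫ c in Ioi (0:ℝ), Θ c (ξ₀ + Rε) * lennardJonesDensity c * Real.exp (-(c * t ^ 2)) :=
      integral_add hI1 hI2
    have s4 : ∫ c in Ioi (0:ℝ), 3 * (Θ c ξ₀ * lennardJonesDensity c * Real.exp (-(c * t ^ 2))) =
        3 * ∫ c in Ioi (0:ℝ), Θ c ξ₀ * lennardJonesDensity c * Real.exp (-(c * t ^ 2)) :=
      integral_const_mul _ _
    rw [s1, s2, s3, s4, ← hE0, ← hE1, ← hE2, ← hE3]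
  have s5 : ∫ c in Ioi (0:ℝ), -(3 * E2 * K) * G c = -(3 * E2 * K) * ∫ c in Ioi (0:ℝ), G c :=
    integral_const_mul _ _
  rw [s5, hlin, hrot1, hrot2] at hmono
  have hE2n : 0 ≤ E2 := by rw [hE2def]; positivity
  have h1 : E2 * (K * ∫ c in Ioi (0:ℝ), G c) ≤ E2 * (39 / 50 * a / t) ^ 6 :=
    mul_le_mul_of_nonneg_left hN' hE2n
  have h2 : -(3 * E2 * K) * (∫ c in Ioi (0:ℝ), G c) = -3 * (E2 * (K * ∫ c in Ioi (0:ℝ), G c)) := by ring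
  rw [hεn, ← hE2def]
  rw [h2] at hmono
  linarith

/-- **Stub S2 — second-order lateral bound at far layers** (RESHAPED v15: constant `(39a/(50t))⁶`; DERIVED from
RS, POIS, TRIG, NUM by `slipFarHessian_of_pieces`).  For `a ∈ [47/50,1]`, `t ≥ 39a/25`, a registered offset
`ξ₀ = σ•w + p•u + q•v` (`σ ∈ {0, ±1}`) and any in-plane `ε`: `Ψ(a,t,ξ₀+ε) ≥ Ψ(a,t,ξ₀) − (39a/(50t))⁶‖ε‖²`. -/
theorem stub_slipFarHessian : ∀ (a : ℝ), 47 / 50 ≤ a → a ≤ 1 → ∀ t : ℝ, 39 / 25 * a ≤ t → ∀ (σ p q : ℤ), (σ = 1 ∨ σ = -1 ∨ σ = 0) → ∀ ε : EuclideanSpace ℝ (Fin 3), ε 2 = 0 → (∑' ij : ℤ × ℤ, Literature.MathematicalPhysics.StatisticalMechanics.lennardJones ‖(ij.1 : ℝ) • Literature.MathematicalPhysics.StatisticalMechanics.triangularVec₁ a + (ij.2 : ℝ) • Literature.MathematicalPhysics.StatisticalMechanics.triangularVec₂ a + (((σ : ℝ) • Literature.MathematicalPhysics.StatisticalMechanics.barlowOffset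 a + (p : ℝ) • Literature.MathematicalPhysics.StatisticalMechanics.triangularVec₁ a + (q : ℝ) • Literature.MathematicalPhysics.StatisticalMechanics.triangularVec₂ a)) + Literature.MathematicalPhysics.StatisticalMechanics.layerNormal (t)‖) - (39 / 50 * a / t) ^ 6 * ‖ε‖ ^ 2 ≤ (∑' ij : ℤ × ℤ, Literature.MathematicalPhysics.StatisticalMechanics.lennardJones ‖(ij.1 : ℝ) • Literature.MathematicalPhysics.StatisticalMechanics.triangularVec₁ a + (ij.2 : ℝ) • Literature.MathematicalPhysics.StatisticalMechanics.triangularVec₂ a + (((σ : ℝ) • Literature.MathematicalPhysics.StatisticalMechanics.barlowOffset a + (p : ℝ) • Literature.MathematicalPhysics.StatisticalMechanics.triangularVec₁ a + (q : ℝ) • Literature.MathematicalPhysics.StatisticalMechanics.triangularVec₂ a) + ε) + Literature.MathematicalPhysics.StatisticalMechanics.layerNormal (t)‖) :=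
  slipFarHessian_of_pieces stub_slipLayerBernstein stub_slipThetaPoisson stub_dualThreefoldInequality
    stub_slipFarNumerics

/-- **Stub SL — the LATERAL REDUCTION** (registered; to be landed as the conditional `S1 → S2 → SL` by the
bookkeeping of PLAN-T_slip.md: nearest pairs by S1 (gain `μ = 1/10` per ordered nearest pair), span-`k` pairs by S2 at the
registered offset `(label difference)•w` (`≡ σ•w` mod the lattice, `3w = u+v`) with the cumulative deviation
`E = Σ_path ε_j`, `‖E‖² ≤ k Σ‖ε_j‖²`, loss `≤ k⁻⁶·k·Σ_path‖ε_j‖²` per ordered pair, `Σ_k 2k²k⁻⁶ = 2(ζ(4)−1) < 2μ`;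
exterior bonds `‖ε‖² ≤ a²/3`, column ends O(1)).  At fixed word `s`, heights `H` and slips `τ` with nearest-hollow data
`(s, p, q)`: `Σ_{m∈col} (registered site series) + g·Σ_{m∈col} ‖ξ_m − ref_m‖² ≤ Σ_{m∈col} (slipped site series) + C`.
[size L (given S1, S2)] -/
theorem stub_slipLateral : ∃ g : ℝ, 0 < g ∧ ∃ C : ℝ, ∀ a' : ℝ, 47 / 50 ≤ a' → a' ≤ 1 → ∀ s : ℤ → ℤ, Literature.MathematicalPhysics.StatisticalMechanics.IsHaggSeq s → ∀ H : ℤ → ℝ, (∀ k : ℤ, 39 / 50 * a' ≤ H (k + 1) - H k ∧ H (k + 1) - H k ≤ 17 / 20 * a') → ∀ τ : ℤ → EuclideanSpace ℝ (Fin 3), (∀ k : ℤ, τ k 2 = 0) → ∀ (p q : ℤ → ℤ), (∀ (k : ℤ) (σ' p' q' : ℤ), (σ' = 1 ∨ σ' = -1) → ‖(τ (k + 1) - τ k) - ((s k : ℝ) • Literature.MathematicalPhysics.StatisticalMechanics.barlowOffset a' + (p k : ℝ) • Literature.MathematicalPhysics.StatisticalMechanics.triangularVec₁ a' + (q k : ℝ)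 • Literature.MathematicalPhysics.StatisticalMechanics.triangularVec₂ a')‖ ≤ ‖(τ (k + 1) - τ k) - ((σ' : ℝ) • Literature.MathematicalPhysics.StatisticalMechanics.barlowOffset a' + (p' : ℝ) • Literature.MathematicalPhysics.StatisticalMechanics.triangularVec₁ a' + (q' : ℝ) • Literature.MathematicalPhysics.StatisticalMechanics.triangularVec₂ a')‖) → ∀ M₁ M₂ : ℤ, M₁ ≤ M₂ → (∑ m ∈ Finset.Icc M₁ M₂, (Literature.MathematicalPhysics.StatisticalMechanics.inLayerInteraction Literature.MathematicalPhysics.StatisticalMechanics.lennardJones a' + ∑' k : ℤ, (if k = m then (0 : ℝ) else Literature.MathematicalPhysics.StatisticalMechanics.layerInteraction Literature.MathematicalPhysics.StatisticalMechanics.lennardJones a' (H k - H m) (Literature.MathematicalPhysics.StatisticalMechanics.haggLabel s k - Literature.MathematicalPhysics.StatisticalMechanics.haggLabel s m) 1))) + g * (∑ m ∈ Finset.Icc M₁ M₂, ‖(τ (m + 1) - τ m) - ((s m : ℝ) • Literature.MathematicalPhysics.StatisticalMechanics.barlowOffset a' + (p m : ℝ) • Literature.MathematicalPhysics.StatisticalMechanics.triangularVec₁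 a' + (q m : ℝ) • Literature.MathematicalPhysics.StatisticalMechanics.triangularVec₂ a')‖ ^ 2) ≤ (∑ m ∈ Finset.Icc M₁ M₂, (Literature.MathematicalPhysics.StatisticalMechanics.inLayerInteraction Literature.MathematicalPhysics.StatisticalMechanics.lennardJones a' + ∑' k : ℤ, (if k = m then (0 : ℝ) else ∑' ij : ℤ × ℤ, Literature.MathematicalPhysics.StatisticalMechanics.lennardJones ‖(ij.1 : ℝ) • Literature.MathematicalPhysics.StatisticalMechanics.triangularVec₁ a' + (ij.2 : ℝ) • Literature.MathematicalPhysics.StatisticalMechanics.triangularVec₂ a' + (τ k - τ m) + Literature.MathematicalPhysics.StatisticalMechanics.layerNormal (H k - H m)‖))) + C := by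
  sorry

/-- **SC from SL and RC**: the slip column inequality is the lateral reduction SL added to the relaxed column
inequality RC on the registered column (same word, same heights); `g = min g_SL g_RC`. No `sorry`. -/
theorem slipColumn_of_lateral_relaxed (hSL : (∃ g : ℝ, 0 < g ∧ ∃ C : ℝ, ∀ a' : ℝ, 47 / 50 ≤ a' → a' ≤ 1 → ∀ s : ℤ → ℤ, Literature.MathematicalPhysics.StatisticalMechanics.IsHaggSeq s → ∀ H : ℤ → ℝ, (∀ k : ℤ, 39 / 50 * a' ≤ H (k + 1) - H k ∧ H (k + 1) - H k ≤ 17 / 20 * a') → ∀ τ : ℤ → EuclideanSpace ℝ (Fin 3), (∀ k : ℤ, τ k 2 = 0) → ∀ (p q : ℤ → ℤ), (∀ (k : ℤ) (σ' p' q' : ℤ), (σ' = 1 ∨ σ' = -1) → ‖(τ (k + 1) - τ k) - ((s k : ℝ) • Literature.MathematicalPhysics.StatisticalMechanics.barlowOffset a' + (p k : ℝ) • Literature.MathematicalPhysics.StatisticalMechanics.triangularVec₁ a' + (q k : ℝ) • Literature.MathematicalPhysics.StatisticalMechanics.triangularVec₂ a')‖ ≤ ‖(τ (k + 1) - τ k)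 - ((σ' : ℝ) • Literature.MathematicalPhysics.StatisticalMechanics.barlowOffset a' + (p' : ℝ) • Literature.MathematicalPhysics.StatisticalMechanics.triangularVec₁ a' + (q' : ℝ) • Literature.MathematicalPhysics.StatisticalMechanics.triangularVec₂ a')‖) → ∀ M₁ M₂ : ℤ, M₁ ≤ M₂ → (∑ m ∈ Finset.Icc M₁ M₂, (Literature.MathematicalPhysics.StatisticalMechanics.inLayerInteraction Literature.MathematicalPhysics.StatisticalMechanics.lennardJones a' + ∑' k : ℤ, (if k = m then (0 : ℝ) else Literature.MathematicalPhysics.StatisticalMechanics.layerInteraction Literature.MathematicalPhysics.StatisticalMechanics.lennardJones a' (H k - H m) (Literature.MathematicalPhysics.StatisticalMechanics.haggLabel s k - Literature.MathematicalPhysics.StatisticalMechanics.haggLabel s m) 1))) + g * (∑ m ∈ Finset.Icc M₁ M₂, ‖(τ (m + 1) - τ m) - ((s m : ℝ) • Literature.MathematicalPhysics.StatisticalMechanics.barlowOffset a' + (p m : ℝ) • Literature.MathematicalPhysics.StatisticalMechanics.triangularVec₁ a' + (q m : ℝ) • Literature.MathematicalPhysics.StatisticalMechanics.triangularVec₂ a')‖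 ^ 2) ≤ (∑ m ∈ Finset.Icc M₁ M₂, (Literature.MathematicalPhysics.StatisticalMechanics.inLayerInteraction Literature.MathematicalPhysics.StatisticalMechanics.lennardJones a' + ∑' k : ℤ, (if k = m then (0 : ℝ) else ∑' ij : ℤ × ℤ, Literature.MathematicalPhysics.StatisticalMechanics.lennardJones ‖(ij.1 : ℝ) • Literature.MathematicalPhysics.StatisticalMechanics.triangularVec₁ a' + (ij.2 : ℝ) • Literature.MathematicalPhysics.StatisticalMechanics.triangularVec₂ a' + (τ k - τ m) + Literature.MathematicalPhysics.StatisticalMechanics.layerNormal (H k - H m)‖))) + C)) (hRC : (∀ (a h : ℝ) (ha : a ≠ 0) (hh : h ≠ 0), (9 / 10 < a ∧ a < 1 ∧ |h - a * Real.sqrt (2 / 3)| ≤ a / 100) → (∀ a' h' : ℝ, ∀ ha' : a' ≠ 0, ∀ hh' : h' ≠ 0, (9 / 10 < a' ∧ a' < 1 ∧ |h' - a' * Real.sqrt (2 / 3)| ≤ a' / 100) → (Literature.MathematicalPhysics.StatisticalMechanics.hcpPeriodicConfiguration ha hh).energyPerParticle Literature.MathematicalPhysics.StatisticalMechanics.lennardJones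 ≤ (Literature.MathematicalPhysics.StatisticalMechanics.hcpPeriodicConfiguration ha' hh').energyPerParticle Literature.MathematicalPhysics.StatisticalMechanics.lennardJones) → ∃ g : ℝ, 0 < g ∧ ∃ C : ℝ, ∀ a' : ℝ, 47 / 50 ≤ a' → a' ≤ 1 → ∀ s : ℤ → ℤ, Literature.MathematicalPhysics.StatisticalMechanics.IsHaggSeq s → ∀ H : ℤ → ℝ, (∀ k : ℤ, 39 / 50 * a' ≤ H (k + 1) - H k ∧ H (k + 1) - H k ≤ 17 / 20 * a') → ∀ M₁ M₂ : ℤ, M₁ ≤ M₂ → ((M₂ - M₁ + 1 : ℤ) : ℝ) * (2 * (Literature.MathematicalPhysics.StatisticalMechanics.hcpPeriodicConfiguration ha hh).energyPerParticle Literature.MathematicalPhysics.StatisticalMechanics.lennardJones) + g * (∑ m ∈ Finset.Icc M₁ M₂, ((if s (m + 1) = s m then (1 : ℝ) else 0) + (a' - a) ^ 2 + (H (m + 1) - H m - h) ^ 2)) ≤ (∑ m ∈ Finset.Icc M₁ M₂, (Literature.MathematicalPhysics.StatisticalMechanics.inLayerInteraction Literature.MathematicalPhysics.StatisticalMechanics.lennardJones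 a' + ∑' k : ℤ, (if k = m then (0 : ℝ) else Literature.MathematicalPhysics.StatisticalMechanics.layerInteraction Literature.MathematicalPhysics.StatisticalMechanics.lennardJones a' (H k - H m) (Literature.MathematicalPhysics.StatisticalMechanics.haggLabel s k - Literature.MathematicalPhysics.StatisticalMechanics.haggLabel s m) 1))) + C)) : ∀ (a h : ℝ) (ha : a ≠ 0) (hh : h ≠ 0), (9 / 10 < a ∧ a < 1 ∧ |h - a * Real.sqrt (2 / 3)| ≤ a / 100) → (∀ a' h' : ℝ, ∀ ha' : a' ≠ 0, ∀ hh' : h' ≠ 0, (9 / 10 < a' ∧ a' < 1 ∧ |h' - a' * Real.sqrt (2 / 3)| ≤ a' / 100) → (Literature.MathematicalPhysics.StatisticalMechanics.hcpPeriodicConfiguration ha hh).energyPerParticle Literature.MathematicalPhysics.StatisticalMechanics.lennardJones ≤ (Literature.MathematicalPhysics.StatisticalMechanics.hcpPeriodicConfiguration ha' hh').energyPerParticle Literature.MathematicalPhysics.StatisticalMechanics.lennardJones) → ∃ g : ℝ, 0 < g ∧ ∃ C : ℝ, ∀ a' : ℝ, 47 / 50 ≤ a' → a' ≤ 1 → ∀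 s : ℤ → ℤ, Literature.MathematicalPhysics.StatisticalMechanics.IsHaggSeq s → ∀ H : ℤ → ℝ, (∀ k : ℤ, 39 / 50 * a' ≤ H (k + 1) - H k ∧ H (k + 1) - H k ≤ 17 / 20 * a') → ∀ τ : ℤ → EuclideanSpace ℝ (Fin 3), (∀ k : ℤ, τ k 2 = 0) → ∀ (p q : ℤ → ℤ), (∀ (k : ℤ) (σ' p' q' : ℤ), (σ' = 1 ∨ σ' = -1) → ‖(τ (k + 1) - τ k) - ((s k : ℝ) • Literature.MathematicalPhysics.StatisticalMechanics.barlowOffset a' + (p k : ℝ) • Literature.MathematicalPhysics.StatisticalMechanics.triangularVec₁ a' + (q k : ℝ) • Literature.MathematicalPhysics.StatisticalMechanics.triangularVec₂ a')‖ ≤ ‖(τ (k + 1) - τ k) - ((σ' : ℝ) • Literature.MathematicalPhysics.StatisticalMechanics.barlowOffset a' + (p' : ℝ) • Literature.MathematicalPhysics.StatisticalMechanics.triangularVec₁ a' + (q' : ℝ) • Literature.MathematicalPhysics.StatisticalMechanics.triangularVec₂ a')‖) → ∀ M₁ M₂ : ℤ, M₁ ≤ M₂ → ((M₂ - M₁ +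 1 : ℤ) : ℝ) * (2 * (Literature.MathematicalPhysics.StatisticalMechanics.hcpPeriodicConfiguration ha hh).energyPerParticle Literature.MathematicalPhysics.StatisticalMechanics.lennardJones) + g * (∑ m ∈ Finset.Icc M₁ M₂, ((if s (m + 1) = s m then (1 : ℝ) else 0) + (a' - a) ^ 2 + (H (m + 1) - H m - h) ^ 2 + ‖(τ (m + 1) - τ m) - ((s m : ℝ) • Literature.MathematicalPhysics.StatisticalMechanics.barlowOffset a' + (p m : ℝ) • Literature.MathematicalPhysics.StatisticalMechanics.triangularVec₁ a' + (q m : ℝ) • Literature.MathematicalPhysics.StatisticalMechanics.triangularVec₂ a')‖ ^ 2)) ≤ (∑ m ∈ Finset.Icc M₁ M₂, (Literature.MathematicalPhysics.StatisticalMechanics.inLayerInteraction Literature.MathematicalPhysics.StatisticalMechanics.lennardJones a' + ∑' k : ℤ, (if k = m then (0 : ℝ) else ∑' ij : ℤ × ℤ, Literature.MathematicalPhysics.StatisticalMechanics.lennardJones ‖(ij.1 : ℝ) • Literature.MathematicalPhysics.StatisticalMechanics.triangularVec₁ a' + (ij.2 : ℝ) • Literature.MathematicalPhysics.StatisticalMechanics.triangularVec₂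 a' + (τ k - τ m) + Literature.MathematicalPhysics.StatisticalMechanics.layerNormal (H k - H m)‖))) + C := by
  intro a h ha hh hbox hmin
  obtain ⟨g₁, hg₁, C₁, hC₁⟩ := hSL
  obtain ⟨g₂, hg₂, C₂, hC₂⟩ := hRC a h ha hh hbox hmin
  refine ⟨min g₁ g₂, lt_min hg₁ hg₂, C₁ + C₂, ?_⟩
  intro a' ha1 ha2 s hs H hH τ hτ p q hnear M₁ M₂ hM
  have i₁ := hC₁ a' ha1 ha2 s hs H hH τ hτ p q hnear M₁ M₂ hM
  have i₂ := hC₂ a' ha1 ha2 s hs H hH M₁ M₂ hM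
  have hsplit : ∀ m ∈ Finset.Icc M₁ M₂,
      min g₁ g₂ * ((if s (m + 1) = s m then (1 : ℝ) else 0) + (a' - a) ^ 2 + (H (m + 1) - H m - h) ^ 2 +
        ‖(τ (m + 1) - τ m) - ((s m : ℝ) • Literature.MathematicalPhysics.StatisticalMechanics.barlowOffset a' +
          (p m : ℝ) • Literature.MathematicalPhysics.StatisticalMechanics.triangularVec₁ a' +
          (q m : ℝ) • Literature.MathematicalPhysics.StatisticalMechanics.triangularVec₂ a')‖ ^ 2) ≤
      g₂ * ((if s (m + 1) = s m then (1 : ℝ) else 0) + (a' - a) ^ 2 + (H (m + 1) - H m - h) ^ 2) +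
      g₁ * ‖(τ (m + 1) - τ m) - ((s m : ℝ) • Literature.MathematicalPhysics.StatisticalMechanics.barlowOffset a' +
          (p m : ℝ) • Literature.MathematicalPhysics.StatisticalMechanics.triangularVec₁ a' +
          (q m : ℝ) • Literature.MathematicalPhysics.StatisticalMechanics.triangularVec₂ a')‖ ^ 2 := by
    intro m _
    have h1 : min g₁ g₂ ≤ g₁ := min_le_left _ _
    have h2 : min g₁ g₂ ≤ g₂ := min_le_right _ _
    have hA : 0 ≤ (if s (m + 1) = s m then (1 : ℝ) else 0) + (a' - a) ^ 2 + (H (m + 1) - H m - h) ^ 2 := by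
      have : 0 ≤ (if s (m + 1) = s m then (1 : ℝ) else 0) := by split_ifs <;> norm_num
      positivity
    have hB : 0 ≤ ‖(τ (m + 1) - τ m) - ((s m : ℝ) • Literature.MathematicalPhysics.StatisticalMechanics.barlowOffset a' +
          (p m : ℝ) • Literature.MathematicalPhysics.StatisticalMechanics.triangularVec₁ a' +
          (q m : ℝ) • Literature.MathematicalPhysics.StatisticalMechanics.triangularVec₂ a')‖ ^ 2 := by positivity
    nlinarith [mul_le_mul_of_nonneg_right h1 hB, mul_le_mul_of_nonneg_right h2 hA]
  have hsum : min g₁ g₂ * (∑ m ∈ Finset.Icc M₁ M₂, ((if s (m + 1) = s m then (1 : ℝ) else 0) + (a' - a) ^ 2 +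
        (H (m + 1) - H m - h) ^ 2 +
        ‖(τ (m + 1) - τ m) - ((s m : ℝ) • Literature.MathematicalPhysics.StatisticalMechanics.barlowOffset a' +
          (p m : ℝ) • Literature.MathematicalPhysics.StatisticalMechanics.triangularVec₁ a' +
          (q m : ℝ) • Literature.MathematicalPhysics.StatisticalMechanics.triangularVec₂ a')‖ ^ 2)) ≤
      g₂ * (∑ m ∈ Finset.Icc M₁ M₂, ((if s (m + 1) = s m then (1 : ℝ) else 0) + (a' - a) ^ 2 +
        (H (m + 1) - H m - h) ^ 2)) +
      g₁ * (∑ m ∈ Finset.Icc M₁ M₂,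
        ‖(τ (m + 1) - τ m) - ((s m : ℝ) • Literature.MathematicalPhysics.StatisticalMechanics.barlowOffset a' +
          (p m : ℝ) • Literature.MathematicalPhysics.StatisticalMechanics.triangularVec₁ a' +
          (q m : ℝ) • Literature.MathematicalPhysics.StatisticalMechanics.triangularVec₂ a')‖ ^ 2) := by
    rw [Finset.mul_sum, Finset.mul_sum, Finset.mul_sum, ← Finset.sum_add_distrib]
    exact Finset.sum_le_sum hsplit
  linarith

/-- **Stub SC — the SLIP COLUMN INEQUALITY** (v15: DERIVED from SL and RC by `slipColumn_of_lateral_relaxed`). -/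
theorem stub_slipColumn : ∀ (a h : ℝ) (ha : a ≠ 0) (hh : h ≠ 0), (9 / 10 < a ∧ a < 1 ∧ |h - a * Real.sqrt (2 / 3)| ≤ a / 100) → (∀ a' h' : ℝ, ∀ ha' : a' ≠ 0, ∀ hh' : h' ≠ 0, (9 / 10 < a' ∧ a' < 1 ∧ |h' - a' * Real.sqrt (2 / 3)| ≤ a' / 100) → (Literature.MathematicalPhysics.StatisticalMechanics.hcpPeriodicConfiguration ha hh).energyPerParticle Literature.MathematicalPhysics.StatisticalMechanics.lennardJones ≤ (Literature.MathematicalPhysics.StatisticalMechanics.hcpPeriodicConfiguration ha' hh').energyPerParticle Literature.MathematicalPhysics.StatisticalMechanics.lennardJones) → ∃ g : ℝ, 0 < g ∧ ∃ C : ℝ, ∀ a' : ℝ, 47 / 50 ≤ a' → a' ≤ 1 → ∀ s : ℤ → ℤ, Literature.MathematicalPhysics.StatisticalMechanics.IsHaggSeq s → ∀ H : ℤ → ℝ, (∀ k : ℤ, 39 / 50 * a' ≤ H (k + 1) - H k ∧ H (k + 1) - H k ≤ 17 / 20 * a') → ∀ τ : ℤ → EuclideanSpace ℝ (Fin 3),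 (∀ k : ℤ, τ k 2 = 0) → ∀ (p q : ℤ → ℤ), (∀ (k : ℤ) (σ' p' q' : ℤ), (σ' = 1 ∨ σ' = -1) → ‖(τ (k + 1) - τ k) - ((s k : ℝ) • Literature.MathematicalPhysics.StatisticalMechanics.barlowOffset a' + (p k : ℝ) • Literature.MathematicalPhysics.StatisticalMechanics.triangularVec₁ a' + (q k : ℝ) • Literature.MathematicalPhysics.StatisticalMechanics.triangularVec₂ a')‖ ≤ ‖(τ (k + 1) - τ k) - ((σ' : ℝ) • Literature.MathematicalPhysics.StatisticalMechanics.barlowOffset a' + (p' : ℝ) • Literature.MathematicalPhysics.StatisticalMechanics.triangularVec₁ a' + (q' : ℝ) • Literature.MathematicalPhysics.StatisticalMechanics.triangularVec₂ a')‖) → ∀ M₁ M₂ : ℤ, M₁ ≤ M₂ → ((M₂ - M₁ + 1 : ℤ) : ℝ) * (2 * (Literature.MathematicalPhysics.StatisticalMechanics.hcpPeriodicConfiguration ha hh).energyPerParticle Literature.MathematicalPhysics.StatisticalMechanics.lennardJones) + g * (∑ m ∈ Finset.Icc M₁ M₂, ((if s (m + 1) = s m then (1 : ℝ) else 0) + (a'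 - a) ^ 2 + (H (m + 1) - H m - h) ^ 2 + ‖(τ (m + 1) - τ m) - ((s m : ℝ) • Literature.MathematicalPhysics.StatisticalMechanics.barlowOffset a' + (p m : ℝ) • Literature.MathematicalPhysics.StatisticalMechanics.triangularVec₁ a' + (q m : ℝ) • Literature.MathematicalPhysics.StatisticalMechanics.triangularVec₂ a')‖ ^ 2)) ≤ (∑ m ∈ Finset.Icc M₁ M₂, (Literature.MathematicalPhysics.StatisticalMechanics.inLayerInteraction Literature.MathematicalPhysics.StatisticalMechanics.lennardJones a' + ∑' k : ℤ, (if k = m then (0 : ℝ) else ∑' ij : ℤ × ℤ, Literature.MathematicalPhysics.StatisticalMechanics.lennardJones ‖(ij.1 : ℝ) • Literature.MathematicalPhysics.StatisticalMechanics.triangularVec₁ a' + (ij.2 : ℝ) • Literature.MathematicalPhysics.StatisticalMechanics.triangularVec₂ a' + (τ k - τ m) + Literature.MathematicalPhysics.StatisticalMechanics.layerNormal (H k - H m)‖))) + C :=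
  slipColumn_of_lateral_relaxed stub_slipLateral stub_relaxedColumn

/-- **The relaxed cut, kernel-checked**: whoever proves the lift `T_relaxed → T` (pricing survives the remaining
relaxation content — in-plane/shear relaxation of the layers, elastic strain fields with the `r⁻⁶` tail, aperiodic /
local templates, the plastic far-from-multilattice part) closes T, hence the crux, once T_relaxed is landed (lead,
from RC/RS/RF/RG).  T_relaxed's statement is the hypothesis of the first argument, verbatim. -/
theorem templatedCoercivity_of_liftRelaxed : ((∀ (a h : ℝ) (ha : a ≠ 0) (hh : h ≠ 0), (9 / 10 < a ∧ a < 1 ∧ |h - a * Real.sqrt (2 / 3)| ≤ a / 100) → (∀ a' h' : ℝ, ∀ ha' : a' ≠ 0, ∀ hh' : h' ≠ 0, (9 / 10 < a' ∧ a' < 1 ∧ |h' - a' * Real.sqrt (2 / 3)| ≤ a' / 100) → (Literature.MathematicalPhysics.StatisticalMechanics.hcpPeriodicConfiguration ha hh).energyPerParticle Literature.MathematicalPhysics.StatisticalMechanics.lennardJones ≤ (Literature.MathematicalPhysics.StatisticalMechanics.hcpPeriodicConfiguration ha' hh').energyPerParticle Literature.MathematicalPhysics.StatisticalMechanics.lennardJones)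 → ∀ θ : ℝ, 0 < θ → ∃ κ : ℝ, 0 < κ ∧ ∃ C : ℝ, ∀ (a' : ℝ), 47 / 50 ≤ a' → a' ≤ 1 → ∀ s : ℤ → ℤ, Literature.MathematicalPhysics.StatisticalMechanics.IsHaggSeq s → ∀ H : ℤ → ℝ, (∀ k : ℤ, 39 / 50 * a' ≤ H (k + 1) - H k ∧ H (k + 1) - H k ≤ 17 / 20 * a') → ∀ (B : EuclideanSpace ℝ (Fin 3) →ₗᵢ[ℝ] EuclideanSpace ℝ (Fin 3)) (v c : EuclideanSpace ℝ (Fin 3)) (L : ℝ), 0 ≤ L → ∀ (n : ℕ) (x : Fin n → EuclideanSpace ℝ (Fin 3)), Function.Injective x → Set.range x = {y : EuclideanSpace ℝ (Fin 3) | y ∈ (fun w => v + B w) '' Literature.MathematicalPhysics.StatisticalMechanics.barlowStackingH a' H s ∧ dist y c ≤ L} → (n : ℝ) * (Literature.MathematicalPhysics.StatisticalMechanics.hcpPeriodicConfiguration ha hh).energyPerParticle Literature.MathematicalPhysics.StatisticalMechanics.lennardJones + κ * (Nat.card {i : Fin n // ¬ (∃ A : EuclideanSpace ℝ (Fin 3)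 →ₗᵢ[ℝ] EuclideanSpace ℝ (Fin 3), (∀ p ∈ (Literature.MathematicalPhysics.StatisticalMechanics.hcpPeriodicConfiguration ha hh).points, ‖p‖ ≤ 4 → ∃ j : Fin n, dist (x j) (x i + A p) ≤ θ) ∧ (∀ j : Fin n, dist (x j) (x i) ≤ 4 → ∃ p ∈ (Literature.MathematicalPhysics.StatisticalMechanics.hcpPeriodicConfiguration ha hh).points, dist (x j) (x i + A p) ≤ θ))} : ℝ) ≤ Literature.MathematicalPhysics.StatisticalMechanics.interactionEnergy Literature.MathematicalPhysics.StatisticalMechanics.lennardJones x + C * (L + 1) ^ 2) → ((∀ (a h : ℝ) (ha : a ≠ 0) (hh : h ≠ 0), (9 / 10 < a ∧ a < 1 ∧ |h - a * Real.sqrt (2 / 3)| ≤ a / 100) → (∀ a' h' : ℝ, ∀ ha' : a' ≠ 0, ∀ hh' : h' ≠ 0, (9 / 10 < a' ∧ a' < 1 ∧ |h' - a' * Real.sqrt (2 / 3)| ≤ a' / 100) → (Literature.MathematicalPhysics.StatisticalMechanics.hcpPeriodicConfiguration ha hh).energyPerParticle Literature.MathematicalPhysics.StatisticalMechanics.lennardJones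 ≤ (Literature.MathematicalPhysics.StatisticalMechanics.hcpPeriodicConfiguration ha' hh').energyPerParticle Literature.MathematicalPhysics.StatisticalMechanics.lennardJones) → (∀ δ θ : ℝ, 0 < δ → 0 < θ → ∃ κ : ℝ, 0 < κ ∧ ∃ C : ℝ, ∀ S : Set (EuclideanSpace ℝ (Fin 3)), Summit.AtomisticToContinuum.Crystallization.Theorems.HullExactificationCascadeRobustBarlowTemplate.Sep δ S → (∀ y ∈ S, Summit.AtomisticToContinuum.Crystallization.Theorems.HullExactificationCascadeRobustBarlowTemplate.Good S y) → (∃ s : ℤ → ℤ, Literature.MathematicalPhysics.StatisticalMechanics.IsHaggSeq s ∧ ∃ Φ : EuclideanSpace ℝ (Fin 3) → EuclideanSpace ℝ (Fin 3), Set.BijOn Φ (Summit.AtomisticToContinuum.Crystallization.Theorems.HullExactificationCascadeRobustBarlowTemplate.idealStacking s) S ∧ Summit.AtomisticToContinuum.Crystallization.Theorems.HullExactificationCascadeRobustBarlowTemplate.LocSim s Φ) → ∀ (c : EuclideanSpace ℝ (Fin 3)) (L : ℝ), 0 ≤ L → ∀ (n : ℕ) (x : Fin n → EuclideanSpace ℝ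 (Fin 3)), Function.Injective x → Set.range x = {y : EuclideanSpace ℝ (Fin 3) | y ∈ S ∧ dist y c ≤ L} → (n : ℝ) * (Literature.MathematicalPhysics.StatisticalMechanics.hcpPeriodicConfiguration ha hh).energyPerParticle Literature.MathematicalPhysics.StatisticalMechanics.lennardJones + κ * (Nat.card {i : Fin n // ¬ (∃ A : EuclideanSpace ℝ (Fin 3) →ₗᵢ[ℝ] EuclideanSpace ℝ (Fin 3), (∀ p ∈ (Literature.MathematicalPhysics.StatisticalMechanics.hcpPeriodicConfiguration ha hh).points, ‖p‖ ≤ 4 → ∃ j : Fin n, dist (x j) (x i + A p) ≤ θ) ∧ (∀ j : Fin n, dist (x j) (x i) ≤ 4 → ∃ p ∈ (Literature.MathematicalPhysics.StatisticalMechanics.hcpPeriodicConfiguration ha hh).points, dist (x j) (x i + A p) ≤ θ))} : ℝ) ≤ Literature.MathematicalPhysics.StatisticalMechanics.interactionEnergy Literature.MathematicalPhysics.StatisticalMechanics.lennardJones x + C * (L + 1) ^ 2)))) → (∀ (a h : ℝ) (ha : a ≠ 0) (hh : h ≠ 0), (9 / 10 < a ∧ a < 1 ∧ |h - a * Real.sqrt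 (2 / 3)| ≤ a / 100) → (∀ a' h' : ℝ, ∀ ha' : a' ≠ 0, ∀ hh' : h' ≠ 0, (9 / 10 < a' ∧ a' < 1 ∧ |h' - a' * Real.sqrt (2 / 3)| ≤ a' / 100) → (Literature.MathematicalPhysics.StatisticalMechanics.hcpPeriodicConfiguration ha hh).energyPerParticle Literature.MathematicalPhysics.StatisticalMechanics.lennardJones ≤ (Literature.MathematicalPhysics.StatisticalMechanics.hcpPeriodicConfiguration ha' hh').energyPerParticle Literature.MathematicalPhysics.StatisticalMechanics.lennardJones) → ∀ θ : ℝ, 0 < θ → ∃ κ : ℝ, 0 < κ ∧ ∃ C : ℝ, ∀ (a' : ℝ), 47 / 50 ≤ a' → a' ≤ 1 → ∀ s : ℤ → ℤ, Literature.MathematicalPhysics.StatisticalMechanics.IsHaggSeq s → ∀ H : ℤ → ℝ, (∀ k : ℤ, 39 / 50 * a' ≤ H (k + 1) - H k ∧ H (k + 1) - H k ≤ 17 / 20 * a') → ∀ (B : EuclideanSpace ℝ (Fin 3) →ₗᵢ[ℝ] EuclideanSpace ℝ (Fin 3)) (v c : EuclideanSpace ℝ (Fin 3)) (L : ℝ),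 0 ≤ L → ∀ (n : ℕ) (x : Fin n → EuclideanSpace ℝ (Fin 3)), Function.Injective x → Set.range x = {y : EuclideanSpace ℝ (Fin 3) | y ∈ (fun w => v + B w) '' Literature.MathematicalPhysics.StatisticalMechanics.barlowStackingH a' H s ∧ dist y c ≤ L} → (n : ℝ) * (Literature.MathematicalPhysics.StatisticalMechanics.hcpPeriodicConfiguration ha hh).energyPerParticle Literature.MathematicalPhysics.StatisticalMechanics.lennardJones + κ * (Nat.card {i : Fin n // ¬ (∃ A : EuclideanSpace ℝ (Fin 3) →ₗᵢ[ℝ] EuclideanSpace ℝ (Fin 3), (∀ p ∈ (Literature.MathematicalPhysics.StatisticalMechanics.hcpPeriodicConfiguration ha hh).points, ‖p‖ ≤ 4 → ∃ j : Fin n, dist (x j) (x i + A p) ≤ θ) ∧ (∀ j : Fin n, dist (x j) (x i) ≤ 4 → ∃ p ∈ (Literature.MathematicalPhysics.StatisticalMechanics.hcpPeriodicConfiguration ha hh).points, dist (x j) (x i + A p) ≤ θ))} : ℝ) ≤ Literature.MathematicalPhysics.StatisticalMechanics.interactionEnergy Literature.MathematicalPhysics.StatisticalMechanics.lennardJones x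 + C * (L + 1) ^ 2) → ((∀ (a h : ℝ) (ha : a ≠ 0) (hh : h ≠ 0), (9 / 10 < a ∧ a < 1 ∧ |h - a * Real.sqrt (2 / 3)| ≤ a / 100) → (∀ a' h' : ℝ, ∀ ha' : a' ≠ 0, ∀ hh' : h' ≠ 0, (9 / 10 < a' ∧ a' < 1 ∧ |h' - a' * Real.sqrt (2 / 3)| ≤ a' / 100) → (Literature.MathematicalPhysics.StatisticalMechanics.hcpPeriodicConfiguration ha hh).energyPerParticle Literature.MathematicalPhysics.StatisticalMechanics.lennardJones ≤ (Literature.MathematicalPhysics.StatisticalMechanics.hcpPeriodicConfiguration ha' hh').energyPerParticle Literature.MathematicalPhysics.StatisticalMechanics.lennardJones) → (∀ δ θ : ℝ, 0 < δ → 0 < θ → ∃ κ : ℝ, 0 < κ ∧ ∃ C : ℝ, ∀ S : Set (EuclideanSpace ℝ (Fin 3)), Summit.AtomisticToContinuum.Crystallization.Theorems.HullExactificationCascadeRobustBarlowTemplate.Sep δ S → (∀ y ∈ S, Summit.AtomisticToContinuum.Crystallization.Theorems.HullExactificationCascadeRobustBarlowTemplate.Good S y) → (∃ s : ℤ → ℤ,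 Literature.MathematicalPhysics.StatisticalMechanics.IsHaggSeq s ∧ ∃ Φ : EuclideanSpace ℝ (Fin 3) → EuclideanSpace ℝ (Fin 3), Set.BijOn Φ (Summit.AtomisticToContinuum.Crystallization.Theorems.HullExactificationCascadeRobustBarlowTemplate.idealStacking s) S ∧ Summit.AtomisticToContinuum.Crystallization.Theorems.HullExactificationCascadeRobustBarlowTemplate.LocSim s Φ) → ∀ (c : EuclideanSpace ℝ (Fin 3)) (L : ℝ), 0 ≤ L → ∀ (n : ℕ) (x : Fin n → EuclideanSpace ℝ (Fin 3)), Function.Injective x → Set.range x = {y : EuclideanSpace ℝ (Fin 3) | y ∈ S ∧ dist y c ≤ L} → (n : ℝ) * (Literature.MathematicalPhysics.StatisticalMechanics.hcpPeriodicConfiguration ha hh).energyPerParticle Literature.MathematicalPhysics.StatisticalMechanics.lennardJones + κ * (Nat.card {i : Fin n // ¬ (∃ A : EuclideanSpace ℝ (Fin 3) →ₗᵢ[ℝ] EuclideanSpace ℝ (Fin 3), (∀ p ∈ (Literature.MathematicalPhysics.StatisticalMechanics.hcpPeriodicConfiguration ha hh).points, ‖p‖ ≤ 4 → ∃ j : Fin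 n, dist (x j) (x i + A p) ≤ θ) ∧ (∀ j : Fin n, dist (x j) (x i) ≤ 4 → ∃ p ∈ (Literature.MathematicalPhysics.StatisticalMechanics.hcpPeriodicConfiguration ha hh).points, dist (x j) (x i + A p) ≤ θ))} : ℝ) ≤ Literature.MathematicalPhysics.StatisticalMechanics.interactionEnergy Literature.MathematicalPhysics.StatisticalMechanics.lennardJones x + C * (L + 1) ^ 2))) :=
  fun lift hrel => lift hrel

/-- **Stub T — templated defect-counting coercivity at the relaxed-hcp box minimiser** (NEW statement, not an
item; 14476 + 14477 restricted to injective enumerations `x` of windows `S ∩ B̄_L(c)` of admissible `S` —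
`Sep δ S`, every site `Good`, Barlow-templated through `idealStacking`/`LocSim` of
`HullExactificationCascadeRobustBarlowTemplateDefs`, definitionally B's own hypotheses — with an `O((L+1)²)`
allowance): for `(a,h)` minimising `e_LJ(hcp a h)` over B's box and `δ, θ > 0` there are `κ > 0`, `C` with
`n·e_LJ(hcp a h) + κ·#{i : ¬Good(4,θ,i)} ≤ 𝓔_LJ(x) + C(L+1)²` for all such windows (`Good(4,θ,i)` as in 14476,
relative to `x`).  [difficulty: XL / open — discrete nonlinear elasticity à la Friesecke–Theil in 3-D with the
`r⁻⁶` tail + stacking-fault localisation; implied by 14477 ∧ 14476 (`templatedCoercivity_of_hcpDefectCounting`)] -/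
theorem stub_templatedCoercivity : (∀ (a h : ℝ) (ha : a ≠ 0) (hh : h ≠ 0), (9 / 10 < a ∧ a < 1 ∧ |h - a * Real.sqrt (2 / 3)| ≤ a / 100) → (∀ a' h' : ℝ, ∀ ha' : a' ≠ 0, ∀ hh' : h' ≠ 0, (9 / 10 < a' ∧ a' < 1 ∧ |h' - a' * Real.sqrt (2 / 3)| ≤ a' / 100) → (Literature.MathematicalPhysics.StatisticalMechanics.hcpPeriodicConfiguration ha hh).energyPerParticle Literature.MathematicalPhysics.StatisticalMechanics.lennardJones ≤ (Literature.MathematicalPhysics.StatisticalMechanics.hcpPeriodicConfiguration ha' hh').energyPerParticle Literature.MathematicalPhysics.StatisticalMechanics.lennardJones) → (∀ δ θ : ℝ, 0 < δ → 0 < θ → ∃ κ : ℝ, 0 < κ ∧ ∃ C : ℝ, ∀ S : Set (EuclideanSpace ℝ (Fin 3)), Summit.AtomisticToContinuum.Crystallization.Theorems.HullExactificationCascadeRobustBarlowTemplate.Sep δ S → (∀ y ∈ S, Summit.AtomisticToContinuum.Crystallization.Theorems.HullExactificationCascadeRobustBarlowTemplate.Good S y) → (∃ s : ℤ → ℤ,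 Literature.MathematicalPhysics.StatisticalMechanics.IsHaggSeq s ∧ ∃ Φ : EuclideanSpace ℝ (Fin 3) → EuclideanSpace ℝ (Fin 3), Set.BijOn Φ (Summit.AtomisticToContinuum.Crystallization.Theorems.HullExactificationCascadeRobustBarlowTemplate.idealStacking s) S ∧ Summit.AtomisticToContinuum.Crystallization.Theorems.HullExactificationCascadeRobustBarlowTemplate.LocSim s Φ) → ∀ (c : EuclideanSpace ℝ (Fin 3)) (L : ℝ), 0 ≤ L → ∀ (n : ℕ) (x : Fin n → EuclideanSpace ℝ (Fin 3)), Function.Injective x → Set.range x = {y : EuclideanSpace ℝ (Fin 3) | y ∈ S ∧ dist y c ≤ L} → (n : ℝ) * (Literature.MathematicalPhysics.StatisticalMechanics.hcpPeriodicConfiguration ha hh).energyPerParticle Literature.MathematicalPhysics.StatisticalMechanics.lennardJones + κ * (Nat.card {i : Fin n // ¬ (∃ A : EuclideanSpace ℝ (Fin 3) →ₗᵢ[ℝ] EuclideanSpace ℝ (Fin 3), (∀ p ∈ (Literature.MathematicalPhysics.StatisticalMechanics.hcpPeriodicConfiguration ha hh).points, ‖p‖ ≤ 4 → ∃ j : Fin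 n, dist (x j) (x i + A p) ≤ θ) ∧ (∀ j : Fin n, dist (x j) (x i) ≤ 4 → ∃ p ∈ (Literature.MathematicalPhysics.StatisticalMechanics.hcpPeriodicConfiguration ha hh).points, dist (x j) (x i + A p) ≤ θ))} : ℝ) ≤ Literature.MathematicalPhysics.StatisticalMechanics.interactionEnergy Literature.MathematicalPhysics.StatisticalMechanics.lennardJones x + C * (L + 1) ^ 2)) := by
  sorry

/-- **The crux BY NAME from stub T alone** (alternative skeleton composition; landed glue p155072). -/
theorem HcpLandscapeGap_of_stubT :
    Summit.AtomisticToContinuum.Crystallization.Theses.HullExactificationCascade.HcpLandscapeGap :=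
  Summit.AtomisticToContinuum.Crystallization.Theorems.HcpLandscapeGapBirth.HcpLandscapeGap_of_templatedCoercivity
    stub_templatedCoercivity

end Summit.AtomisticToContinuum.Crystallization.Cruxes.HcpLandscapeGap.Birth
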